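/-
Copyright: cell `langlands-arthur-audit` (papers/Langlands/langlands-arthur-audit), unit `pub-arthur-down-g70`
(downstream tracer, gen 70).  Nineteenth file of the exact-support certificates of the downstream register (module M312 of the cell's MODULE-MAP — CLAIMed in
`lean/MODULE-MAP3.md` 2026-08-27T10:24Z).  `DownstreamSupport18.lean` (module M309, sections 160–170: the supports of tranches 158–168) stands at v10 = 164,917 B = 82.5 % of the
gate's 200,000-byte bound and is CLOSED; this file continues APPEND-ONLY in the same conventions and the same namespace `…Arthur2013.Downstream.Support`, importing
`…DownstreamSupport18` only (through it every earlier support file: the canonical readings `canon` (section 1), `canon₂` / `canon₅` (sections 2 / 5), `canon₁₁` / `canon₁₂`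
(sections 11 / 12), `canon₁₃` (section 13), `canon₃₅` / `canon₄₅` / `canon₅₄` / `canon₅₉` (sections 35, 45, 54, 59) with their `canon_implications…`, the tops `νtop` / `μtop` /
`κtop`, `κnoMok`, `bookInputs_top`, `mokInputs_top`, `kmswInputs_top`, `not_B_cm`, `not_M_cm`, `twelfth_kmsw_cm`, the carver's `LeafSupport` certificates; and the register head
`…Downstream46`, imported by `…DownstreamSupport18`).  A SUPPORT STATEMENT, as before, is a kernel-checked fact about the canonical (minimal) reading of a tranche: each typed
statement := exactly the conjunction of the register inputs its edges name; « at the top » = every atom of the three DAGs true; « countermodel of leaf l » = the carver's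
assignment in which every edge of the DAG holds, every other leaf holds and l fails.  Nothing of sections 1–170 is redeclared or changed.
v1 = section 171 (tranche 169, `Downstream46.lean` v3: NEW rows B142 Chang Huang, arXiv:2510.09975 (preprint 2025): Theorem 1.6 ⇐ the book ∧ row B115 ∧ row B6 as printed —
the 24 book leaves ∧ Mok's 29 leaves ∧ KMSW's proved scope —, Theorem 1.1 a control; C324 S. Tayou, Int. J. Number Theory 13 (2017): Théorème 1.2 ⇐ row C5 — the 24 book
leaves —, Théorème 1.3 a control).
v2 (unit `pub-arthur-down-g71`, downstream tracer gen 71) = section 172 appended (tranche 170, `Downstream46.lean` v4: NEW rows B143 C. Mœglin, Bull. Iranian Math. Soc. 43 (2017):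
Propositions 2.1–2.3 ⇐ the book ∧ row E41; C325 Conti – Lang – Medvedovsky, Math. Ann. 385 (2023): Theorem 12.8 ⇐ row C191, Theorems A–C a control; C326 D. Jiang, Bull. Iranian
Math. Soc. 43 (2017): Corollary 4.3 ⇐ the book — the 24 book leaves each; uses section 14's `canon₁₄` / `fourteenth_holds_top` and section 31's `canon₂₈` through the chain);
nothing of v1 redeclared or changed, no new import.
v3 (same unit) = section 173 appended (tranche 171, NEW `Downstream47.lean` v1 = module M313: NEW rows C327 D. Liu – B. Sun arXiv:1709.05762v3 (2025, preprint): Lemma 9.8 and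
Theorem 2.13 = 9.13 ⇐ Mok ∧ KMSW's proved scope ∧ rows C14 / C26 — Mok's 29 leaves ∧ KMSW's proved-scope leaves, no book leaf —; C328 X. Cheng arXiv:2311.00243 (2023, preprint):
Proposition 4.2 and Theorem 5.3 / Corollary 5.4 ⇐ the book ∧ rows C182 / C180 — the 24 book leaves —, Theorem A a control; uses sections 1 / 19 / 20's `canon₂` / `canon₁₉` / `canon₂₀`
and section 7's `scope_of_onlyFull`); ADDS `import …Downstream47` (the register's new head; `…DownstreamSupport18` imports only `…Downstream46`); nothing of v1 / v2 redeclared or changed.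
v4 (same unit) = section 174 appended (tranche 172, `Downstream47.lean` v2: NEW rows C329 Haining Wang arXiv:2204.06976 (2022, preprint): Theorem 24 ⇐ the four stabilisation leaves FL /
WFL_split / WFL_general / STF_Arthur EXACTLY (two-sided, `hwangJL_support` by `decide` on the carver's numerals; the Boolean `LeafSupport.Leaf.stabOrdB`), Theorem 4 ⇐ Theorem 24 ∧
rows C191 / C144 — the 24 book leaves —; C330 Emerton – Gee, Algebra Number Theory 9 (2015) = arXiv:1203.4963: Theorem 3 = 39 ⇐ Mok ∧ KMSW's proved scope as printed — Mok's 29 leaves ∧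
KMSW's proved-scope leaves, no book leaf —, Corollary 34 a control; uses section 31's `canon₂₈` and section 7's `scope_of_onlyFull`); no new import; nothing of v1 – v3 redeclared or changed.
v5 (same unit) = section 175 appended (tranche 173, `Downstream47.lean` v3: NEW row C331 A. Bertoloni Meli – M. Oi arXiv:2211.13864v3 (2025, preprint): the unitary instance of its
Theorem 3.8 ⇐ Mok ∧ KMSW's proved scope — Mok's 29 leaves ∧ KMSW's proved-scope leaves, no book leaf —, the SO_{2n+1} instance ⇐ the book ∧ row A5 — the 24 book leaves —, the GL_n
instance a control; uses section 1's `canon` and section 7's `scope_of_onlyFull`); no new import; nothing of v1 – v4 redeclared or changed.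
v6 (same unit) = section 176 appended (tranche 174, `Downstream47.lean` v4: NEW row C332 C. Schembri, Sheffield PhD thesis 2019: Theorems 4.4.3 / 4.4.4 ⇐ row C191 — the 24 book
leaves —, Theorems 3.2.4 / 3.3.1 a control; uses section 31's `canon₂₈`); no new import; nothing of v1 – v5 redeclared or changed.
v7 (unit `pub-arthur-down-g72`, downstream tracer gen 72) = section 177 appended (supports of tranche 175 = `Downstream47.lean` v5: NEW rows C333 Gan – Savin arXiv:2308.12561, C334 Castellano – Chen –
Darshan – Raghuram arXiv:2607.17617, C335 Helm – Kurinczuk – Skodlerack – Stevens arXiv:2405.13713v3, C336 Chang Yang arXiv:2312.10974; canonical reading over sections 1 / 3 / 14 / 15 / 38 / 60's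
bundles; exact supports: four book-only fields, one field reading the book ∧ Mok ∧ KMSW's proved scope through C158); nothing of v1 – v6 redeclared or changed, no new import.
v8 (same unit) = section 178 appended (supports of tranche 176 = NEW `Downstream48.lean` v1, module M314: NEW rows C337 Cauchi – Rodrigues Jacinto Doc. Math. 25 (2020), C338 Pollack
arXiv:2211.05280v2, C339 Cunningham – Dembélé arXiv:1705.03054, C340 H. Lu Math. Res. Lett. 27 (2020); canonical reading over sections 1 / 54's bundles; exact supports: all five Arthur-fed
fields book-only — the 24 book leaves, no Mok or KMSW leaf); ADDS `import …Downstream48` (the register's new head, which imports `…Downstream47`); nothing of v1 – v7 redeclared or changed.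
v9 (unit `pub-arthur-down-g73`, downstream tracer gen 73) = section 179 appended: supports of `Downstream48.lean` v2's tranche 177 (the class row B82's fourth typed member, I. Matić,
J. Algebra 444 (2015): `canon₁₇₇`, `c177_top`, `c177_book_cm`, `c177_regraded` over sections 18 / 50 / 54's `canon₁₄` / `canon₄₅` / `canon₅₀` / `canon₅₁`); nothing of v1 – v8 redeclared or changed, no new import.
v10 (unit `pub-arthur-down-g73`) = section 180 appended: supports of `Downstream48.lean` v3's tranche 178 (row C172, J. A. Thorne, Forum Math. Sigma 2 (2014) e16: `canon₁₇₈`, `canon₈₃T`,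
`canon_implications₁₇₈`, `c178_top`, `c178_book_cm`, `c178_mok_cm`, `c178_control`, `c178_regraded` over section 83's `canon₈₃W` (`…DownstreamSupport10`)); nothing of v1 – v9 redeclared or changed, no new import.
v11 (unit `pub-arthur-down-g73`) = section 181 appended: supports of `Downstream48.lean` v4's tranche 179 (row C102, H. Grobner arXiv:2608.15947v2: `canon₁₇₉`,
`canon_implications₁₇₉`, `c179_top`, `c179_book_cm`, `c179_mok_cm`, `c179_kmsw_cm`, `c179_kmsw_sequel_cm`, `c179_regraded` over section 1's `canon` and section 7's
`scope_of_onlyFull`); nothing of v1 – v10 redeclared or changed, no new import.  With v11 this file stands at ≈ 83 % of the bound and is CLOSED; section 182 opens `DownstreamSupport20.lean` (M315).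
-/
import HarnessLib
import Literature.NumberTheory.Automorphic.Arthur2013.DownstreamSupport18
import Literature.NumberTheory.Automorphic.Arthur2013.Downstream47
import Literature.NumberTheory.Automorphic.Arthur2013.Downstream48

set_option autoImplicit false

namespace Literature.NumberTheory.Automorphic.Arthur2013

namespace Downstream

namespace Support

/-! ## 171. Hundred-and-sixty-ninth tranche (v1 of this file, after `Downstream46.lean` v3; unit `pub-arthur-down-g70`, downstream tracer gen 70): supports of NEW rows B142 (Chang Huang,
arXiv:2510.09975, preprint 2025) and C324 (S. Tayou, Int. J. Number Theory 13 (2017) 1129–1144).  The canonical reading `canon₁₆₉ ν c c₁₂ c₅₉` over ARBITRARY tranche-1 / tranche-12 /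
tranche-59 assignments (read canonically below through `canon` (section 1: `ChenevierLannesStar` := the book at every rank), `canon₁₂` (section 12: `LLSantiTempered` := the book ∧ Mok ∧
KMSW's proved scope) and `canon₅₉` (section 59: `XuCuspidalSupport` := the book at every rank)): Theorem 1.1 and Théorème 1.3 (controls) := `True`; Theorem 1.6 := the book at every rank ∧
`c₅₉.XuCuspidalSupport` ∧ `c₁₂.LLSantiTempered`; Théorème 1.2 := `c.ChenevierLannesStar`.  Every tranche-169 edge holds in it (`canon_implications₁₆₉`).  READINGS: (i) AT THE TOP the bundle
holds and all four fields HOLD — B142's Theorem 1.6 delivered by the tranche's own `huang_of_leaves` from the canonical bundles of tranches 1, 5, 12, 59 and the top inputs of the three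
DAGs, C324's Théorème 1.2 by `tayou_of_inputs` (`c169_top`); (ii) BOOK SIDE: in each of the 24 book countermodels Theorem 1.6 and Théorème 1.2 both FAIL, the controls hold (`c169_book_cm`);
(iii) MOK SIDE: in each of Mok's 29 countermodels (book at the top, KMSW read `κnoMok`) Theorem 1.6 FAILS — through [LLS24, Theorem 5.9] typed as printed (all pure inner forms of classical
groups, unitary groups through Mok) — while Théorème 1.2 HOLDS (`c169_mok_cm`); (iv) KMSW SIDE: in KMSW's countermodel of a leaf `l ≠ MokMain` (book and Mok at the top) Theorem 1.6 holds iff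
`l` is a sequel-only leaf (`l.onlyFull = true`, by section 12's `twelfth_kmsw_cm`): KMSW's proved-scope leaves are load-bearing through B6, its sequels [KMS_A] / [KMS_B] are not; Théorème 1.2
holds (`c169_kmsw_cm`).  Supports, exact: support(B142 Thm 1.6) = support(B6 as printed) = the 24 book leaves ∧ Mok's 29 leaves ∧ KMSW's proved-scope leaves (a symplectic-only reading of
[LLS24, Thm 5.9] would cut it to the 24 book leaves — recorded in the register, not typed); support(C324 Thm 1.2) = support(C5) = the 24 book leaves; the two controls: ∅. -/

section Canon169

variable (ν : Nodes)

/-- The canonical reading of NEW rows B142 / C324 over arbitrary tranche-1, tranche-12 and tranche-59 assignments: Theorem 1.6 := the book at every rank ∧ B115's value ∧ B6's value (as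
printed); Théorème 1.2 := C5's value; Theorem 1.1, Théorème 1.3 := `True`. [cite: Huang2025TwistedOsborne, Thms 1.1, 1.6; Tayou2017ImagesGalois, Thms 1.2, 1.3 (canonical model; bookkeeping)] [claim: Huang2025TwistedOsborne, under-review] -/
abbrev canon₁₆₉ (c : Consumers) (c₁₂ : Consumers12) (c₅₉ : Consumers59) : Consumers169 where
  HuangTwistedOsborne := True
  HuangJacAntiTempered := (∀ N, ν.Everything N) ∧ c₅₉.XuCuspidalSupport ∧ c₁₂.LLSantiTempered
  TayouIrreducibility := c.ChenevierLannesStar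
  TayouImage := True

/-- Every hundred-and-sixty-ninth-tranche edge holds in the canonical reading, for arbitrary ν and arbitrary tranche-1 / 12 / 59 assignments. [cite: Huang2025TwistedOsborne, Thm 1.6; Tayou2017ImagesGalois, Thm 1.2 (bookkeeping proved here)] [claim: Huang2025TwistedOsborne, under-review] -/
theorem canon_implications₁₆₉ (c : Consumers) (c₁₂ : Consumers12) (c₅₉ : Consumers59) : Implications169 ν c c₁₂ c₅₉ (canon₁₆₉ ν c c₁₂ c₅₉) where
  huangOsborne := True.intro
  huangJac := fun b x s => ⟨b, x, s⟩
  tayouIrr := fun h => h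
  tayouImage := True.intro

end Canon169

/-- AT THE TOP (every leaf of the three DAGs granted; tranches 1, 12, 59 read canonically): the bundle holds and ALL FOUR fields of rows B142 / C324 HOLD — Theorem 1.6 by the tranche's
`huang_of_leaves` over the canonical bundles of tranches 1, 5, 12, 59 and `bookInputs_top` / `mokInputs_top` / `kmswInputs_top`, Théorème 1.2 by `tayou_of_inputs`. [cite: Huang2025TwistedOsborne, Thm 1.6; Tayou2017ImagesGalois, Thm 1.2 (bookkeeping proved here)] [claim: Huang2025TwistedOsborne, under-review] -/
theorem c169_top :
    Implications169 νtop (canon νtop μtop κtop) (canon₁₂ νtop μtop κtop) (canon₅₉ νtop μtop κtop) (canon₁₆₉ νtop (canon νtop μtop κtop) (canon₁₂ νtop μtop κtop) (canon₅₉ νtop μtop κtop)) ∧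
      (canon₁₆₉ νtop (canon νtop μtop κtop) (canon₁₂ νtop μtop κtop) (canon₅₉ νtop μtop κtop)).HuangTwistedOsborne ∧
      (canon₁₆₉ νtop (canon νtop μtop κtop) (canon₁₂ νtop μtop κtop) (canon₅₉ νtop μtop κtop)).HuangJacAntiTempered ∧
      (canon₁₆₉ νtop (canon νtop μtop κtop) (canon₁₂ νtop μtop κtop) (canon₅₉ νtop μtop κtop)).TayouIrreducibility ∧
      (canon₁₆₉ νtop (canon νtop μtop κtop) (canon₁₂ νtop μtop κtop) (canon₅₉ νtop μtop κtop)).TayouImage :=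
  have I := canon_implications νtop μtop κtop
  have Y := canon_implications₁₆₉ νtop (canon νtop μtop κtop) (canon₁₂ νtop μtop κtop) (canon₅₉ νtop μtop κtop)
  ⟨Y, True.intro,
    huang_of_leaves Y I (canon_implications₅ νtop μtop κtop) (canon_implications₁₂ νtop μtop κtop) (canon_implications₅₉ νtop μtop κtop) bookInputs_top mokInputs_top
      (kmswInputs_top μtop).1,
    tayou_of_inputs Y I bookInputs_top, True.intro⟩

/-- BOOK SIDE: in the book countermodel of ANY of the 24 leaves `l` (tranches 1, 12, 59 read canonically there; Mok / KMSW at the top) the bundle holds, Theorem 1.6 and Théorème 1.2 both FAIL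
and the two controls hold — every book leaf is load-bearing for B142 (through Π_ψ, B115 and B6 alike) and for C324 (through Chenevier – Lannes's starred statements). [cite: Huang2025TwistedOsborne, proof of Thm 1.6 (arXiv:2510.09975 p0005:L1-12); Tayou2017ImagesGalois, §3 (arXiv:1602.02272 p0005:L13) (separating models; bookkeeping proved here)] [claim: Huang2025TwistedOsborne, under-review] -/
theorem c169_book_cm (l : LeafSupport.Leaf) :
    ¬ (LeafSupport.mkN (LeafSupport.cm l)).leaf l ∧
      Implications169 (LeafSupport.mkN (LeafSupport.cm l)) (canon (LeafSupport.mkN (LeafSupport.cm l)) μtop κtop) (canon₁₂ (LeafSupport.mkN (LeafSupport.cm l)) μtop κtop) (canon₅₉ (LeafSupport.mkN (LeafSupport.cm l)) μtop κtop) (canon₁₆₉ (LeafSupport.mkN (LeafSupport.cm l)) (canon (LeafSupport.mkN (LeafSupport.cm l)) μtop κtop) (canon₁₂ (LeafSupport.mkN (LeafSupport.cm l)) μtop κtop) (canon₅₉ (LeafSupport.mkN (LeafSupport.cm l)) μtop κtop)) ∧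
      ¬ (canon₁₆₉ (LeafSupport.mkN (LeafSupport.cm l)) (canon (LeafSupport.mkN (LeafSupport.cm l)) μtop κtop) (canon₁₂ (LeafSupport.mkN (LeafSupport.cm l)) μtop κtop) (canon₅₉ (LeafSupport.mkN (LeafSupport.cm l)) μtop κtop)).HuangJacAntiTempered ∧
      ¬ (canon₁₆₉ (LeafSupport.mkN (LeafSupport.cm l)) (canon (LeafSupport.mkN (LeafSupport.cm l)) μtop κtop) (canon₁₂ (LeafSupport.mkN (LeafSupport.cm l)) μtop κtop) (canon₅₉ (LeafSupport.mkN (LeafSupport.cm l)) μtop κtop)).TayouIrreducibility ∧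
      ((canon₁₆₉ (LeafSupport.mkN (LeafSupport.cm l)) (canon (LeafSupport.mkN (LeafSupport.cm l)) μtop κtop) (canon₁₂ (LeafSupport.mkN (LeafSupport.cm l)) μtop κtop) (canon₅₉ (LeafSupport.mkN (LeafSupport.cm l)) μtop κtop)).HuangTwistedOsborne ∧ (canon₁₆₉ (LeafSupport.mkN (LeafSupport.cm l)) (canon (LeafSupport.mkN (LeafSupport.cm l)) μtop κtop) (canon₁₂ (LeafSupport.mkN (LeafSupport.cm l)) μtop κtop) (canon₅₉ (LeafSupport.mkN (LeafSupport.cm l)) μtop κtop)).TayouImage) :=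
  have nb := not_B_cm l
  ⟨(LeafSupport.countermodel l).2.2.1, canon_implications₁₆₉ _ _ _ _, fun h => nb h.1, fun h => nb h, ⟨True.intro, True.intro⟩⟩

/-- MOK SIDE: in Mok's countermodel of ANY Mok leaf `l` (the book at the top, KMSW read `κnoMok`; tranches 1, 12, 59 read canonically there) the bundle holds; B142's Theorem 1.6 FAILS — it
cites [LLS24, Theorem 5.9] as printed, whose unitary cases run through Mok's memoir — while C324's Théorème 1.2 HOLDS (Sp₄(ℤ): no unitary group). [cite: Huang2025TwistedOsborne, proof of Thm 1.6 (arXiv:2510.09975 p0005:L7); Tayou2017ImagesGalois, Thm 1.2 (separating models; bookkeeping proved here)] [claim: LiuLoShahidi2024, under-review] -/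
theorem c169_mok_cm (l : Mok2015.LeafSupport.Leaf) :
    ¬ (Mok2015.LeafSupport.mkN (Mok2015.LeafSupport.cm l)).leaf l ∧
      Implications169 νtop (canon νtop (Mok2015.LeafSupport.mkN (Mok2015.LeafSupport.cm l)) κnoMok) (canon₁₂ νtop (Mok2015.LeafSupport.mkN (Mok2015.LeafSupport.cm l)) κnoMok) (canon₅₉ νtop (Mok2015.LeafSupport.mkN (Mok2015.LeafSupport.cm l)) κnoMok) (canon₁₆₉ νtop (canon νtop (Mok2015.LeafSupport.mkN (Mok2015.LeafSupport.cm l)) κnoMok) (canon₁₂ νtop (Mok2015.LeafSupport.mkN (Mok2015.LeafSupport.cm l)) κnoMok) (canon₅₉ νtop (Mok2015.LeafSupport.mkN (Mok2015.LeafSupport.cm l)) κnoMok)) ∧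
      ¬ (canon₁₆₉ νtop (canon νtop (Mok2015.LeafSupport.mkN (Mok2015.LeafSupport.cm l)) κnoMok) (canon₁₂ νtop (Mok2015.LeafSupport.mkN (Mok2015.LeafSupport.cm l)) κnoMok) (canon₅₉ νtop (Mok2015.LeafSupport.mkN (Mok2015.LeafSupport.cm l)) κnoMok)).HuangJacAntiTempered ∧
      (canon₁₆₉ νtop (canon νtop (Mok2015.LeafSupport.mkN (Mok2015.LeafSupport.cm l)) κnoMok) (canon₁₂ νtop (Mok2015.LeafSupport.mkN (Mok2015.LeafSupport.cm l)) κnoMok) (canon₅₉ νtop (Mok2015.LeafSupport.mkN (Mok2015.LeafSupport.cm l)) κnoMok)).TayouIrreducibility :=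
  have b : ∀ N, νtop.Everything N := bookInputs_top.everything
  ⟨(Mok2015.LeafSupport.countermodel l).2.2.1, canon_implications₁₆₉ _ _ _ _, fun h => not_M_cm l h.2.2.2.1, b⟩

/-- KMSW SIDE: in KMSW's countermodel of a leaf `l ≠ MokMain` (book and Mok at the top; tranches 1, 12, 59 read canonically there) the bundle holds; B142's Theorem 1.6 holds iff `l` is a
sequel-only leaf (`l.onlyFull = true`, section 12's `twelfth_kmsw_cm` for B6 as printed): KMSW's proved-scope leaves are load-bearing through [LLS24, Thm 5.9], its unwritten sequels
[KMS_A] / [KMS_B] (and `AubertSS`) are not; C324's Théorème 1.2 holds. [cite: Huang2025TwistedOsborne, proof of Thm 1.6 (arXiv:2510.09975 p0005:L7); Tayou2017ImagesGalois, Thm 1.2 (separating models; bookkeeping proved here)] [claim: KalethaMinguezShinWhite2014, under-review] -/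
theorem c169_kmsw_cm (l : KMSW2014.LeafSupport.Leaf) (hl : l ≠ .MokMain) :
    ¬ (KMSW2014.LeafSupport.mkN (KMSW2014.LeafSupport.cm l)).leaf l ∧
      Implications169 νtop (canon νtop μtop (KMSW2014.LeafSupport.mkN (KMSW2014.LeafSupport.cm l))) (canon₁₂ νtop μtop (KMSW2014.LeafSupport.mkN (KMSW2014.LeafSupport.cm l))) (canon₅₉ νtop μtop (KMSW2014.LeafSupport.mkN (KMSW2014.LeafSupport.cm l))) (canon₁₆₉ νtop (canon νtop μtop (KMSW2014.LeafSupport.mkN (KMSW2014.LeafSupport.cm l))) (canon₁₂ νtop μtop (KMSW2014.LeafSupport.mkN (KMSW2014.LeafSupport.cm l))) (canon₅₉ νtop μtop (KMSW2014.LeafSupport.mkN (KMSW2014.LeafSupport.cm l)))) ∧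
      ((canon₁₆₉ νtop (canon νtop μtop (KMSW2014.LeafSupport.mkN (KMSW2014.LeafSupport.cm l))) (canon₁₂ νtop μtop (KMSW2014.LeafSupport.mkN (KMSW2014.LeafSupport.cm l))) (canon₅₉ νtop μtop (KMSW2014.LeafSupport.mkN (KMSW2014.LeafSupport.cm l)))).HuangJacAntiTempered ↔ l.onlyFull = true) ∧
      (canon₁₆₉ νtop (canon νtop μtop (KMSW2014.LeafSupport.mkN (KMSW2014.LeafSupport.cm l))) (canon₁₂ νtop μtop (KMSW2014.LeafSupport.mkN (KMSW2014.LeafSupport.cm l))) (canon₅₉ νtop μtop (KMSW2014.LeafSupport.mkN (KMSW2014.LeafSupport.cm l)))).TayouIrreducibility :=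
  have b : ∀ N, νtop.Everything N := bookInputs_top.everything
  have e := (twelfth_kmsw_cm l hl).2.2.2.2.2.1
  ⟨(KMSW2014.LeafSupport.countermodel l).2.2.1, canon_implications₁₆₉ _ _ _ _,
    ⟨fun h => e.1 h.2.2, fun o => ⟨b, b, e.2 o⟩⟩, b⟩

/-- THE HUNDRED-AND-SIXTY-NINTH TRANCHE REGRADED, in one statement: (i) at the top Theorem 1.6 (B142) and Théorème 1.2 (C324) hold; (ii) in the book countermodel of any of the 24 leaves both
fail; (iii) in Mok's countermodel of any Mok leaf Theorem 1.6 fails and Théorème 1.2 holds; (iv) in KMSW's countermodel of a leaf `l ≠ MokMain` Theorem 1.6 holds iff `l.onlyFull = true` and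
Théorème 1.2 holds.  Supports, exact: support(B142 Thm 1.6) = the 24 book leaves ∧ Mok's 29 leaves ∧ KMSW's proved-scope leaves; support(C324 Thm 1.2) = the 24 book leaves; controls ∅. [cite: Huang2025TwistedOsborne, Thm 1.6; Tayou2017ImagesGalois, Thm 1.2 (bookkeeping proved here)] [claim: Huang2025TwistedOsborne, under-review] -/
theorem c169_regraded :
    ((canon₁₆₉ νtop (canon νtop μtop κtop) (canon₁₂ νtop μtop κtop) (canon₅₉ νtop μtop κtop)).HuangJacAntiTempered ∧ (canon₁₆₉ νtop (canon νtop μtop κtop) (canon₁₂ νtop μtop κtop) (canon₅₉ νtop μtop κtop)).TayouIrreducibility) ∧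
      (∀ l : LeafSupport.Leaf, ¬ (LeafSupport.mkN (LeafSupport.cm l)).leaf l ∧
        ¬ (canon₁₆₉ (LeafSupport.mkN (LeafSupport.cm l)) (canon (LeafSupport.mkN (LeafSupport.cm l)) μtop κtop) (canon₁₂ (LeafSupport.mkN (LeafSupport.cm l)) μtop κtop) (canon₅₉ (LeafSupport.mkN (LeafSupport.cm l)) μtop κtop)).HuangJacAntiTempered ∧
        ¬ (canon₁₆₉ (LeafSupport.mkN (LeafSupport.cm l)) (canon (LeafSupport.mkN (LeafSupport.cm l)) μtop κtop) (canon₁₂ (LeafSupport.mkN (LeafSupport.cm l)) μtop κtop) (canon₅₉ (LeafSupport.mkN (LeafSupport.cm l)) μtop κtop)).TayouIrreducibility) ∧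
      (∀ l : Mok2015.LeafSupport.Leaf, ¬ (Mok2015.LeafSupport.mkN (Mok2015.LeafSupport.cm l)).leaf l ∧
        ¬ (canon₁₆₉ νtop (canon νtop (Mok2015.LeafSupport.mkN (Mok2015.LeafSupport.cm l)) κnoMok) (canon₁₂ νtop (Mok2015.LeafSupport.mkN (Mok2015.LeafSupport.cm l)) κnoMok) (canon₅₉ νtop (Mok2015.LeafSupport.mkN (Mok2015.LeafSupport.cm l)) κnoMok)).HuangJacAntiTempered ∧
        (canon₁₆₉ νtop (canon νtop (Mok2015.LeafSupport.mkN (Mok2015.LeafSupport.cm l)) κnoMok) (canon₁₂ νtop (Mok2015.LeafSupport.mkN (Mok2015.LeafSupport.cm l)) κnoMok) (canon₅₉ νtop (Mok2015.LeafSupport.mkN (Mok2015.LeafSupport.cm l)) κnoMok)).TayouIrreducibility) ∧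
      (∀ l : KMSW2014.LeafSupport.Leaf, l ≠ .MokMain →
        ((canon₁₆₉ νtop (canon νtop μtop (KMSW2014.LeafSupport.mkN (KMSW2014.LeafSupport.cm l))) (canon₁₂ νtop μtop (KMSW2014.LeafSupport.mkN (KMSW2014.LeafSupport.cm l))) (canon₅₉ νtop μtop (KMSW2014.LeafSupport.mkN (KMSW2014.LeafSupport.cm l)))).HuangJacAntiTempered ↔ l.onlyFull = true) ∧
        (canon₁₆₉ νtop (canon νtop μtop (KMSW2014.LeafSupport.mkN (KMSW2014.LeafSupport.cm l))) (canon₁₂ νtop μtop (KMSW2014.LeafSupport.mkN (KMSW2014.LeafSupport.cm l))) (canon₅₉ νtop μtop (KMSW2014.LeafSupport.mkN (KMSW2014.LeafSupport.cm l)))).TayouIrreducibility) :=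
  ⟨⟨c169_top.2.2.1, c169_top.2.2.2.1⟩,
    fun l =>
      have h := c169_book_cm l
      ⟨h.1, h.2.2.1, h.2.2.2.1⟩,
    fun l =>
      have h := c169_mok_cm l
      ⟨h.1, h.2.2.1, h.2.2.2⟩,
    fun l hl =>
      have h := c169_kmsw_cm l hl
      ⟨h.2.2.1, h.2.2.2⟩⟩

/-! ## 172. Hundred-and-seventieth tranche (v2 of this file, after `Downstream46.lean` v4; unit `pub-arthur-down-g71`, downstream tracer gen 71): supports of NEW rows B143 (C. Mœglin,
*Caractérisation des paramètres d'Arthur, une remarque*, Bull. Iranian Math. Soc. 43 (2017) 279–289), C325 (Conti – Lang – Medvedovsky, *Big images of two-dimensional pseudorepresentations*,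
Math. Ann. 385 (2023) 1–95) and C326 (D. Jiang, *On tensor product L-functions and Langlands functoriality*, Bull. Iranian Math. Soc. 43 (2017) 169–189) — the Internet Archive Scholar full-text
channel (GAPS G-DN-618).  The canonical reading `canon₁₇₀ ν c₁₄ c₂₈` over ARBITRARY tranche-14 / tranche-28 assignments (read canonically below through section 14's `canon₁₄ ν` (E41 := its
seven conjuncts A11_twisted ∧ TWFL ∧ WFL_nonstandard ∧ FL ∧ TwistedTF ∧ MW_Stab ∧ LLC_GLN) and section 31's `canon₂₈ ν μ κ` (C191 := the book at every rank ∧ row A4's value, itself := the book)):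
Propositions 2.1 / 2.3 and Proposition 2.2 := the book at every rank ∧ `c₁₄.MoeglinStable`; Theorem 12.8 := `c₂₈.MokGSp4`; Corollary 4.3 := the book at every rank; Theorems A – C (control) :=
`True`.  Every tranche-170 edge holds in it (`canon_implications₁₇₀`).  READINGS: (i) AT THE TOP the bundle holds and all five fields HOLD — by the tranche's own `moeglinBIMS_of_inputs`,
`bianchiBigImage_of_inputs`, `jiangTensor_of_inputs` from the canonical bundles of tranches 1, 14, 28 and `bookInputs_top` (`c170_top`); (ii) BOOK SIDE: in each of the 24 book countermodels the
four Arthur-fed fields ALL FAIL (each reads `∀ N, ν.Everything N`; E41's own seven-leaf support and C191's reading lie inside the 24), the control holds (`c170_book_cm`); (iii) MOK SIDE and (iv)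
KMSW SIDE: in each of Mok's 29 countermodels (book at the top, KMSW read `κnoMok`) and in KMSW's countermodel of any leaf (book and Mok at the top) all five fields HOLD — no unitary input anywhere
in the three rows (`c170_mok_cm`, `c170_kmsw_cm`).  Supports, exact: support(B143 Props 2.1–2.3) = support(C325 Thm 12.8) = support(C326 Cor. 4.3) = the 24 book leaves; the control: ∅.  No Mok /
KMSW leaf. -/

section Canon170

variable (ν : Nodes)

/-- The canonical reading of NEW rows B143 / C325 / C326 over arbitrary tranche-14 and tranche-28 assignments: Propositions 2.1–2.3 := the book at every rank ∧ E41's value; Theorem 12.8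
:= C191's value; Corollary 4.3 := the book at every rank; Theorems A – C := `True`. [cite: Moeglin2017Caracterisation, Props 2.1–2.3; ContiLangMedvedovsky2023, Thms A–C, 12.8; Jiang2017TensorProduct, Cor. 4.3 (canonical model; bookkeeping)] -/
abbrev canon₁₇₀ (c₁₄ : Consumers14) (c₂₈ : Consumers28) : Consumers170 where
  MoeglinCharacter := (∀ N, ν.Everything N) ∧ c₁₄.MoeglinStable
  MoeglinDichotomy := (∀ N, ν.Everything N) ∧ c₁₄.MoeglinStable
  PseudorepMain := True
  BianchiBigImage := c₂₈.MokGSp4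
  JiangPoleBound := ∀ N, ν.Everything N

/-- Every hundred-and-seventieth-tranche edge holds in the canonical reading, for arbitrary ν and arbitrary tranche-14 / 28 assignments. [cite: Moeglin2017Caracterisation, Props 2.1–2.3; ContiLangMedvedovsky2023, Thm 12.8; Jiang2017TensorProduct, Cor. 4.3 (bookkeeping proved here)] -/
theorem canon_implications₁₇₀ (c₁₄ : Consumers14) (c₂₈ : Consumers28) : Implications170 ν c₁₄ c₂₈ (canon₁₇₀ ν c₁₄ c₂₈) where
  moeglinCharacter := fun b e => ⟨b, e⟩
  moeglinDichotomy := fun b e => ⟨b, e⟩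
  pseudorepMain := True.intro
  bianchiBigImage := fun m _ => m
  jiang := fun b => b

end Canon170

/-- AT THE TOP (every leaf of the three DAGs granted; tranches 14, 28 read canonically): the bundle holds and ALL FIVE fields of rows B143 / C325 / C326 HOLD — by the tranche's
`moeglinBIMS_of_inputs`, `bianchiBigImage_of_inputs`, `jiangTensor_of_inputs` over the canonical bundles of tranches 1, 14, 28 and `bookInputs_top`. [cite: Moeglin2017Caracterisation, Props 2.1–2.3; ContiLangMedvedovsky2023, Thm 12.8; Jiang2017TensorProduct, Cor. 4.3 (bookkeeping proved here)] -/
theorem c170_top :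
    Implications170 νtop (canon₁₄ νtop) (canon₂₈ νtop μtop κtop) (canon₁₇₀ νtop (canon₁₄ νtop) (canon₂₈ νtop μtop κtop)) ∧
      (canon₁₇₀ νtop (canon₁₄ νtop) (canon₂₈ νtop μtop κtop)).MoeglinCharacter ∧
      (canon₁₇₀ νtop (canon₁₄ νtop) (canon₂₈ νtop μtop κtop)).MoeglinDichotomy ∧
      (canon₁₇₀ νtop (canon₁₄ νtop) (canon₂₈ νtop μtop κtop)).PseudorepMain ∧
      (canon₁₇₀ νtop (canon₁₄ νtop) (canon₂₈ νtop μtop κtop)).BianchiBigImage ∧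
      (canon₁₇₀ νtop (canon₁₄ νtop) (canon₂₈ νtop μtop κtop)).JiangPoleBound :=
  have Y := canon_implications₁₇₀ νtop (canon₁₄ νtop) (canon₂₈ νtop μtop κtop)
  have m := moeglinBIMS_of_inputs Y (canon_implications₁₄ νtop) bookInputs_top
  ⟨Y, m.1, m.2, True.intro,
    bianchiBigImage_of_inputs Y (canon_implications₂₈ νtop μtop κtop) (canon_implications νtop μtop κtop) bookInputs_top,
    jiangTensor_of_inputs Y bookInputs_top⟩

/-- BOOK SIDE: in the book countermodel of ANY of the 24 leaves `l` (tranches 14 / 28 read canonically there; Mok / KMSW at the top) the bundle holds, the four Arthur-fed fields ALL FAIL and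
the control holds — every book leaf is load-bearing for B143 (through [2, Thms 2.4.1 / 2.4.4] and the book's endoscopy for O(2n)), for C325 (through C191 ⇐ the book) and for C326 (through
the global parameters of Sp_{2n}). [cite: Moeglin2017Caracterisation, §2 (`bims-1164-moeglin` p0006:L2); ContiLangMedvedovsky2023, §12.3 (arXiv:1904.10519v3 p0058:L12-13); Jiang2017TensorProduct, §4.1 (`bims-1160-jiang` p0014:L46-47) (separating models; bookkeeping proved here)] -/
theorem c170_book_cm (l : LeafSupport.Leaf) :
    ¬ (LeafSupport.mkN (LeafSupport.cm l)).leaf l ∧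
      Implications170 (LeafSupport.mkN (LeafSupport.cm l)) (canon₁₄ (LeafSupport.mkN (LeafSupport.cm l))) (canon₂₈ (LeafSupport.mkN (LeafSupport.cm l)) μtop κtop) (canon₁₇₀ (LeafSupport.mkN (LeafSupport.cm l)) (canon₁₄ (LeafSupport.mkN (LeafSupport.cm l))) (canon₂₈ (LeafSupport.mkN (LeafSupport.cm l)) μtop κtop)) ∧
      ¬ (canon₁₇₀ (LeafSupport.mkN (LeafSupport.cm l)) (canon₁₄ (LeafSupport.mkN (LeafSupport.cm l))) (canon₂₈ (LeafSupport.mkN (LeafSupport.cm l)) μtop κtop)).MoeglinCharacter ∧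
      ¬ (canon₁₇₀ (LeafSupport.mkN (LeafSupport.cm l)) (canon₁₄ (LeafSupport.mkN (LeafSupport.cm l))) (canon₂₈ (LeafSupport.mkN (LeafSupport.cm l)) μtop κtop)).MoeglinDichotomy ∧
      ¬ (canon₁₇₀ (LeafSupport.mkN (LeafSupport.cm l)) (canon₁₄ (LeafSupport.mkN (LeafSupport.cm l))) (canon₂₈ (LeafSupport.mkN (LeafSupport.cm l)) μtop κtop)).BianchiBigImage ∧
      ¬ (canon₁₇₀ (LeafSupport.mkN (LeafSupport.cm l)) (canon₁₄ (LeafSupport.mkN (LeafSupport.cm l))) (canon₂₈ (LeafSupport.mkN (LeafSupport.cm l)) μtop κtop)).JiangPoleBound ∧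
      (canon₁₇₀ (LeafSupport.mkN (LeafSupport.cm l)) (canon₁₄ (LeafSupport.mkN (LeafSupport.cm l))) (canon₂₈ (LeafSupport.mkN (LeafSupport.cm l)) μtop κtop)).PseudorepMain :=
  have nb := not_B_cm l
  ⟨(LeafSupport.countermodel l).2.2.1, canon_implications₁₇₀ _ _ _, fun h => nb h.1, fun h => nb h.1, fun h => nb h.1, fun h => nb h, True.intro⟩

/-- MOK SIDE: in Mok's countermodel of ANY Mok leaf `l` (the book at the top, KMSW read `κnoMok`; tranches 14 / 28 read canonically there) the bundle holds and ALL FIVE fields HOLD — no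
unitary input in rows B143 / C325 / C326. [cite: Moeglin2017Caracterisation, Props 2.1–2.3; ContiLangMedvedovsky2023, Thm 12.8; Jiang2017TensorProduct, Cor. 4.3 (separating models; bookkeeping proved here)] -/
theorem c170_mok_cm (l : Mok2015.LeafSupport.Leaf) :
    ¬ (Mok2015.LeafSupport.mkN (Mok2015.LeafSupport.cm l)).leaf l ∧
      Implications170 νtop (canon₁₄ νtop) (canon₂₈ νtop (Mok2015.LeafSupport.mkN (Mok2015.LeafSupport.cm l)) κnoMok) (canon₁₇₀ νtop (canon₁₄ νtop) (canon₂₈ νtop (Mok2015.LeafSupport.mkN (Mok2015.LeafSupport.cm l)) κnoMok)) ∧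
      (canon₁₇₀ νtop (canon₁₄ νtop) (canon₂₈ νtop (Mok2015.LeafSupport.mkN (Mok2015.LeafSupport.cm l)) κnoMok)).MoeglinCharacter ∧
      (canon₁₇₀ νtop (canon₁₄ νtop) (canon₂₈ νtop (Mok2015.LeafSupport.mkN (Mok2015.LeafSupport.cm l)) κnoMok)).MoeglinDichotomy ∧
      (canon₁₇₀ νtop (canon₁₄ νtop) (canon₂₈ νtop (Mok2015.LeafSupport.mkN (Mok2015.LeafSupport.cm l)) κnoMok)).BianchiBigImage ∧
      (canon₁₇₀ νtop (canon₁₄ νtop) (canon₂₈ νtop (Mok2015.LeafSupport.mkN (Mok2015.LeafSupport.cm l)) κnoMok)).JiangPoleBound :=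
  have b : ∀ N, νtop.Everything N := bookInputs_top.everything
  have e := fourteenth_holds_top
  ⟨(Mok2015.LeafSupport.countermodel l).2.2.1, canon_implications₁₇₀ _ _ _, ⟨b, e⟩, ⟨b, e⟩, ⟨b, b⟩, b⟩

/-- KMSW SIDE: in KMSW's countermodel of ANY KMSW leaf `l` (book and Mok at the top; tranches 14 / 28 read canonically there) the bundle holds and ALL FIVE fields HOLD — nothing of KMSW's
proved scope or sequels is load-bearing for rows B143 / C325 / C326. [cite: Moeglin2017Caracterisation, Props 2.1–2.3; ContiLangMedvedovsky2023, Thm 12.8; Jiang2017TensorProduct, Cor. 4.3 (separating models; bookkeeping proved here)] -/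
theorem c170_kmsw_cm (l : KMSW2014.LeafSupport.Leaf) :
    ¬ (KMSW2014.LeafSupport.mkN (KMSW2014.LeafSupport.cm l)).leaf l ∧
      Implications170 νtop (canon₁₄ νtop) (canon₂₈ νtop μtop (KMSW2014.LeafSupport.mkN (KMSW2014.LeafSupport.cm l))) (canon₁₇₀ νtop (canon₁₄ νtop) (canon₂₈ νtop μtop (KMSW2014.LeafSupport.mkN (KMSW2014.LeafSupport.cm l)))) ∧
      (canon₁₇₀ νtop (canon₁₄ νtop) (canon₂₈ νtop μtop (KMSW2014.LeafSupport.mkN (KMSW2014.LeafSupport.cm l)))).MoeglinCharacter ∧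
      (canon₁₇₀ νtop (canon₁₄ νtop) (canon₂₈ νtop μtop (KMSW2014.LeafSupport.mkN (KMSW2014.LeafSupport.cm l)))).MoeglinDichotomy ∧
      (canon₁₇₀ νtop (canon₁₄ νtop) (canon₂₈ νtop μtop (KMSW2014.LeafSupport.mkN (KMSW2014.LeafSupport.cm l)))).BianchiBigImage ∧
      (canon₁₇₀ νtop (canon₁₄ νtop) (canon₂₈ νtop μtop (KMSW2014.LeafSupport.mkN (KMSW2014.LeafSupport.cm l)))).JiangPoleBound :=
  have b : ∀ N, νtop.Everything N := bookInputs_top.everything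
  have e := fourteenth_holds_top
  ⟨(KMSW2014.LeafSupport.countermodel l).2.2.1, canon_implications₁₇₀ _ _ _, ⟨b, e⟩, ⟨b, e⟩, ⟨b, b⟩, b⟩

/-- THE HUNDRED-AND-SEVENTIETH TRANCHE REGRADED, in one statement: (i) at the top the four Arthur-fed fields of rows B143 / C325 / C326 hold; (ii) in the book countermodel of any of the 24
leaves all four fail; (iii) in Mok's countermodel of any Mok leaf and (iv) in KMSW's countermodel of any KMSW leaf all four hold.  Supports, exact: support(B143 Props 2.1 / 2.3) = support(B143
Prop 2.2) = support(C325 Thm 12.8) = support(C326 Cor. 4.3) = the 24 book leaves; the control (C325 Thms A – C): ∅; no Mok / KMSW leaf. [cite: Moeglin2017Caracterisation, Props 2.1–2.3; ContiLangMedvedovsky2023, Thm 12.8; Jiang2017TensorProduct, Cor. 4.3 (bookkeeping proved here)] -/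
theorem c170_regraded :
    ((canon₁₇₀ νtop (canon₁₄ νtop) (canon₂₈ νtop μtop κtop)).MoeglinCharacter ∧ (canon₁₇₀ νtop (canon₁₄ νtop) (canon₂₈ νtop μtop κtop)).MoeglinDichotomy ∧
        (canon₁₇₀ νtop (canon₁₄ νtop) (canon₂₈ νtop μtop κtop)).BianchiBigImage ∧ (canon₁₇₀ νtop (canon₁₄ νtop) (canon₂₈ νtop μtop κtop)).JiangPoleBound) ∧
      (∀ l : LeafSupport.Leaf, ¬ (LeafSupport.mkN (LeafSupport.cm l)).leaf l ∧
        ¬ (canon₁₇₀ (LeafSupport.mkN (LeafSupport.cm l)) (canon₁₄ (LeafSupport.mkN (LeafSupport.cm l))) (canon₂₈ (LeafSupport.mkN (LeafSupport.cm l)) μtop κtop)).MoeglinCharacter ∧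
        ¬ (canon₁₇₀ (LeafSupport.mkN (LeafSupport.cm l)) (canon₁₄ (LeafSupport.mkN (LeafSupport.cm l))) (canon₂₈ (LeafSupport.mkN (LeafSupport.cm l)) μtop κtop)).MoeglinDichotomy ∧
        ¬ (canon₁₇₀ (LeafSupport.mkN (LeafSupport.cm l)) (canon₁₄ (LeafSupport.mkN (LeafSupport.cm l))) (canon₂₈ (LeafSupport.mkN (LeafSupport.cm l)) μtop κtop)).BianchiBigImage ∧
        ¬ (canon₁₇₀ (LeafSupport.mkN (LeafSupport.cm l)) (canon₁₄ (LeafSupport.mkN (LeafSupport.cm l))) (canon₂₈ (LeafSupport.mkN (LeafSupport.cm l)) μtop κtop)).JiangPoleBound) ∧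
      (∀ l : Mok2015.LeafSupport.Leaf, ¬ (Mok2015.LeafSupport.mkN (Mok2015.LeafSupport.cm l)).leaf l ∧
        (canon₁₇₀ νtop (canon₁₄ νtop) (canon₂₈ νtop (Mok2015.LeafSupport.mkN (Mok2015.LeafSupport.cm l)) κnoMok)).MoeglinCharacter ∧
        (canon₁₇₀ νtop (canon₁₄ νtop) (canon₂₈ νtop (Mok2015.LeafSupport.mkN (Mok2015.LeafSupport.cm l)) κnoMok)).BianchiBigImage ∧
        (canon₁₇₀ νtop (canon₁₄ νtop) (canon₂₈ νtop (Mok2015.LeafSupport.mkN (Mok2015.LeafSupport.cm l)) κnoMok)).JiangPoleBound) ∧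
      (∀ l : KMSW2014.LeafSupport.Leaf, ¬ (KMSW2014.LeafSupport.mkN (KMSW2014.LeafSupport.cm l)).leaf l ∧
        (canon₁₇₀ νtop (canon₁₄ νtop) (canon₂₈ νtop μtop (KMSW2014.LeafSupport.mkN (KMSW2014.LeafSupport.cm l)))).MoeglinCharacter ∧
        (canon₁₇₀ νtop (canon₁₄ νtop) (canon₂₈ νtop μtop (KMSW2014.LeafSupport.mkN (KMSW2014.LeafSupport.cm l)))).BianchiBigImage ∧
        (canon₁₇₀ νtop (canon₁₄ νtop) (canon₂₈ νtop μtop (KMSW2014.LeafSupport.mkN (KMSW2014.LeafSupport.cm l)))).JiangPoleBound) :=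
  ⟨⟨c170_top.2.1, c170_top.2.2.1, c170_top.2.2.2.2.1, c170_top.2.2.2.2.2⟩,
    fun l =>
      have h := c170_book_cm l
      ⟨h.1, h.2.2.1, h.2.2.2.1, h.2.2.2.2.1, h.2.2.2.2.2.1⟩,
    fun l =>
      have h := c170_mok_cm l
      ⟨h.1, h.2.2.1, h.2.2.2.2.1, h.2.2.2.2.2⟩,
    fun l =>
      have h := c170_kmsw_cm l
      ⟨h.1, h.2.2.1, h.2.2.2.2.1, h.2.2.2.2.2⟩⟩

/-! ## 173. Hundred-and-seventy-first tranche (v3 of this file, after NEW `Downstream47.lean` v1 — hence the new import; unit `pub-arthur-down-g71`, downstream tracer gen 71): supports of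
NEW rows C327 (D. Liu – B. Sun, *Relative completed cohomologies and modular symbols*, arXiv:1709.05762v3 (2025), preprint) and C328 (X. Cheng, *Hodge classes in the cohomology of local
systems*, arXiv:2311.00243 (2023), preprint).  The canonical reading `canon₁₇₁ ν μ κ c₂ c₁₉ c₂₀` over ARBITRARY tranche-2 / tranche-19 / tranche-20 assignments (read canonically below
through section 1's `canon₂ ν μ κ` (C14 Thm 1.8 := `True`, C14 Thm 1.10 := Mok at every rank ∧ KMSW's proved scope, C26 := the same), section 19's `canon₁₉` (C180 := the book at every
rank) and section 20's `canon₂₀` (C182 := the book ∧ C180)): Lemma 9.8 := Mok ∧ KMSW's proved scope; Theorem 2.13 = 9.13 := C14's two values ∧ C26's value ∧ Mok ∧ KMSW's proved scope;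
Proposition 4.2 and Lemma 5.1 / Theorem 5.3 / Corollary 5.4 := the book at every rank ∧ C182's value ∧ C180's value; Theorem A (control) := `True`.  Every tranche-171 edge holds in it
(`canon_implications₁₇₁`).  READINGS: (i) AT THE TOP the bundle holds and all five fields HOLD — by the tranche's own `liuSun_of_inputs` / `chengHodge_of_inputs` from the canonical
bundles of tranches 2, 19, 20 and `bookInputs_top` / `mokInputs_top` / `kmswInputs_top` (`c171_top`); (ii) BOOK SIDE: in each of the 24 book countermodels C327's two fields HOLD (no
book input — unitary groups only) while C328's two Arthur-fed fields FAIL and its control holds (`c171_book_cm`); (iii) MOK SIDE: in each of Mok's 29 countermodels (book at the top, KMSW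
read `κnoMok`) C327's two fields FAIL and C328's hold (`c171_mok_cm`); (iv) KMSW SIDE: in KMSW's countermodel of ANY KMSW leaf `l` (book and Mok at the top) C327's two fields hold IFF
`l.onlyFull = true` (the sequel-only leaves `AubertSS`, `KMS_A`, `KMS_B`): KMSW's proved-scope leaves are load-bearing through « [KMSW14] » and through C14 / C26, its unwritten sequels are
NOT; C328's fields hold (`c171_kmsw_cm`).  Supports, exact: support(C327 Lemma 9.8) = support(C327 Thm 9.13) = Mok's 29 leaves ∧ KMSW's proved-scope leaves, NO book leaf;
support(C328 Prop. 4.2) = support(C328 Thm 5.3 / Cor. 5.4) = the 24 book leaves; the control: ∅. -/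

section Canon171

variable (ν : Nodes) (μ : Mok2015.Nodes) (κ : KMSW2014.Nodes)

/-- The canonical reading of NEW rows C327 / C328 over arbitrary tranche-2, tranche-19 and tranche-20 assignments. [cite: LiuSun2025RelativeCompleted, Lemma 9.8, Thm 9.13; Cheng2023HodgeLocalSystems, Thm A, Prop. 4.2, Thm 5.3 (canonical model; bookkeeping)] [claim: LiuSun2025RelativeCompleted, under-review] [claim: Cheng2023HodgeLocalSystems, under-review] -/
abbrev canon₁₇₁ (c₂ : Consumers2) (c₁₉ : Consumers19) (c₂₀ : Consumers20) : Consumers171 where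
  LiuSunStrongBC := (∀ N, μ.Everything N) ∧ (∀ N, κ.Scope N)
  LiuSunPadicL := c₂.BPLZZggp ∧ c₂.BPLZZii ∧ c₂.BPCZii ∧ (∀ N, μ.Everything N) ∧ (∀ N, κ.Scope N)
  ChengBallQuotients := True
  ChengSKMultiplicity := (∀ N, ν.Everything N) ∧ c₂₀.SchmidtCAP ∧ c₁₉.SchmidtParamodular
  ChengHodge := (∀ N, ν.Everything N) ∧ c₂₀.SchmidtCAP ∧ c₁₉.SchmidtParamodular

/-- Every hundred-and-seventy-first-tranche edge holds in the canonical reading, for arbitrary ν, μ, κ and arbitrary tranche-2 / 19 / 20 assignments. [cite: LiuSun2025RelativeCompleted, Lemma 9.8, Thm 9.13; Cheng2023HodgeLocalSystems, Prop. 4.2, Thm 5.3 (bookkeeping proved here)] [claim: LiuSun2025RelativeCompleted, under-review] -/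
theorem canon_implications₁₇₁ (c₂ : Consumers2) (c₁₉ : Consumers19) (c₂₀ : Consumers20) :
    Implications171 ν μ κ c₂ c₁₉ c₂₀ (canon₁₇₁ ν μ κ c₂ c₁₉ c₂₀) where
  liuSunBC := fun m k => ⟨m, k⟩
  liuSunL := fun a b c m k _ => ⟨a, b, c, m, k⟩
  chengBall := True.intro
  chengSK := fun b s p => ⟨b, s, p⟩
  chengHodge := fun h => h

end Canon171

/-- AT THE TOP (every leaf of the three DAGs granted; tranches 2, 19, 20 read canonically): the bundle holds and ALL FIVE fields of rows C327 / C328 HOLD — by the tranche's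
`liuSun_of_inputs` over section 1's `canon_implications₂` with `mokInputs_top` / `kmswInputs_top`, and `chengHodge_of_inputs` over `canon_implications₁₉` / `canon_implications₂₀` with
`bookInputs_top`. [cite: LiuSun2025RelativeCompleted, Lemma 9.8, Thm 9.13; Cheng2023HodgeLocalSystems, Prop. 4.2, Thm 5.3 (bookkeeping proved here)] [claim: KalethaMinguezShinWhite2014, under-review] -/
theorem c171_top :
    Implications171 νtop μtop κtop (canon₂ νtop μtop κtop) (canon₁₉ νtop μtop κtop) (canon₂₀ νtop μtop κtop) (canon₁₇₁ νtop μtop κtop (canon₂ νtop μtop κtop) (canon₁₉ νtop μtop κtop) (canon₂₀ νtop μtop κtop)) ∧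
      (canon₁₇₁ νtop μtop κtop (canon₂ νtop μtop κtop) (canon₁₉ νtop μtop κtop) (canon₂₀ νtop μtop κtop)).LiuSunStrongBC ∧
      (canon₁₇₁ νtop μtop κtop (canon₂ νtop μtop κtop) (canon₁₉ νtop μtop κtop) (canon₂₀ νtop μtop κtop)).LiuSunPadicL ∧
      (canon₁₇₁ νtop μtop κtop (canon₂ νtop μtop κtop) (canon₁₉ νtop μtop κtop) (canon₂₀ νtop μtop κtop)).ChengBallQuotients ∧
      (canon₁₇₁ νtop μtop κtop (canon₂ νtop μtop κtop) (canon₁₉ νtop μtop κtop) (canon₂₀ νtop μtop κtop)).ChengSKMultiplicity ∧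
      (canon₁₇₁ νtop μtop κtop (canon₂ νtop μtop κtop) (canon₁₉ νtop μtop κtop) (canon₂₀ νtop μtop κtop)).ChengHodge :=
  have Y := canon_implications₁₇₁ νtop μtop κtop (canon₂ νtop μtop κtop) (canon₁₉ νtop μtop κtop) (canon₂₀ νtop μtop κtop)
  have ls := liuSun_of_inputs Y (canon_implications₂ νtop μtop κtop) mokInputs_top (kmswInputs_top μtop).1
  have ch := chengHodge_of_inputs Y (canon_implications₁₉ νtop μtop κtop) (canon_implications₂₀ νtop μtop κtop) bookInputs_top
  ⟨Y, ls.1, ls.2, True.intro, ch.1, ch.2⟩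

/-- BOOK SIDE: in the book countermodel of ANY of the 24 leaves `l` (Mok / KMSW at the top; tranches 2, 19, 20 read canonically there) the bundle holds; C327's Lemma 9.8 and Theorem 9.13
HOLD (unitary groups only: no book input) while C328's Proposition 4.2 and Theorem 5.3 / Corollary 5.4 FAIL and its control holds — every book leaf is load-bearing for C328 (through
[Art] and Schmidt's rows), none for C327. [cite: LiuSun2025RelativeCompleted, §9 (arXiv:1709.05762v3 p0100:L20-21); Cheng2023HodgeLocalSystems, §4.1 (arXiv:2311.00243v1 p0021:L16) (separating models; bookkeeping proved here)] [claim: KalethaMinguezShinWhite2014, under-review] -/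
theorem c171_book_cm (l : LeafSupport.Leaf) :
    ¬ (LeafSupport.mkN (LeafSupport.cm l)).leaf l ∧
      Implications171 (LeafSupport.mkN (LeafSupport.cm l)) μtop κtop (canon₂ (LeafSupport.mkN (LeafSupport.cm l)) μtop κtop) (canon₁₉ (LeafSupport.mkN (LeafSupport.cm l)) μtop κtop) (canon₂₀ (LeafSupport.mkN (LeafSupport.cm l)) μtop κtop) (canon₁₇₁ (LeafSupport.mkN (LeafSupport.cm l)) μtop κtop (canon₂ (LeafSupport.mkN (LeafSupport.cm l)) μtop κtop) (canon₁₉ (LeafSupport.mkN (LeafSupport.cm l)) μtop κtop) (canon₂₀ (LeafSupport.mkN (LeafSupport.cm l)) μtop κtop)) ∧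
      (canon₁₇₁ (LeafSupport.mkN (LeafSupport.cm l)) μtop κtop (canon₂ (LeafSupport.mkN (LeafSupport.cm l)) μtop κtop) (canon₁₉ (LeafSupport.mkN (LeafSupport.cm l)) μtop κtop) (canon₂₀ (LeafSupport.mkN (LeafSupport.cm l)) μtop κtop)).LiuSunStrongBC ∧
      (canon₁₇₁ (LeafSupport.mkN (LeafSupport.cm l)) μtop κtop (canon₂ (LeafSupport.mkN (LeafSupport.cm l)) μtop κtop) (canon₁₉ (LeafSupport.mkN (LeafSupport.cm l)) μtop κtop) (canon₂₀ (LeafSupport.mkN (LeafSupport.cm l)) μtop κtop)).LiuSunPadicL ∧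
      ¬ (canon₁₇₁ (LeafSupport.mkN (LeafSupport.cm l)) μtop κtop (canon₂ (LeafSupport.mkN (LeafSupport.cm l)) μtop κtop) (canon₁₉ (LeafSupport.mkN (LeafSupport.cm l)) μtop κtop) (canon₂₀ (LeafSupport.mkN (LeafSupport.cm l)) μtop κtop)).ChengSKMultiplicity ∧
      ¬ (canon₁₇₁ (LeafSupport.mkN (LeafSupport.cm l)) μtop κtop (canon₂ (LeafSupport.mkN (LeafSupport.cm l)) μtop κtop) (canon₁₉ (LeafSupport.mkN (LeafSupport.cm l)) μtop κtop) (canon₂₀ (LeafSupport.mkN (LeafSupport.cm l)) μtop κtop)).ChengHodge ∧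
      (canon₁₇₁ (LeafSupport.mkN (LeafSupport.cm l)) μtop κtop (canon₂ (LeafSupport.mkN (LeafSupport.cm l)) μtop κtop) (canon₁₉ (LeafSupport.mkN (LeafSupport.cm l)) μtop κtop) (canon₂₀ (LeafSupport.mkN (LeafSupport.cm l)) μtop κtop)).ChengBallQuotients :=
  have nb := not_B_cm l
  have m : ∀ N, μtop.Everything N := mokInputs_top.everything
  have k : ∀ N, κtop.Scope N := (kmswInputs_top μtop).1.scope mokInputs_top
  ⟨(LeafSupport.countermodel l).2.2.1, canon_implications₁₇₁ _ _ _ _ _ _, ⟨m, k⟩, ⟨True.intro, ⟨m, k⟩, ⟨m, k⟩, m, k⟩,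
    fun h => nb h.1, fun h => nb h.1, True.intro⟩

/-- MOK SIDE: in Mok's countermodel of ANY Mok leaf `l` (the book at the top, KMSW read `κnoMok`; tranches 2, 19, 20 read canonically there) the bundle holds; C327's Lemma 9.8 and
Theorem 9.13 FAIL (« [Mok15, KMSW14, Ram18] », « [KMSW14] », C14 / C26 all run through Mok's memoir) while C328's two Arthur-fed fields HOLD. [cite: LiuSun2025RelativeCompleted, Lemma 9.8 proof (arXiv:1709.05762v3 p0104:L12); Cheng2023HodgeLocalSystems, Prop. 4.2 (separating models; bookkeeping proved here)] [claim: LiuSun2025RelativeCompleted, under-review] -/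
theorem c171_mok_cm (l : Mok2015.LeafSupport.Leaf) :
    ¬ (Mok2015.LeafSupport.mkN (Mok2015.LeafSupport.cm l)).leaf l ∧
      Implications171 νtop (Mok2015.LeafSupport.mkN (Mok2015.LeafSupport.cm l)) κnoMok (canon₂ νtop (Mok2015.LeafSupport.mkN (Mok2015.LeafSupport.cm l)) κnoMok) (canon₁₉ νtop (Mok2015.LeafSupport.mkN (Mok2015.LeafSupport.cm l)) κnoMok) (canon₂₀ νtop (Mok2015.LeafSupport.mkN (Mok2015.LeafSupport.cm l)) κnoMok) (canon₁₇₁ νtop (Mok2015.LeafSupport.mkN (Mok2015.LeafSupport.cm l)) κnoMok (canon₂ νtop (Mok2015.LeafSupport.mkN (Mok2015.LeafSupport.cm l)) κnoMok) (canon₁₉ νtop (Mok2015.LeafSupport.mkN (Mok2015.LeafSupport.cm l)) κnoMok) (canon₂₀ νtop (Mok2015.LeafSupport.mkN (Mok2015.LeafSupport.cm l)) κnoMok)) ∧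
      ¬ (canon₁₇₁ νtop (Mok2015.LeafSupport.mkN (Mok2015.LeafSupport.cm l)) κnoMok (canon₂ νtop (Mok2015.LeafSupport.mkN (Mok2015.LeafSupport.cm l)) κnoMok) (canon₁₉ νtop (Mok2015.LeafSupport.mkN (Mok2015.LeafSupport.cm l)) κnoMok) (canon₂₀ νtop (Mok2015.LeafSupport.mkN (Mok2015.LeafSupport.cm l)) κnoMok)).LiuSunStrongBC ∧
      ¬ (canon₁₇₁ νtop (Mok2015.LeafSupport.mkN (Mok2015.LeafSupport.cm l)) κnoMok (canon₂ νtop (Mok2015.LeafSupport.mkN (Mok2015.LeafSupport.cm l)) κnoMok) (canon₁₉ νtop (Mok2015.LeafSupport.mkN (Mok2015.LeafSupport.cm l)) κnoMok) (canon₂₀ νtop (Mok2015.LeafSupport.mkN (Mok2015.LeafSupport.cm l)) κnoMok)).LiuSunPadicL ∧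
      (canon₁₇₁ νtop (Mok2015.LeafSupport.mkN (Mok2015.LeafSupport.cm l)) κnoMok (canon₂ νtop (Mok2015.LeafSupport.mkN (Mok2015.LeafSupport.cm l)) κnoMok) (canon₁₉ νtop (Mok2015.LeafSupport.mkN (Mok2015.LeafSupport.cm l)) κnoMok) (canon₂₀ νtop (Mok2015.LeafSupport.mkN (Mok2015.LeafSupport.cm l)) κnoMok)).ChengSKMultiplicity ∧
      (canon₁₇₁ νtop (Mok2015.LeafSupport.mkN (Mok2015.LeafSupport.cm l)) κnoMok (canon₂ νtop (Mok2015.LeafSupport.mkN (Mok2015.LeafSupport.cm l)) κnoMok) (canon₁₉ νtop (Mok2015.LeafSupport.mkN (Mok2015.LeafSupport.cm l)) κnoMok) (canon₂₀ νtop (Mok2015.LeafSupport.mkN (Mok2015.LeafSupport.cm l)) κnoMok)).ChengHodge :=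
  have b : ∀ N, νtop.Everything N := bookInputs_top.everything
  have nm := not_M_cm l
  ⟨(Mok2015.LeafSupport.countermodel l).2.2.1, canon_implications₁₇₁ _ _ _ _ _ _, fun h => nm h.1, fun h => nm h.2.2.2.1, ⟨b, ⟨b, b⟩, b⟩, ⟨b, ⟨b, b⟩, b⟩⟩

/-- KMSW SIDE: in KMSW's countermodel of ANY KMSW leaf `l` (book and Mok at the top; tranches 2, 19, 20 read canonically there) the bundle holds; C327's Lemma 9.8 and Theorem 9.13 hold
IFF `l.onlyFull = true` — i.e. exactly when the removed leaf is one of the sequel-only leaves `AubertSS`, `KMS_A`, `KMS_B`: KMSW's PROVED-SCOPE leaves are load-bearing (through the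
multiplicity formula « [KMSW14] » and through C14 Thm 1.10 / C26), its two unwritten sequels are not (K1 not triggered: pure inner forms U(V), generic parameters); C328's two
Arthur-fed fields hold. [cite: LiuSun2025RelativeCompleted, §9.1 (arXiv:1709.05762v3 p0100:L17-21) (separating models; bookkeeping proved here)] [claim: KalethaMinguezShinWhite2014, under-review] -/
theorem c171_kmsw_cm (l : KMSW2014.LeafSupport.Leaf) :
    ¬ (KMSW2014.LeafSupport.mkN (KMSW2014.LeafSupport.cm l)).leaf l ∧
      Implications171 νtop μtop (KMSW2014.LeafSupport.mkN (KMSW2014.LeafSupport.cm l)) (canon₂ νtop μtop (KMSW2014.LeafSupport.mkN (KMSW2014.LeafSupport.cm l))) (canon₁₉ νtop μtop (KMSW2014.LeafSupport.mkN (KMSW2014.LeafSupport.cm l))) (canon₂₀ νtop μtop (KMSW2014.LeafSupport.mkN (KMSW2014.LeafSupport.cm l))) (canon₁₇₁ νtop μtop (KMSW2014.LeafSupport.mkN (KMSW2014.LeafSupport.cm l)) (canon₂ νtop μtop (KMSW2014.LeafSupport.mkN (KMSW2014.LeafSupport.cm l))) (canon₁₉ νtop μtop (KMSW2014.LeafSupport.mkN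 (KMSW2014.LeafSupport.cm l))) (canon₂₀ νtop μtop (KMSW2014.LeafSupport.mkN (KMSW2014.LeafSupport.cm l)))) ∧
      ((canon₁₇₁ νtop μtop (KMSW2014.LeafSupport.mkN (KMSW2014.LeafSupport.cm l)) (canon₂ νtop μtop (KMSW2014.LeafSupport.mkN (KMSW2014.LeafSupport.cm l))) (canon₁₉ νtop μtop (KMSW2014.LeafSupport.mkN (KMSW2014.LeafSupport.cm l))) (canon₂₀ νtop μtop (KMSW2014.LeafSupport.mkN (KMSW2014.LeafSupport.cm l)))).LiuSunStrongBC ↔ l.onlyFull = true) ∧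
      ((canon₁₇₁ νtop μtop (KMSW2014.LeafSupport.mkN (KMSW2014.LeafSupport.cm l)) (canon₂ νtop μtop (KMSW2014.LeafSupport.mkN (KMSW2014.LeafSupport.cm l))) (canon₁₉ νtop μtop (KMSW2014.LeafSupport.mkN (KMSW2014.LeafSupport.cm l))) (canon₂₀ νtop μtop (KMSW2014.LeafSupport.mkN (KMSW2014.LeafSupport.cm l)))).LiuSunPadicL ↔ l.onlyFull = true) ∧
      (canon₁₇₁ νtop μtop (KMSW2014.LeafSupport.mkN (KMSW2014.LeafSupport.cm l)) (canon₂ νtop μtop (KMSW2014.LeafSupport.mkN (KMSW2014.LeafSupport.cm l))) (canon₁₉ νtop μtop (KMSW2014.LeafSupport.mkN (KMSW2014.LeafSupport.cm l))) (canon₂₀ νtop μtop (KMSW2014.LeafSupport.mkN (KMSW2014.LeafSupport.cm l)))).ChengSKMultiplicity ∧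
      (canon₁₇₁ νtop μtop (KMSW2014.LeafSupport.mkN (KMSW2014.LeafSupport.cm l)) (canon₂ νtop μtop (KMSW2014.LeafSupport.mkN (KMSW2014.LeafSupport.cm l))) (canon₁₉ νtop μtop (KMSW2014.LeafSupport.mkN (KMSW2014.LeafSupport.cm l))) (canon₂₀ νtop μtop (KMSW2014.LeafSupport.mkN (KMSW2014.LeafSupport.cm l)))).ChengHodge := by
  have b : ∀ N, νtop.Everything N := bookInputs_top.everything
  have m : ∀ N, μtop.Everything N := mokInputs_top.everything
  have nk : l.onlyFull = false → ¬ ∀ N, (KMSW2014.LeafSupport.mkN (KMSW2014.LeafSupport.cm l)).Scope N :=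
    fun hb hk => KMSW2014.LeafSupport.not_scope_of (KMSW2014.LeafSupport.scope_fails l hb 0) (hk 0)
  refine ⟨(KMSW2014.LeafSupport.countermodel l).2.2.1, canon_implications₁₇₁ _ _ _ _ _ _, ?_, ?_, ⟨b, ⟨b, b⟩, b⟩, ⟨b, ⟨b, b⟩, b⟩⟩
  · constructor
    · intro h
      cases hb : l.onlyFull
      · exact absurd h.2 (nk hb)
      · rfl
    · intro h
      exact ⟨m, scope_of_onlyFull l h⟩
  · constructor
    · intro h
      cases hb : l.onlyFull
      · exact absurd h.2.2.2.2 (nk hb)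
      · rfl
    · intro h
      have k := scope_of_onlyFull l h
      exact ⟨True.intro, ⟨m, k⟩, ⟨m, k⟩, m, k⟩

/-- THE HUNDRED-AND-SEVENTY-FIRST TRANCHE REGRADED, in one statement: (i) at the top C327's two fields and C328's two Arthur-fed fields hold; (ii) in the book countermodel of any of
the 24 leaves C327's hold and C328's fail; (iii) in Mok's countermodel of any Mok leaf C327's fail and C328's hold; (iv) in KMSW's countermodel of any KMSW leaf `l` C327's hold iff
`l.onlyFull = true` and C328's hold.  Supports, exact: support(C327 Lemma 9.8) = support(C327 Thm 2.13 = 9.13) = Mok's 29 leaves ∧ KMSW's proved-scope leaves (no book leaf, no KMSW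
sequel); support(C328 Prop. 4.2) = support(C328 Lemma 5.1 / Thm 5.3 / Cor. 5.4) = the 24 book leaves; the control (C328 Thm A): ∅. [cite: LiuSun2025RelativeCompleted, Lemma 9.8, Thm 9.13; Cheng2023HodgeLocalSystems, Prop. 4.2, Thm 5.3 (bookkeeping proved here)] [claim: KalethaMinguezShinWhite2014, under-review] -/
theorem c171_regraded :
    ((canon₁₇₁ νtop μtop κtop (canon₂ νtop μtop κtop) (canon₁₉ νtop μtop κtop) (canon₂₀ νtop μtop κtop)).LiuSunStrongBC ∧ (canon₁₇₁ νtop μtop κtop (canon₂ νtop μtop κtop) (canon₁₉ νtop μtop κtop) (canon₂₀ νtop μtop κtop)).LiuSunPadicL ∧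
        (canon₁₇₁ νtop μtop κtop (canon₂ νtop μtop κtop) (canon₁₉ νtop μtop κtop) (canon₂₀ νtop μtop κtop)).ChengSKMultiplicity ∧ (canon₁₇₁ νtop μtop κtop (canon₂ νtop μtop κtop) (canon₁₉ νtop μtop κtop) (canon₂₀ νtop μtop κtop)).ChengHodge) ∧
      (∀ l : LeafSupport.Leaf, ¬ (LeafSupport.mkN (LeafSupport.cm l)).leaf l ∧
        (canon₁₇₁ (LeafSupport.mkN (LeafSupport.cm l)) μtop κtop (canon₂ (LeafSupport.mkN (LeafSupport.cm l)) μtop κtop) (canon₁₉ (LeafSupport.mkN (LeafSupport.cm l)) μtop κtop) (canon₂₀ (LeafSupport.mkN (LeafSupport.cm l)) μtop κtop)).LiuSunStrongBC ∧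
        (canon₁₇₁ (LeafSupport.mkN (LeafSupport.cm l)) μtop κtop (canon₂ (LeafSupport.mkN (LeafSupport.cm l)) μtop κtop) (canon₁₉ (LeafSupport.mkN (LeafSupport.cm l)) μtop κtop) (canon₂₀ (LeafSupport.mkN (LeafSupport.cm l)) μtop κtop)).LiuSunPadicL ∧
        ¬ (canon₁₇₁ (LeafSupport.mkN (LeafSupport.cm l)) μtop κtop (canon₂ (LeafSupport.mkN (LeafSupport.cm l)) μtop κtop) (canon₁₉ (LeafSupport.mkN (LeafSupport.cm l)) μtop κtop) (canon₂₀ (LeafSupport.mkN (LeafSupport.cm l)) μtop κtop)).ChengSKMultiplicity ∧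
        ¬ (canon₁₇₁ (LeafSupport.mkN (LeafSupport.cm l)) μtop κtop (canon₂ (LeafSupport.mkN (LeafSupport.cm l)) μtop κtop) (canon₁₉ (LeafSupport.mkN (LeafSupport.cm l)) μtop κtop) (canon₂₀ (LeafSupport.mkN (LeafSupport.cm l)) μtop κtop)).ChengHodge) ∧
      (∀ l : Mok2015.LeafSupport.Leaf, ¬ (Mok2015.LeafSupport.mkN (Mok2015.LeafSupport.cm l)).leaf l ∧
        ¬ (canon₁₇₁ νtop (Mok2015.LeafSupport.mkN (Mok2015.LeafSupport.cm l)) κnoMok (canon₂ νtop (Mok2015.LeafSupport.mkN (Mok2015.LeafSupport.cm l)) κnoMok) (canon₁₉ νtop (Mok2015.LeafSupport.mkN (Mok2015.LeafSupport.cm l)) κnoMok) (canon₂₀ νtop (Mok2015.LeafSupport.mkN (Mok2015.LeafSupport.cm l)) κnoMok)).LiuSunStrongBC ∧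
        ¬ (canon₁₇₁ νtop (Mok2015.LeafSupport.mkN (Mok2015.LeafSupport.cm l)) κnoMok (canon₂ νtop (Mok2015.LeafSupport.mkN (Mok2015.LeafSupport.cm l)) κnoMok) (canon₁₉ νtop (Mok2015.LeafSupport.mkN (Mok2015.LeafSupport.cm l)) κnoMok) (canon₂₀ νtop (Mok2015.LeafSupport.mkN (Mok2015.LeafSupport.cm l)) κnoMok)).LiuSunPadicL ∧
        (canon₁₇₁ νtop (Mok2015.LeafSupport.mkN (Mok2015.LeafSupport.cm l)) κnoMok (canon₂ νtop (Mok2015.LeafSupport.mkN (Mok2015.LeafSupport.cm l)) κnoMok) (canon₁₉ νtop (Mok2015.LeafSupport.mkN (Mok2015.LeafSupport.cm l)) κnoMok) (canon₂₀ νtop (Mok2015.LeafSupport.mkN (Mok2015.LeafSupport.cm l)) κnoMok)).ChengSKMultiplicity ∧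
        (canon₁₇₁ νtop (Mok2015.LeafSupport.mkN (Mok2015.LeafSupport.cm l)) κnoMok (canon₂ νtop (Mok2015.LeafSupport.mkN (Mok2015.LeafSupport.cm l)) κnoMok) (canon₁₉ νtop (Mok2015.LeafSupport.mkN (Mok2015.LeafSupport.cm l)) κnoMok) (canon₂₀ νtop (Mok2015.LeafSupport.mkN (Mok2015.LeafSupport.cm l)) κnoMok)).ChengHodge) ∧
      (∀ l : KMSW2014.LeafSupport.Leaf, ¬ (KMSW2014.LeafSupport.mkN (KMSW2014.LeafSupport.cm l)).leaf l ∧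
        ((canon₁₇₁ νtop μtop (KMSW2014.LeafSupport.mkN (KMSW2014.LeafSupport.cm l)) (canon₂ νtop μtop (KMSW2014.LeafSupport.mkN (KMSW2014.LeafSupport.cm l))) (canon₁₉ νtop μtop (KMSW2014.LeafSupport.mkN (KMSW2014.LeafSupport.cm l))) (canon₂₀ νtop μtop (KMSW2014.LeafSupport.mkN (KMSW2014.LeafSupport.cm l)))).LiuSunStrongBC ↔ l.onlyFull = true) ∧
        ((canon₁₇₁ νtop μtop (KMSW2014.LeafSupport.mkN (KMSW2014.LeafSupport.cm l)) (canon₂ νtop μtop (KMSW2014.LeafSupport.mkN (KMSW2014.LeafSupport.cm l))) (canon₁₉ νtop μtop (KMSW2014.LeafSupport.mkN (KMSW2014.LeafSupport.cm l))) (canon₂₀ νtop μtop (KMSW2014.LeafSupport.mkN (KMSW2014.LeafSupport.cm l)))).LiuSunPadicL ↔ l.onlyFull = true) ∧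
        (canon₁₇₁ νtop μtop (KMSW2014.LeafSupport.mkN (KMSW2014.LeafSupport.cm l)) (canon₂ νtop μtop (KMSW2014.LeafSupport.mkN (KMSW2014.LeafSupport.cm l))) (canon₁₉ νtop μtop (KMSW2014.LeafSupport.mkN (KMSW2014.LeafSupport.cm l))) (canon₂₀ νtop μtop (KMSW2014.LeafSupport.mkN (KMSW2014.LeafSupport.cm l)))).ChengSKMultiplicity ∧
        (canon₁₇₁ νtop μtop (KMSW2014.LeafSupport.mkN (KMSW2014.LeafSupport.cm l)) (canon₂ νtop μtop (KMSW2014.LeafSupport.mkN (KMSW2014.LeafSupport.cm l))) (canon₁₉ νtop μtop (KMSW2014.LeafSupport.mkN (KMSW2014.LeafSupport.cm l))) (canon₂₀ νtop μtop (KMSW2014.LeafSupport.mkN (KMSW2014.LeafSupport.cm l)))).ChengHodge) :=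
  ⟨⟨c171_top.2.1, c171_top.2.2.1, c171_top.2.2.2.2.1, c171_top.2.2.2.2.2⟩,
    fun l =>
      have h := c171_book_cm l
      ⟨h.1, h.2.2.1, h.2.2.2.1, h.2.2.2.2.1, h.2.2.2.2.2.1⟩,
    fun l =>
      have h := c171_mok_cm l
      ⟨h.1, h.2.2.1, h.2.2.2.1, h.2.2.2.2.1, h.2.2.2.2.2⟩,
    fun l =>
      have h := c171_kmsw_cm l
      ⟨h.1, h.2.2.1, h.2.2.2.1, h.2.2.2.2.1, h.2.2.2.2.2⟩⟩

/-! ## 174. Hundred-and-seventy-second tranche (v4 of this file, after `Downstream47.lean` v2; unit `pub-arthur-down-g71`, downstream tracer gen 71): supports of NEW rows C329 (Haining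
Wang, *Arithmetic level raising for certain quaternionic unitary Shimura variety*, arXiv:2204.06976 (2022), preprint) and C330 (M. Emerton – T. Gee, *p-adic Hodge-theoretic properties of
étale cohomology with mod p coefficients, and the cohomology of Shimura varieties*, Algebra Number Theory 9 (2015) 1035–1088 = arXiv:1203.4963).  The canonical reading `canon₁₇₂ ν μ κ c₂₈`
over an ARBITRARY tranche-28 assignment (read canonically below through section 31's `canon₂₈ ν μ κ`: C191 `MokGSp4` and C144 `HWang` := the book at every rank ∧ A4's value): C329
Theorem 24 := exactly the four premises its edge receives, ν.FL ∧ ν.WFL_split ∧ ν.WFL_general ∧ ν.STF_Arthur (the reading of the auxiliary nodes `StabInner` / `StabOrdSim` in section 1's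
`canon`); C329 Theorem 4 := C191's value ∧ C144's value ∧ that conjunction; C330 Theorem 3 = 39 := Mok at every rank ∧ KMSW's proved scope; C330 Corollary 34 (control) := `True`.  Every
tranche-172 edge holds in it (`canon_implications₁₇₂`).  READINGS: (i) AT THE TOP the bundle holds and all four fields HOLD — by the tranche's own `hwangALR_of_inputs` /
`emertonGee_of_inputs` from section 31's `canon_implications₂₈`, section 1's `canon_implications` and `bookInputs_top` / `mokInputs_top` / `kmswInputs_top` (`c172_top`); (ii) BOOK SIDE,
TWO-SIDED FOR THEOREM 24: in the book countermodel of the leaf `l` Theorem 24 holds IFF `l.stabOrdB = false`, i.e. it FAILS exactly in the four countermodels removing the fundamental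
lemma, the split weighted FL, the general weighted FL or [ArthurSTF1–3] (`hwangJL_support`, by `decide` on the carver's numerals through `hwangJL_mk`) — the other twenty book leaves (the
local Langlands correspondence and the spectral inputs for GL(N), transfer, [W4] Thm 3.8, the twisted trace formula, Mœglin – Waldspurger's stabilisation, the local / invariant trace formulas,
the archimedean inputs, Ban – Aubert, [A11]-twisted, the seven 2024–2026 preprint supplies, the non-standard weighted FL) are NOT load-bearing for it; Theorem 4 FAILS in all 24 (through
C191 / C144 ⇐ the book); C330's theorem HOLDS (unitary groups only) and its control holds (`c172_book_cm`); (iii) MOK SIDE: in each of Mok's 29 countermodels (book at the top, KMSW read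
`κnoMok`) C329's two fields HOLD and C330's theorem FAILS (`c172_mok_cm`); (iv) KMSW SIDE: in KMSW's countermodel of ANY KMSW leaf `l` (book and Mok at the top) C329's two fields hold and
C330's theorem holds IFF `l.onlyFull = true` (the sequel-only leaves `AubertSS`, `KMS_A`, `KMS_B`): KMSW's proved-scope leaves are load-bearing through the footnote's « Kaletha–Minguez–Shin–White »
as typed, its unwritten sequels are NOT (`c172_kmsw_cm`).  Supports, exact: support(C329 Thm 24) = {FL, WFL_split, WFL_general, STF_Arthur}; support(C329 Thm 4) = the 24 book leaves;
support(C330 Thm 3 = 39) = Mok's 29 leaves ∧ KMSW's proved-scope leaves, NO book leaf; the control: ∅. -/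

section Canon172

variable (ν : Nodes) (μ : Mok2015.Nodes) (κ : KMSW2014.Nodes)

/-- The canonical reading of NEW rows C329 / C330 over an arbitrary tranche-28 assignment. [cite: WangHaining2022LevelRaising, Thm 24, Thm 4; EmertonGee2015padicHodge, Cor. 34, Thm 3 = Thm 39 of the arXiv rendering (canonical model; bookkeeping)] [claim: WangHaining2022LevelRaising, under-review] -/
abbrev canon₁₇₂ (c₂₈ : Consumers28) : Consumers172 where
  HWangJL := ν.FL ∧ ν.WFL_split ∧ ν.WFL_general ∧ ν.STF_Arthur
  HWangALR := c₂₈.MokGSp4 ∧ c₂₈.HWang ∧ (ν.FL ∧ ν.WFL_split ∧ ν.WFL_general ∧ ν.STF_Arthur)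
  EmertonGeeVanishing := True
  EmertonGeeWeights := (∀ N, μ.Everything N) ∧ (∀ N, κ.Scope N)

/-- Every hundred-and-seventy-second-tranche edge holds in the canonical reading, for arbitrary ν, μ, κ and an arbitrary tranche-28 assignment. [cite: WangHaining2022LevelRaising, Thm 24, Thm 4; EmertonGee2015padicHodge, Thm 39 of the arXiv rendering (bookkeeping proved here)] [claim: WangHaining2022LevelRaising, under-review] -/
theorem canon_implications₁₇₂ (c₂₈ : Consumers28) : Implications172 ν μ κ c₂₈ (canon₁₇₂ ν μ κ c₂₈) where
  hwangJL := fun a b c d => ⟨a, b, c, d⟩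
  hwangALR := fun m w j => ⟨m, w, j⟩
  egVanishing := True.intro
  egWeights := fun m k _ => ⟨m, k⟩

/-- Boolean form of C329 Theorem 24's canonical reading under a valuation structure: the four stabilisation bits. [cite: WangHaining2022LevelRaising, Thm 24 with §4.2 Thm 22 (corpus `paper:arxiv-2204.06976` p0018:L2-7) (bookkeeping proved here)] [claim: WangHaining2022LevelRaising, under-review] -/
theorem hwangJL_mk (v : Nat) (c₂₈ : Consumers28) :
    (canon₁₇₂ (LeafSupport.mkN v) μ κ c₂₈).HWangJL ↔ LeafSupport.allB v [.FL, .WFL_split, .WFL_general, .STF_Arthur] = true := by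
  have e := LeafSupport.allP_iff_allB v [.FL, .WFL_split, .WFL_general, .STF_Arthur]
  simp only [LeafSupport.allP] at e
  constructor
  · intro h
    obtain ⟨h1, h2, h3, h4⟩ := h
    exact e.1 ⟨h1, h2, h3, h4, trivial⟩
  · intro h
    obtain ⟨h1, h2, h3, h4, -⟩ := e.2 h
    exact ⟨h1, h2, h3, h4⟩

end Canon172

/-- The four book leaves in C329 Theorem 24's support as typed — the fundamental lemma, the split weighted FL, the general weighted FL, Arthur's stable trace formula I–III (the premises of
`E_HWangJL` = those of `E_StabInner` / `E_StabOrdSim`) — as a Boolean predicate on the book's 24 leaves. [cite: WangHaining2022LevelRaising, §4.2 Thm 22 (corpus `paper:arxiv-2204.06976` p0018:L2) (bookkeeping)] [claim: WangHaining2022LevelRaising, under-review] -/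
def _root_.Literature.NumberTheory.Automorphic.Arthur2013.LeafSupport.Leaf.stabOrdB : LeafSupport.Leaf → Bool
  | .FL => true | .WFL_split => true | .WFL_general => true | .STF_Arthur => true
  | _ => false

/-- The four stabilisation leaves — C329 Theorem 24's canonical reading — hold at the top. [cite: WangHaining2022LevelRaising, Thm 24 (bookkeeping proved here)] [claim: WangHaining2022LevelRaising, under-review] -/
theorem hwangJL_top : (canon₁₇₂ νtop μtop κtop (canon₂₈ νtop μtop κtop)).HWangJL :=
  ⟨bookInputs_top.published.fl, bookInputs_top.published.wfl_split, bookInputs_top.unwritten.wfl_general, bookInputs_top.published.stf⟩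

/-- C329 THEOREM 24, TWO-SIDED: in the 24 book countermodels (Mok / KMSW at the top, tranche 28 read canonically there) Theorem 24's reading FAILS exactly when the removed leaf is one of
the four stabilisation leaves and HOLDS for the other twenty. [cite: WangHaining2022LevelRaising, §4.2 (corpus `paper:arxiv-2204.06976` p0018:L2-7) (bookkeeping proved here: two-sided support of Thm 24 as typed)] [claim: WangHaining2022LevelRaising, under-review] -/
theorem hwangJL_support (l : LeafSupport.Leaf) :
    (canon₁₇₂ (LeafSupport.mkN (LeafSupport.cm l)) μtop κtop (canon₂₈ (LeafSupport.mkN (LeafSupport.cm l)) μtop κtop)).HWangJL ↔ l.stabOrdB = false :=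
  (hwangJL_mk μtop κtop (LeafSupport.cm l) (canon₂₈ (LeafSupport.mkN (LeafSupport.cm l)) μtop κtop)).trans (by cases l <;> decide)

/-- AT THE TOP (every leaf of the three DAGs granted; tranche 28 read canonically): the bundle holds and ALL FOUR fields of rows C329 / C330 HOLD — by the tranche's `hwangALR_of_inputs`
over section 31's `canon_implications₂₈` and section 1's `canon_implications` with `bookInputs_top`, and `emertonGee_of_inputs` with `mokInputs_top` / `kmswInputs_top`. [cite: WangHaining2022LevelRaising, Thm 24, Thm 4; EmertonGee2015padicHodge, Thm 39 of the arXiv rendering (bookkeeping proved here)] [claim: KalethaMinguezShinWhite2014, under-review] -/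
theorem c172_top :
    Implications172 νtop μtop κtop (canon₂₈ νtop μtop κtop) (canon₁₇₂ νtop μtop κtop (canon₂₈ νtop μtop κtop)) ∧
      (canon₁₇₂ νtop μtop κtop (canon₂₈ νtop μtop κtop)).HWangJL ∧
      (canon₁₇₂ νtop μtop κtop (canon₂₈ νtop μtop κtop)).HWangALR ∧
      (canon₁₇₂ νtop μtop κtop (canon₂₈ νtop μtop κtop)).EmertonGeeVanishing ∧
      (canon₁₇₂ νtop μtop κtop (canon₂₈ νtop μtop κtop)).EmertonGeeWeights :=
  have Y := canon_implications₁₇₂ νtop μtop κtop (canon₂₈ νtop μtop κtop)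
  have hw := hwangALR_of_inputs Y (canon_implications₂₈ νtop μtop κtop) (canon_implications νtop μtop κtop) bookInputs_top
  have eg := emertonGee_of_inputs Y mokInputs_top (kmswInputs_top μtop).1
  ⟨Y, hw.1, hw.2, True.intro, eg.2⟩

/-- BOOK SIDE: in the book countermodel of ANY of the 24 leaves `l` (Mok / KMSW at the top; tranche 28 read canonically there) the bundle holds; C329's Theorem 24 holds IFF the removed
leaf is not one of its four stabilisation leaves, C329's Theorem 4 FAILS (through C191 and C144 ⇐ the book at every rank), C330's Theorem 3 = 39 HOLDS (unitary groups only: no book input)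
and its control holds. [cite: WangHaining2022LevelRaising, §4.2 (corpus `paper:arxiv-2204.06976` p0018:L2), §8 (p0033:L9); EmertonGee2015padicHodge, Thm 39 footnote (corpus `paper:arxiv-1203.4963` p0026:L106-111) (separating models; bookkeeping proved here)] [claim: KalethaMinguezShinWhite2014, under-review] -/
theorem c172_book_cm (l : LeafSupport.Leaf) :
    ¬ (LeafSupport.mkN (LeafSupport.cm l)).leaf l ∧
      Implications172 (LeafSupport.mkN (LeafSupport.cm l)) μtop κtop (canon₂₈ (LeafSupport.mkN (LeafSupport.cm l)) μtop κtop) (canon₁₇₂ (LeafSupport.mkN (LeafSupport.cm l)) μtop κtop (canon₂₈ (LeafSupport.mkN (LeafSupport.cm l)) μtop κtop)) ∧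
      ((canon₁₇₂ (LeafSupport.mkN (LeafSupport.cm l)) μtop κtop (canon₂₈ (LeafSupport.mkN (LeafSupport.cm l)) μtop κtop)).HWangJL ↔ l.stabOrdB = false) ∧
      ¬ (canon₁₇₂ (LeafSupport.mkN (LeafSupport.cm l)) μtop κtop (canon₂₈ (LeafSupport.mkN (LeafSupport.cm l)) μtop κtop)).HWangALR ∧
      (canon₁₇₂ (LeafSupport.mkN (LeafSupport.cm l)) μtop κtop (canon₂₈ (LeafSupport.mkN (LeafSupport.cm l)) μtop κtop)).EmertonGeeWeights ∧
      (canon₁₇₂ (LeafSupport.mkN (LeafSupport.cm l)) μtop κtop (canon₂₈ (LeafSupport.mkN (LeafSupport.cm l)) μtop κtop)).EmertonGeeVanishing :=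
  have nb := not_B_cm l
  have m : ∀ N, μtop.Everything N := mokInputs_top.everything
  have k : ∀ N, κtop.Scope N := (kmswInputs_top μtop).1.scope mokInputs_top
  ⟨(LeafSupport.countermodel l).2.2.1, canon_implications₁₇₂ _ _ _ _, hwangJL_support l, fun h => nb h.1.1, ⟨m, k⟩, True.intro⟩

/-- MOK SIDE: in Mok's countermodel of ANY Mok leaf `l` (the book at the top, KMSW read `κnoMok`; tranche 28 read canonically there) the bundle holds; C329's Theorem 24 and Theorem 4 HOLD
(GSp₄ and its inner forms only: nothing of Mok's) while C330's Theorem 3 = 39 FAILS (« Mok and Kaletha–Minguez–Shin–White » runs through Mok's memoir). [cite: WangHaining2022LevelRaising, Thm 4; EmertonGee2015padicHodge, Thm 39 footnote (corpus `paper:arxiv-1203.4963` p0026:L111) (separating models; bookkeeping proved here)] [claim: WangHaining2022LevelRaising, under-review] -/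
theorem c172_mok_cm (l : Mok2015.LeafSupport.Leaf) :
    ¬ (Mok2015.LeafSupport.mkN (Mok2015.LeafSupport.cm l)).leaf l ∧
      Implications172 νtop (Mok2015.LeafSupport.mkN (Mok2015.LeafSupport.cm l)) κnoMok (canon₂₈ νtop (Mok2015.LeafSupport.mkN (Mok2015.LeafSupport.cm l)) κnoMok) (canon₁₇₂ νtop (Mok2015.LeafSupport.mkN (Mok2015.LeafSupport.cm l)) κnoMok (canon₂₈ νtop (Mok2015.LeafSupport.mkN (Mok2015.LeafSupport.cm l)) κnoMok)) ∧
      (canon₁₇₂ νtop (Mok2015.LeafSupport.mkN (Mok2015.LeafSupport.cm l)) κnoMok (canon₂₈ νtop (Mok2015.LeafSupport.mkN (Mok2015.LeafSupport.cm l)) κnoMok)).HWangJL ∧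
      (canon₁₇₂ νtop (Mok2015.LeafSupport.mkN (Mok2015.LeafSupport.cm l)) κnoMok (canon₂₈ νtop (Mok2015.LeafSupport.mkN (Mok2015.LeafSupport.cm l)) κnoMok)).HWangALR ∧
      ¬ (canon₁₇₂ νtop (Mok2015.LeafSupport.mkN (Mok2015.LeafSupport.cm l)) κnoMok (canon₂₈ νtop (Mok2015.LeafSupport.mkN (Mok2015.LeafSupport.cm l)) κnoMok)).EmertonGeeWeights :=
  have b : ∀ N, νtop.Everything N := bookInputs_top.everything
  have j : (canon₁₇₂ νtop (Mok2015.LeafSupport.mkN (Mok2015.LeafSupport.cm l)) κnoMok (canon₂₈ νtop (Mok2015.LeafSupport.mkN (Mok2015.LeafSupport.cm l)) κnoMok)).HWangJL := hwangJL_top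
  have nm := not_M_cm l
  ⟨(Mok2015.LeafSupport.countermodel l).2.2.1, canon_implications₁₇₂ _ _ _ _, j, ⟨⟨b, b⟩, ⟨b, b⟩, j⟩, fun h => nm h.1⟩

/-- KMSW SIDE: in KMSW's countermodel of ANY KMSW leaf `l` (book and Mok at the top; tranche 28 read canonically there) the bundle holds; C329's two fields hold; C330's Theorem 3 = 39 holds
IFF `l.onlyFull = true` — i.e. exactly when the removed leaf is one of the sequel-only leaves `AubertSS`, `KMS_A`, `KMS_B`: KMSW's PROVED-SCOPE leaves are load-bearing as typed (the footnote
names KMSW next to Mok; U(2,1) is quasi-split, K1 not triggered), its two unwritten sequels are not. [cite: EmertonGee2015padicHodge, Thm 39 footnote (corpus `paper:arxiv-1203.4963` p0026:L106-111) (separating models; bookkeeping proved here)] [claim: KalethaMinguezShinWhite2014, under-review] -/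
theorem c172_kmsw_cm (l : KMSW2014.LeafSupport.Leaf) :
    ¬ (KMSW2014.LeafSupport.mkN (KMSW2014.LeafSupport.cm l)).leaf l ∧
      Implications172 νtop μtop (KMSW2014.LeafSupport.mkN (KMSW2014.LeafSupport.cm l)) (canon₂₈ νtop μtop (KMSW2014.LeafSupport.mkN (KMSW2014.LeafSupport.cm l))) (canon₁₇₂ νtop μtop (KMSW2014.LeafSupport.mkN (KMSW2014.LeafSupport.cm l)) (canon₂₈ νtop μtop (KMSW2014.LeafSupport.mkN (KMSW2014.LeafSupport.cm l)))) ∧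
      (canon₁₇₂ νtop μtop (KMSW2014.LeafSupport.mkN (KMSW2014.LeafSupport.cm l)) (canon₂₈ νtop μtop (KMSW2014.LeafSupport.mkN (KMSW2014.LeafSupport.cm l)))).HWangJL ∧
      (canon₁₇₂ νtop μtop (KMSW2014.LeafSupport.mkN (KMSW2014.LeafSupport.cm l)) (canon₂₈ νtop μtop (KMSW2014.LeafSupport.mkN (KMSW2014.LeafSupport.cm l)))).HWangALR ∧
      ((canon₁₇₂ νtop μtop (KMSW2014.LeafSupport.mkN (KMSW2014.LeafSupport.cm l)) (canon₂₈ νtop μtop (KMSW2014.LeafSupport.mkN (KMSW2014.LeafSupport.cm l)))).EmertonGeeWeights ↔ l.onlyFull = true) := by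
  have b : ∀ N, νtop.Everything N := bookInputs_top.everything
  have m : ∀ N, μtop.Everything N := mokInputs_top.everything
  have j : (canon₁₇₂ νtop μtop (KMSW2014.LeafSupport.mkN (KMSW2014.LeafSupport.cm l)) (canon₂₈ νtop μtop (KMSW2014.LeafSupport.mkN (KMSW2014.LeafSupport.cm l)))).HWangJL := hwangJL_top
  have nk : l.onlyFull = false → ¬ ∀ N, (KMSW2014.LeafSupport.mkN (KMSW2014.LeafSupport.cm l)).Scope N :=
    fun hb hk => KMSW2014.LeafSupport.not_scope_of (KMSW2014.LeafSupport.scope_fails l hb 0) (hk 0)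
  refine ⟨(KMSW2014.LeafSupport.countermodel l).2.2.1, canon_implications₁₇₂ _ _ _ _, j, ⟨⟨b, b⟩, ⟨b, b⟩, j⟩, ?_⟩
  constructor
  · intro h
    cases hb : l.onlyFull
    · exact absurd h.2 (nk hb)
    · rfl
  · intro h
    exact ⟨m, scope_of_onlyFull l h⟩

/-- THE HUNDRED-AND-SEVENTY-SECOND TRANCHE REGRADED, in one statement: (i) at the top C329's two fields and C330's theorem hold; (ii) in the book countermodel of the leaf `l` C329's
Theorem 24 holds iff `l.stabOrdB = false`, C329's Theorem 4 fails and C330's theorem holds; (iii) in Mok's countermodel of any Mok leaf C329's two fields hold and C330's theorem fails;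
(iv) in KMSW's countermodel of any KMSW leaf `l` C329's two fields hold and C330's theorem holds iff `l.onlyFull = true`.  Supports, exact: support(C329 Thm 24) = the four stabilisation
leaves FL, WFL_split, WFL_general, STF_Arthur; support(C329 Thm 4 with Cor. 60 / Thm 61) = the 24 book leaves; support(C330 Thm 3 = Thm 39) = Mok's 29 leaves ∧ KMSW's proved-scope
leaves (no book leaf, no KMSW sequel); the control (C330 Cor. 34): ∅. [cite: WangHaining2022LevelRaising, Thm 24, Thm 4; EmertonGee2015padicHodge, Cor. 34, Thm 39 of the arXiv rendering (bookkeeping proved here)] [claim: KalethaMinguezShinWhite2014, under-review] -/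
theorem c172_regraded :
    ((canon₁₇₂ νtop μtop κtop (canon₂₈ νtop μtop κtop)).HWangJL ∧ (canon₁₇₂ νtop μtop κtop (canon₂₈ νtop μtop κtop)).HWangALR ∧ (canon₁₇₂ νtop μtop κtop (canon₂₈ νtop μtop κtop)).EmertonGeeWeights) ∧
      (∀ l : LeafSupport.Leaf, ¬ (LeafSupport.mkN (LeafSupport.cm l)).leaf l ∧
        ((canon₁₇₂ (LeafSupport.mkN (LeafSupport.cm l)) μtop κtop (canon₂₈ (LeafSupport.mkN (LeafSupport.cm l)) μtop κtop)).HWangJL ↔ l.stabOrdB = false) ∧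
        ¬ (canon₁₇₂ (LeafSupport.mkN (LeafSupport.cm l)) μtop κtop (canon₂₈ (LeafSupport.mkN (LeafSupport.cm l)) μtop κtop)).HWangALR ∧
        (canon₁₇₂ (LeafSupport.mkN (LeafSupport.cm l)) μtop κtop (canon₂₈ (LeafSupport.mkN (LeafSupport.cm l)) μtop κtop)).EmertonGeeWeights) ∧
      (∀ l : Mok2015.LeafSupport.Leaf, ¬ (Mok2015.LeafSupport.mkN (Mok2015.LeafSupport.cm l)).leaf l ∧
        (canon₁₇₂ νtop (Mok2015.LeafSupport.mkN (Mok2015.LeafSupport.cm l)) κnoMok (canon₂₈ νtop (Mok2015.LeafSupport.mkN (Mok2015.LeafSupport.cm l)) κnoMok)).HWangJL ∧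
        (canon₁₇₂ νtop (Mok2015.LeafSupport.mkN (Mok2015.LeafSupport.cm l)) κnoMok (canon₂₈ νtop (Mok2015.LeafSupport.mkN (Mok2015.LeafSupport.cm l)) κnoMok)).HWangALR ∧
        ¬ (canon₁₇₂ νtop (Mok2015.LeafSupport.mkN (Mok2015.LeafSupport.cm l)) κnoMok (canon₂₈ νtop (Mok2015.LeafSupport.mkN (Mok2015.LeafSupport.cm l)) κnoMok)).EmertonGeeWeights) ∧
      (∀ l : KMSW2014.LeafSupport.Leaf, ¬ (KMSW2014.LeafSupport.mkN (KMSW2014.LeafSupport.cm l)).leaf l ∧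
        (canon₁₇₂ νtop μtop (KMSW2014.LeafSupport.mkN (KMSW2014.LeafSupport.cm l)) (canon₂₈ νtop μtop (KMSW2014.LeafSupport.mkN (KMSW2014.LeafSupport.cm l)))).HWangJL ∧
        (canon₁₇₂ νtop μtop (KMSW2014.LeafSupport.mkN (KMSW2014.LeafSupport.cm l)) (canon₂₈ νtop μtop (KMSW2014.LeafSupport.mkN (KMSW2014.LeafSupport.cm l)))).HWangALR ∧
        ((canon₁₇₂ νtop μtop (KMSW2014.LeafSupport.mkN (KMSW2014.LeafSupport.cm l)) (canon₂₈ νtop μtop (KMSW2014.LeafSupport.mkN (KMSW2014.LeafSupport.cm l)))).EmertonGeeWeights ↔ l.onlyFull = true)) :=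
  ⟨⟨c172_top.2.1, c172_top.2.2.1, c172_top.2.2.2.2⟩,
    fun l =>
      have h := c172_book_cm l
      ⟨h.1, h.2.2.1, h.2.2.2.1, h.2.2.2.2.1⟩,
    fun l =>
      have h := c172_mok_cm l
      ⟨h.1, h.2.2.1, h.2.2.2.1, h.2.2.2.2⟩,
    fun l =>
      have h := c172_kmsw_cm l
      ⟨h.1, h.2.2.1, h.2.2.2.1, h.2.2.2.2⟩⟩

/-! ## 175. Hundred-and-seventy-third tranche (v5 of this file, after `Downstream47.lean` v3; unit `pub-arthur-down-g71`, downstream tracer gen 71): supports of NEW row C331 (A. Bertoloni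
Meli – M. Oi, *The B(G)-parametrization of the local Langlands correspondence*, arXiv:2211.13864v3 (2025), preprint).  The canonical reading `canon₁₇₃ ν μ κ c` over an ARBITRARY tranche-1
assignment (read canonically below through section 1's `canon ν μ κ`: A5 `IshimotoGeneric` := the book at every rank): the unitary instance of Theorem 3.8 := Mok at every rank ∧ KMSW's proved
scope; the odd orthogonal instance := the book at every rank ∧ A5's value; the GL_n instance (control) := `True`.  Every tranche-173 edge holds in it (`canon_implications₁₇₃`).  READINGS: (i) AT
THE TOP the bundle holds and all three fields HOLD — by the tranche's own `bmOiUnitary_of_inputs` / `bmOiOddOrthogonal_of_inputs` from section 1's `canon_implications` and `bookInputs_top` /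
`mokInputs_top` / `kmswInputs_top` (`c173_top`); (ii) BOOK SIDE: in each of the 24 book countermodels the unitary instance HOLDS (no book input) while the odd orthogonal instance FAILS and the
control holds (`c173_book_cm`); (iii) MOK SIDE: in each of Mok's 29 countermodels (book at the top, KMSW read `κnoMok`) the unitary instance FAILS and the odd orthogonal instance holds
(`c173_mok_cm`); (iv) KMSW SIDE: in KMSW's countermodel of ANY KMSW leaf `l` (book and Mok at the top) the unitary instance holds IFF `l.onlyFull = true` (the sequel-only leaves `AubertSS`,
`KMS_A`, `KMS_B`): KMSW's proved-scope leaves are load-bearing through « [KMSW14] » as typed, its unwritten sequels are NOT; the odd orthogonal instance holds (`c173_kmsw_cm`).  Supports,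
exact: support(C331 unitary) = Mok's 29 leaves ∧ KMSW's proved-scope leaves, NO book leaf; support(C331 SO_{2n+1}) = the 24 book leaves; the control: ∅. -/

section Canon173

variable (ν : Nodes) (μ : Mok2015.Nodes) (κ : KMSW2014.Nodes)

/-- The canonical reading of NEW row C331 over an arbitrary tranche-1 assignment. [cite: BertoloniMeliOi2022BGParametrization, Thm 3.8 with Rem. 3.9 (3) (canonical model; bookkeeping)] [claim: BertoloniMeliOi2022BGParametrization, under-review] -/
abbrev canon₁₇₃ (c : Consumers) : Consumers173 where
  BMOiGL := True
  BMOiUnitary := (∀ N, μ.Everything N) ∧ (∀ N, κ.Scope N)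
  BMOiOddOrthogonal := (∀ N, ν.Everything N) ∧ c.IshimotoGeneric

/-- Every hundred-and-seventy-third-tranche edge holds in the canonical reading, for arbitrary ν, μ, κ and an arbitrary tranche-1 assignment. [cite: BertoloniMeliOi2022BGParametrization, Thm 3.8 with Rem. 3.9 (3) (bookkeeping proved here)] [claim: BertoloniMeliOi2022BGParametrization, under-review] -/
theorem canon_implications₁₇₃ (c : Consumers) : Implications173 ν μ κ c (canon₁₇₃ ν μ κ c) where
  bmOiGL := True.intro
  bmOiUnitary := fun m k => ⟨m, k⟩
  bmOiOddOrthogonal := fun b i => ⟨b, i⟩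

end Canon173

/-- AT THE TOP (every leaf of the three DAGs granted; tranche 1 read canonically): the bundle holds and ALL THREE fields of row C331 HOLD — by the tranche's `bmOiUnitary_of_inputs` with
`mokInputs_top` / `kmswInputs_top` and `bmOiOddOrthogonal_of_inputs` over section 1's `canon_implications` with `bookInputs_top`. [cite: BertoloniMeliOi2022BGParametrization, Thm 3.8 with Rem. 3.9 (3) (bookkeeping proved here)] [claim: KalethaMinguezShinWhite2014, under-review] -/
theorem c173_top :
    Implications173 νtop μtop κtop (canon νtop μtop κtop) (canon₁₇₃ νtop μtop κtop (canon νtop μtop κtop)) ∧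
      (canon₁₇₃ νtop μtop κtop (canon νtop μtop κtop)).BMOiGL ∧
      (canon₁₇₃ νtop μtop κtop (canon νtop μtop κtop)).BMOiUnitary ∧
      (canon₁₇₃ νtop μtop κtop (canon νtop μtop κtop)).BMOiOddOrthogonal :=
  have Y := canon_implications₁₇₃ νtop μtop κtop (canon νtop μtop κtop)
  ⟨Y, True.intro, bmOiUnitary_of_inputs Y mokInputs_top (kmswInputs_top μtop).1,
    bmOiOddOrthogonal_of_inputs Y (canon_implications νtop μtop κtop) bookInputs_top⟩

/-- BOOK SIDE: in the book countermodel of ANY of the 24 leaves `l` (Mok / KMSW at the top; tranche 1 read canonically there) the bundle holds; C331's unitary instance HOLDS (no book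
input), its odd orthogonal instance FAILS (through [Art13] and A5 ⇐ the book), its control holds — every book leaf is load-bearing for the SO_{2n+1} instance, none for the unitary one. [cite: BertoloniMeliOi2022BGParametrization, Rem. 3.9 (3) (arXiv:2211.13864v3 p0022:L26-28) (separating models; bookkeeping proved here)] [claim: KalethaMinguezShinWhite2014, under-review] -/
theorem c173_book_cm (l : LeafSupport.Leaf) :
    ¬ (LeafSupport.mkN (LeafSupport.cm l)).leaf l ∧
      Implications173 (LeafSupport.mkN (LeafSupport.cm l)) μtop κtop (canon (LeafSupport.mkN (LeafSupport.cm l)) μtop κtop) (canon₁₇₃ (LeafSupport.mkN (LeafSupport.cm l)) μtop κtop (canon (LeafSupport.mkN (LeafSupport.cm l)) μtop κtop)) ∧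
      (canon₁₇₃ (LeafSupport.mkN (LeafSupport.cm l)) μtop κtop (canon (LeafSupport.mkN (LeafSupport.cm l)) μtop κtop)).BMOiUnitary ∧
      ¬ (canon₁₇₃ (LeafSupport.mkN (LeafSupport.cm l)) μtop κtop (canon (LeafSupport.mkN (LeafSupport.cm l)) μtop κtop)).BMOiOddOrthogonal ∧
      (canon₁₇₃ (LeafSupport.mkN (LeafSupport.cm l)) μtop κtop (canon (LeafSupport.mkN (LeafSupport.cm l)) μtop κtop)).BMOiGL :=
  have nb := not_B_cm l
  have m : ∀ N, μtop.Everything N := mokInputs_top.everything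
  have k : ∀ N, κtop.Scope N := (kmswInputs_top μtop).1.scope mokInputs_top
  ⟨(LeafSupport.countermodel l).2.2.1, canon_implications₁₇₃ _ _ _ _, ⟨m, k⟩, fun h => nb h.1, True.intro⟩

/-- MOK SIDE: in Mok's countermodel of ANY Mok leaf `l` (the book at the top, KMSW read `κnoMok`; tranche 1 read canonically there) the bundle holds; C331's unitary instance FAILS
(« [Mok15], [KMSW14], and [AGI+24] ») while its odd orthogonal instance HOLDS. [cite: BertoloniMeliOi2022BGParametrization, Rem. 3.9 (3) (arXiv:2211.13864v3 p0022:L26-28) (separating models; bookkeeping proved here)] [claim: BertoloniMeliOi2022BGParametrization, under-review] -/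
theorem c173_mok_cm (l : Mok2015.LeafSupport.Leaf) :
    ¬ (Mok2015.LeafSupport.mkN (Mok2015.LeafSupport.cm l)).leaf l ∧
      Implications173 νtop (Mok2015.LeafSupport.mkN (Mok2015.LeafSupport.cm l)) κnoMok (canon νtop (Mok2015.LeafSupport.mkN (Mok2015.LeafSupport.cm l)) κnoMok) (canon₁₇₃ νtop (Mok2015.LeafSupport.mkN (Mok2015.LeafSupport.cm l)) κnoMok (canon νtop (Mok2015.LeafSupport.mkN (Mok2015.LeafSupport.cm l)) κnoMok)) ∧
      ¬ (canon₁₇₃ νtop (Mok2015.LeafSupport.mkN (Mok2015.LeafSupport.cm l)) κnoMok (canon νtop (Mok2015.LeafSupport.mkN (Mok2015.LeafSupport.cm l)) κnoMok)).BMOiUnitary ∧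
      (canon₁₇₃ νtop (Mok2015.LeafSupport.mkN (Mok2015.LeafSupport.cm l)) κnoMok (canon νtop (Mok2015.LeafSupport.mkN (Mok2015.LeafSupport.cm l)) κnoMok)).BMOiOddOrthogonal :=
  have b : ∀ N, νtop.Everything N := bookInputs_top.everything
  have nm := not_M_cm l
  ⟨(Mok2015.LeafSupport.countermodel l).2.2.1, canon_implications₁₇₃ _ _ _ _, fun h => nm h.1, ⟨b, b⟩⟩

/-- KMSW SIDE: in KMSW's countermodel of ANY KMSW leaf `l` (book and Mok at the top; tranche 1 read canonically there) the bundle holds; C331's unitary instance holds IFF `l.onlyFull =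
true` — i.e. exactly when the removed leaf is one of the sequel-only leaves `AubertSS`, `KMS_A`, `KMS_B`: KMSW's PROVED-SCOPE leaves are load-bearing as typed (p-adic inner twists of
unitary groups are pure, parameters tempered: K1 not triggered), its two unwritten sequels are not; the odd orthogonal instance holds. [cite: BertoloniMeliOi2022BGParametrization, Rem. 3.9 (3) (arXiv:2211.13864v3 p0022:L26-28) (separating models; bookkeeping proved here)] [claim: KalethaMinguezShinWhite2014, under-review] -/
theorem c173_kmsw_cm (l : KMSW2014.LeafSupport.Leaf) :
    ¬ (KMSW2014.LeafSupport.mkN (KMSW2014.LeafSupport.cm l)).leaf l ∧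
      Implications173 νtop μtop (KMSW2014.LeafSupport.mkN (KMSW2014.LeafSupport.cm l)) (canon νtop μtop (KMSW2014.LeafSupport.mkN (KMSW2014.LeafSupport.cm l))) (canon₁₇₃ νtop μtop (KMSW2014.LeafSupport.mkN (KMSW2014.LeafSupport.cm l)) (canon νtop μtop (KMSW2014.LeafSupport.mkN (KMSW2014.LeafSupport.cm l)))) ∧
      ((canon₁₇₃ νtop μtop (KMSW2014.LeafSupport.mkN (KMSW2014.LeafSupport.cm l)) (canon νtop μtop (KMSW2014.LeafSupport.mkN (KMSW2014.LeafSupport.cm l)))).BMOiUnitary ↔ l.onlyFull = true) ∧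
      (canon₁₇₃ νtop μtop (KMSW2014.LeafSupport.mkN (KMSW2014.LeafSupport.cm l)) (canon νtop μtop (KMSW2014.LeafSupport.mkN (KMSW2014.LeafSupport.cm l)))).BMOiOddOrthogonal := by
  have b : ∀ N, νtop.Everything N := bookInputs_top.everything
  have m : ∀ N, μtop.Everything N := mokInputs_top.everything
  have nk : l.onlyFull = false → ¬ ∀ N, (KMSW2014.LeafSupport.mkN (KMSW2014.LeafSupport.cm l)).Scope N :=
    fun hb hk => KMSW2014.LeafSupport.not_scope_of (KMSW2014.LeafSupport.scope_fails l hb 0) (hk 0)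
  refine ⟨(KMSW2014.LeafSupport.countermodel l).2.2.1, canon_implications₁₇₃ _ _ _ _, ?_, ⟨b, b⟩⟩
  constructor
  · intro h
    cases hb : l.onlyFull
    · exact absurd h.2 (nk hb)
    · rfl
  · intro h
    exact ⟨m, scope_of_onlyFull l h⟩

/-- THE HUNDRED-AND-SEVENTY-THIRD TRANCHE REGRADED, in one statement: (i) at the top C331's two Arthur-fed instances hold; (ii) in the book countermodel of any of the 24 leaves the unitary
instance holds and the SO_{2n+1} instance fails; (iii) in Mok's countermodel of any Mok leaf the unitary instance fails and the SO_{2n+1} instance holds; (iv) in KMSW's countermodel of any KMSW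
leaf `l` the unitary instance holds iff `l.onlyFull = true` and the SO_{2n+1} instance holds.  Supports, exact: support(C331 Thm 3.8, unitary groups) = Mok's 29 leaves ∧ KMSW's proved-scope
leaves (no book leaf, no KMSW sequel); support(C331 Thm 3.8, SO_{2n+1}) = the 24 book leaves; the control (GL_n): ∅. [cite: BertoloniMeliOi2022BGParametrization, Thm 3.8 with Rem. 3.9 (3) (bookkeeping proved here)] [claim: KalethaMinguezShinWhite2014, under-review] -/
theorem c173_regraded :
    ((canon₁₇₃ νtop μtop κtop (canon νtop μtop κtop)).BMOiUnitary ∧ (canon₁₇₃ νtop μtop κtop (canon νtop μtop κtop)).BMOiOddOrthogonal) ∧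
      (∀ l : LeafSupport.Leaf, ¬ (LeafSupport.mkN (LeafSupport.cm l)).leaf l ∧
        (canon₁₇₃ (LeafSupport.mkN (LeafSupport.cm l)) μtop κtop (canon (LeafSupport.mkN (LeafSupport.cm l)) μtop κtop)).BMOiUnitary ∧
        ¬ (canon₁₇₃ (LeafSupport.mkN (LeafSupport.cm l)) μtop κtop (canon (LeafSupport.mkN (LeafSupport.cm l)) μtop κtop)).BMOiOddOrthogonal) ∧
      (∀ l : Mok2015.LeafSupport.Leaf, ¬ (Mok2015.LeafSupport.mkN (Mok2015.LeafSupport.cm l)).leaf l ∧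
        ¬ (canon₁₇₃ νtop (Mok2015.LeafSupport.mkN (Mok2015.LeafSupport.cm l)) κnoMok (canon νtop (Mok2015.LeafSupport.mkN (Mok2015.LeafSupport.cm l)) κnoMok)).BMOiUnitary ∧
        (canon₁₇₃ νtop (Mok2015.LeafSupport.mkN (Mok2015.LeafSupport.cm l)) κnoMok (canon νtop (Mok2015.LeafSupport.mkN (Mok2015.LeafSupport.cm l)) κnoMok)).BMOiOddOrthogonal) ∧
      (∀ l : KMSW2014.LeafSupport.Leaf, ¬ (KMSW2014.LeafSupport.mkN (KMSW2014.LeafSupport.cm l)).leaf l ∧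
        ((canon₁₇₃ νtop μtop (KMSW2014.LeafSupport.mkN (KMSW2014.LeafSupport.cm l)) (canon νtop μtop (KMSW2014.LeafSupport.mkN (KMSW2014.LeafSupport.cm l)))).BMOiUnitary ↔ l.onlyFull = true) ∧
        (canon₁₇₃ νtop μtop (KMSW2014.LeafSupport.mkN (KMSW2014.LeafSupport.cm l)) (canon νtop μtop (KMSW2014.LeafSupport.mkN (KMSW2014.LeafSupport.cm l)))).BMOiOddOrthogonal) :=
  ⟨⟨c173_top.2.2.1, c173_top.2.2.2⟩,
    fun l =>
      have h := c173_book_cm l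
      ⟨h.1, h.2.2.1, h.2.2.2.1⟩,
    fun l =>
      have h := c173_mok_cm l
      ⟨h.1, h.2.2.1, h.2.2.2⟩,
    fun l =>
      have h := c173_kmsw_cm l
      ⟨h.1, h.2.2.1, h.2.2.2⟩⟩

/-! ## 176. Hundred-and-seventy-fourth tranche (v6 of this file, after `Downstream47.lean` v4; unit `pub-arthur-down-g71`, downstream tracer gen 71): supports of NEW row C332 (C. Schembri,
*Modularity of abelian surfaces over imaginary quadratic fields*, PhD thesis, University of Sheffield 2019).  The canonical reading `canon₁₇₄ c₂₈` over an ARBITRARY tranche-28 assignment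
(read canonically below through section 31's `canon₂₈ ν μ κ`: C191 `MokGSp4` := the book at every rank ∧ A4's value): Theorems 4.4.3 / 4.4.4 := C191's value; Theorems 3.2.4 / 3.3.1 (control)
:= `True`.  Both tranche-174 edges hold in it (`canon_implications₁₇₄`).  READINGS: (i) AT THE TOP the bundle holds and both fields HOLD (`schembri_of_inputs` over section 31's
`canon_implications₂₈`, section 1's `canon_implications` and `bookInputs_top`; `c174_top`); (ii) BOOK SIDE: in each of the 24 book countermodels the modularity theorem FAILS (through C191 ⇐
the book) and the control holds (`c174_book_cm`); (iii) MOK SIDE and (iv) KMSW SIDE: the modularity theorem HOLDS in every Mok / KMSW countermodel (book at the top) — nothing of the unitary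
monographs is load-bearing (`c174_mok_cm`, `c174_kmsw_cm`).  Supports, exact: support(C332 Thm 4.4.4) = the 24 book leaves; the control: ∅. -/

section Canon174

variable (ν : Nodes) (μ : Mok2015.Nodes) (κ : KMSW2014.Nodes)

/-- The canonical reading of NEW row C332 over an arbitrary tranche-28 assignment. [cite: Schembri2019Thesis, Thms 3.2.4, 4.4.4 (canonical model; bookkeeping)] -/
abbrev canon₁₇₄ (c₂₈ : Consumers28) : Consumers174 where
  SchembriGenuineQM := True
  SchembriQMModular := c₂₈.MokGSp4

/-- Both hundred-and-seventy-fourth-tranche edges hold in the canonical reading, for an arbitrary tranche-28 assignment. [cite: Schembri2019Thesis, Thm 4.4.4 (bookkeeping proved here)] -/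
theorem canon_implications₁₇₄ (c₂₈ : Consumers28) : Implications174 c₂₈ (canon₁₇₄ c₂₈) where
  schembriGenuine := True.intro
  schembriModular := fun h => h

end Canon174

/-- AT THE TOP (every leaf of the three DAGs granted; tranche 28 read canonically): the bundle holds and BOTH fields of row C332 HOLD — by the tranche's `schembri_of_inputs` over section 31's
`canon_implications₂₈` and section 1's `canon_implications` with `bookInputs_top`. [cite: Schembri2019Thesis, Thm 4.4.4 (bookkeeping proved here)] -/
theorem c174_top :
    Implications174 (canon₂₈ νtop μtop κtop) (canon₁₇₄ (canon₂₈ νtop μtop κtop)) ∧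
      (canon₁₇₄ (canon₂₈ νtop μtop κtop)).SchembriGenuineQM ∧
      (canon₁₇₄ (canon₂₈ νtop μtop κtop)).SchembriQMModular :=
  have Y := canon_implications₁₇₄ (canon₂₈ νtop μtop κtop)
  ⟨Y, True.intro, schembri_of_inputs Y (canon_implications₂₈ νtop μtop κtop) (canon_implications νtop μtop κtop) bookInputs_top⟩

/-- BOOK SIDE: in the book countermodel of ANY of the 24 leaves `l` (Mok / KMSW at the top; tranche 28 read canonically there) the bundle holds; C332's modularity theorem FAILS (through
C191 ⇐ the book at every rank) and its control holds — every book leaf is load-bearing, as printed through [Mok14]. [cite: Schembri2019Thesis, §4.1 (PDF p0054:L22-24) (separating models; bookkeeping proved here)] -/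
theorem c174_book_cm (l : LeafSupport.Leaf) :
    ¬ (LeafSupport.mkN (LeafSupport.cm l)).leaf l ∧
      Implications174 (canon₂₈ (LeafSupport.mkN (LeafSupport.cm l)) μtop κtop) (canon₁₇₄ (canon₂₈ (LeafSupport.mkN (LeafSupport.cm l)) μtop κtop)) ∧
      ¬ (canon₁₇₄ (canon₂₈ (LeafSupport.mkN (LeafSupport.cm l)) μtop κtop)).SchembriQMModular ∧
      (canon₁₇₄ (canon₂₈ (LeafSupport.mkN (LeafSupport.cm l)) μtop κtop)).SchembriGenuineQM :=
  have nb := not_B_cm l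
  ⟨(LeafSupport.countermodel l).2.2.1, canon_implications₁₇₄ _, fun h => nb h.1, True.intro⟩

/-- MOK SIDE: in Mok's countermodel of ANY Mok leaf `l` (the book at the top, KMSW read `κnoMok`; tranche 28 read canonically there) the bundle holds and C332's modularity theorem HOLDS —
nothing of Mok's memoir is load-bearing ([Mok14] is the 2014 Compositio paper, the conduit C191, not the 2015 memoir). [cite: Schembri2019Thesis, Thm 4.4.4 (separating models; bookkeeping proved here)] -/
theorem c174_mok_cm (l : Mok2015.LeafSupport.Leaf) :
    ¬ (Mok2015.LeafSupport.mkN (Mok2015.LeafSupport.cm l)).leaf l ∧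
      Implications174 (canon₂₈ νtop (Mok2015.LeafSupport.mkN (Mok2015.LeafSupport.cm l)) κnoMok) (canon₁₇₄ (canon₂₈ νtop (Mok2015.LeafSupport.mkN (Mok2015.LeafSupport.cm l)) κnoMok)) ∧
      (canon₁₇₄ (canon₂₈ νtop (Mok2015.LeafSupport.mkN (Mok2015.LeafSupport.cm l)) κnoMok)).SchembriQMModular :=
  have b : ∀ N, νtop.Everything N := bookInputs_top.everything
  ⟨(Mok2015.LeafSupport.countermodel l).2.2.1, canon_implications₁₇₄ _, ⟨b, b⟩⟩

/-- KMSW SIDE: in KMSW's countermodel of ANY KMSW leaf `l` (book and Mok at the top; tranche 28 read canonically there) the bundle holds and C332's modularity theorem HOLDS — nothing of KMSW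
is load-bearing. [cite: Schembri2019Thesis, Thm 4.4.4 (separating models; bookkeeping proved here)] -/
theorem c174_kmsw_cm (l : KMSW2014.LeafSupport.Leaf) :
    ¬ (KMSW2014.LeafSupport.mkN (KMSW2014.LeafSupport.cm l)).leaf l ∧
      Implications174 (canon₂₈ νtop μtop (KMSW2014.LeafSupport.mkN (KMSW2014.LeafSupport.cm l))) (canon₁₇₄ (canon₂₈ νtop μtop (KMSW2014.LeafSupport.mkN (KMSW2014.LeafSupport.cm l)))) ∧
      (canon₁₇₄ (canon₂₈ νtop μtop (KMSW2014.LeafSupport.mkN (KMSW2014.LeafSupport.cm l)))).SchembriQMModular :=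
  have b : ∀ N, νtop.Everything N := bookInputs_top.everything
  ⟨(KMSW2014.LeafSupport.countermodel l).2.2.1, canon_implications₁₇₄ _, ⟨b, b⟩⟩

/-- THE HUNDRED-AND-SEVENTY-FOURTH TRANCHE REGRADED, in one statement: (i) at the top C332's modularity theorem holds; (ii) in the book countermodel of any of the 24 leaves it fails; (iii) in
Mok's countermodel of any Mok leaf it holds; (iv) in KMSW's countermodel of any KMSW leaf it holds.  Supports, exact: support(C332 Thms 4.4.3 / 4.4.4) = the 24 book leaves (no Mok leaf, no
KMSW leaf); the control (Thms 3.2.4 / 3.3.1): ∅. [cite: Schembri2019Thesis, Thm 4.4.4 (bookkeeping proved here)] -/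
theorem c174_regraded :
    (canon₁₇₄ (canon₂₈ νtop μtop κtop)).SchembriQMModular ∧
      (∀ l : LeafSupport.Leaf, ¬ (LeafSupport.mkN (LeafSupport.cm l)).leaf l ∧ ¬ (canon₁₇₄ (canon₂₈ (LeafSupport.mkN (LeafSupport.cm l)) μtop κtop)).SchembriQMModular) ∧
      (∀ l : Mok2015.LeafSupport.Leaf, ¬ (Mok2015.LeafSupport.mkN (Mok2015.LeafSupport.cm l)).leaf l ∧ (canon₁₇₄ (canon₂₈ νtop (Mok2015.LeafSupport.mkN (Mok2015.LeafSupport.cm l)) κnoMok)).SchembriQMModular) ∧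
      (∀ l : KMSW2014.LeafSupport.Leaf, ¬ (KMSW2014.LeafSupport.mkN (KMSW2014.LeafSupport.cm l)).leaf l ∧ (canon₁₇₄ (canon₂₈ νtop μtop (KMSW2014.LeafSupport.mkN (KMSW2014.LeafSupport.cm l)))).SchembriQMModular) :=
  ⟨c174_top.2.2,
    fun l =>
      have h := c174_book_cm l
      ⟨h.1, h.2.2.1⟩,
    fun l =>
      have h := c174_mok_cm l
      ⟨h.1, h.2.2⟩,
    fun l =>
      have h := c174_kmsw_cm l
      ⟨h.1, h.2.2⟩⟩

/-! ## 177. Hundred-and-seventy-fifth tranche (v7 of this file, after `Downstream47.lean` v5; unit `pub-arthur-down-g72`, downstream tracer gen 72): supports of NEW rows C333 (W. T. Gan –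
G. Savin, arXiv:2308.12561), C334 (G. Castellano – S.-Y. Chen – N. Darshan – A. Raghuram, arXiv:2607.17617), C335 (D. Helm – R. Kurinczuk – D. Skodlerack – S. Stevens, arXiv:2405.13713v3)
and C336 (Chang Yang, arXiv:2312.10974) — the four rows of the NASA ADS full-text channel.  The canonical reading `canon₁₇₅ ν c₃ c₃₈ c₆₀` over ARBITRARY tranche-3 / tranche-38 /
tranche-60 assignments (read canonically below through section 1's `canon₃ ν μ κ` (C158 `DHKM` := the book ∧ Mok ∧ KMSW's proved scope at every rank), section 38's `canon₃₈ ν` (B27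
`GanSavinG2` := the book with its node and rows, all book-fed) and section 60's `canon₆₀ ν μ` (B76 `BHSJordan` := the book ∧ E41's leaves)): C333 Thm 2.4, C334 Thm 8.2 (totally imaginary
case), C336 Prop. 6.10 := the book at every rank; C333 Thm 2.2 := `c₃₈.GanSavinG2`; C335 Thm 8.6 / Cor. 8.7 := the book ∧ `c₃.DHKM` ∧ `c₆₀.BHSJordan`; the three controls := `True`.  Every
tranche-175 edge holds in it (`canon_implications₁₇₅`).  READINGS: (i) AT THE TOP the bundle holds and all eight fields HOLD — by the tranche's own `hundredseventyfifth_of_inputs` over the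
canonical bundles of sections 1, 3, 14, 15, 38, 60 and the top inputs of the three DAGs (`c175_top`); (ii) BOOK SIDE: in each of the 24 book countermodels all five Arthur-fed fields FAIL,
the controls hold (`c175_book_cm`); (iii) MOK SIDE: in each of Mok's 29 countermodels (book at the top, KMSW read `κnoMok`) C335's Thm 8.6 FAILS — through C158's typed field, which reads
Mok — while C333's, C334's, C336's fields HOLD (`c175_mok_cm`); (iv) KMSW SIDE: in KMSW's countermodel of ANY KMSW leaf `l` (book and Mok at the top) C335's Thm 8.6 holds IFF
`l.onlyFull = true` (KMSW's proved-scope leaves are load-bearing through C158, its two unwritten sequels are not), the other four Arthur-fed fields hold (`c175_kmsw_cm`).  Supports, exact: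
support(C333 Thm 2.4) = support(C333 Thm 2.2) = support(C334 Thm 8.2, tot. imaginary case) = support(C336 Prop. 6.10) = the 24 book leaves; support(C335 Thm 8.6 / Cor. 8.7) = the 24 book
leaves ∧ Mok's 29 leaves ∧ KMSW's proved-scope leaves (as printed through C158's typed field — a symplectic-only reading would cut it to the 24 book leaves, DIVERGENCE3 D-DN-g72-3); the
three controls: ∅. -/

section Canon175

variable (ν : Nodes) (μ : Mok2015.Nodes) (κ : KMSW2014.Nodes)

/-- The canonical reading of NEW rows C333 – C336 over arbitrary tranche-3 / tranche-38 / tranche-60 assignments. [cite: GanSavin2023GammaG2, Thms 2.2, 2.4; CastellanoChenDarshanRaghuram2026Betti, Thms 5.1, 8.2; HelmKurinczukSkodlerackStevens2024Blocks, Thms 1.1, 8.6; Yang2023ExtDistinction, Thm 1.4, Prop. 6.10 (canonical model; bookkeeping)] [claim: GanSavin2023GammaG2, under-review] [claim: CastellanoChenDarshanRaghuram2026Betti, under-review] [claim: HelmKurinczukSkodlerackStevens2024Blocks, under-review] [claim: Yang2023ExtDistinction, under-review] -/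
abbrev canon₁₇₅ (c₃ : Consumers3) (c₃₈ : Consumers38) (c₆₀ : Consumers60) : Consumers175 where
  GSGammaChar := ∀ N, ν.Everything N
  GSGammaLLC := c₃₈.GanSavinG2
  CCDRduality := True
  CCDRShalikaTI := ∀ N, ν.Everything N
  HKSSBlocks := True
  HKSSWild := (∀ N, ν.Everything N) ∧ c₃.DHKM ∧ c₆₀.BHSJordan
  YangExt := True
  YangRelSC := ∀ N, ν.Everything N

/-- All eight hundred-and-seventy-fifth-tranche edges hold in the canonical reading, for arbitrary tranche-3 / tranche-38 / tranche-60 assignments. [cite: GanSavin2023GammaG2, Thm 2.4; HelmKurinczukSkodlerackStevens2024Blocks, Thm 8.6 (bookkeeping proved here)] [claim: GanSavin2023GammaG2, under-review] [claim: HelmKurinczukSkodlerackStevens2024Blocks, under-review] -/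
theorem canon_implications₁₇₅ (c₃ : Consumers3) (c₃₈ : Consumers38) (c₆₀ : Consumers60) : Implications175 ν c₃ c₃₈ c₆₀ (canon₁₇₅ ν c₃ c₃₈ c₆₀) where
  gsChar := fun h => h
  gsLLC := fun h => h
  ccdrDuality := True.intro
  ccdrShalika := fun h => h
  hkssBlocks := True.intro
  hkssWild := fun b d j => ⟨b, d, j⟩
  yangExt := True.intro
  yangRelSC := fun h => h

end Canon175

/-- AT THE TOP (every leaf of the three DAGs granted; tranches 3, 38, 60 read canonically): the bundle holds and ALL EIGHT fields of rows C333 – C336 HOLD — by the tranche's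
`hundredseventyfifth_of_inputs` over sections 1 / 3 / 14 / 15 / 38 / 60's canonical bundles and `bookInputs_top`, `mokInputs_top`, `kmswInputs_top`. [cite: GanSavin2023GammaG2, Thm 2.4; CastellanoChenDarshanRaghuram2026Betti, Thm 8.2; HelmKurinczukSkodlerackStevens2024Blocks, Thm 8.6; Yang2023ExtDistinction, Prop. 6.10 (bookkeeping proved here)] [claim: GanSavin2023GammaG2, under-review] [claim: CastellanoChenDarshanRaghuram2026Betti, under-review] [claim: HelmKurinczukSkodlerackStevens2024Blocks, under-review] [claim: Yang2023ExtDistinction, under-review] [claim: KalethaMinguezShinWhite2014, under-review] -/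
theorem c175_top :
    Implications175 νtop (canon₃ νtop μtop κtop) (canon₃₈ νtop) (canon₆₀ νtop μtop) (canon₁₇₅ νtop (canon₃ νtop μtop κtop) (canon₃₈ νtop) (canon₆₀ νtop μtop)) ∧
      ((canon₁₇₅ νtop (canon₃ νtop μtop κtop) (canon₃₈ νtop) (canon₆₀ νtop μtop)).GSGammaChar ∧ (canon₁₇₅ νtop (canon₃ νtop μtop κtop) (canon₃₈ νtop) (canon₆₀ νtop μtop)).GSGammaLLC ∧ (canon₁₇₅ νtop (canon₃ νtop μtop κtop) (canon₃₈ νtop) (canon₆₀ νtop μtop)).CCDRShalikaTI ∧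
        (canon₁₇₅ νtop (canon₃ νtop μtop κtop) (canon₃₈ νtop) (canon₆₀ νtop μtop)).HKSSWild ∧ (canon₁₇₅ νtop (canon₃ νtop μtop κtop) (canon₃₈ νtop) (canon₆₀ νtop μtop)).YangRelSC) ∧
      ((canon₁₇₅ νtop (canon₃ νtop μtop κtop) (canon₃₈ νtop) (canon₆₀ νtop μtop)).CCDRduality ∧ (canon₁₇₅ νtop (canon₃ νtop μtop κtop) (canon₃₈ νtop) (canon₆₀ νtop μtop)).HKSSBlocks ∧ (canon₁₇₅ νtop (canon₃ νtop μtop κtop) (canon₃₈ νtop) (canon₆₀ νtop μtop)).YangExt) :=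
  have Y := canon_implications₁₇₅ νtop (canon₃ νtop μtop κtop) (canon₃₈ νtop) (canon₆₀ νtop μtop)
  have h := hundredseventyfifth_of_inputs Y (canon_implications νtop μtop κtop) (canon_implications₃ νtop μtop κtop) (canon_implications₁₅ νtop μtop κtop)
    (canon_implications₃₈ νtop μtop κtop) (canon_implications₆₀ νtop μtop κtop) (canon_implications₁₄ νtop) bookInputs_top mokInputs_top (kmswInputs_top μtop).1
  ⟨Y, h⟩

/-- BOOK SIDE: in the book countermodel of ANY of the 24 leaves `l` (Mok / KMSW at the top; tranches 3, 38, 60 read canonically there) the bundle holds; ALL FIVE Arthur-fed fields of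
rows C333 – C336 FAIL (each reads the book at every rank — C333 Thm 2.2 through B27, C335 Thm 8.6 through the book and C158 / B76) and the three controls hold — every book leaf is
load-bearing for every typed use of the tranche. [cite: GanSavin2023GammaG2, §2.1 (arXiv:2308.12561v1 p0003:L8-9); CastellanoChenDarshanRaghuram2026Betti, Rem. 7.3; HelmKurinczukSkodlerackStevens2024Blocks, §8; Yang2023ExtDistinction, Prop. 6.10 (separating models; bookkeeping proved here)] [claim: GanSavin2023GammaG2, under-review] [claim: CastellanoChenDarshanRaghuram2026Betti, under-review] [claim: HelmKurinczukSkodlerackStevens2024Blocks, under-review] [claim: Yang2023ExtDistinction, under-review] -/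
theorem c175_book_cm (l : LeafSupport.Leaf) :
    ¬ (LeafSupport.mkN (LeafSupport.cm l)).leaf l ∧
      Implications175 (LeafSupport.mkN (LeafSupport.cm l)) (canon₃ (LeafSupport.mkN (LeafSupport.cm l)) μtop κtop) (canon₃₈ (LeafSupport.mkN (LeafSupport.cm l))) (canon₆₀ (LeafSupport.mkN (LeafSupport.cm l)) μtop) (canon₁₇₅ (LeafSupport.mkN (LeafSupport.cm l)) (canon₃ (LeafSupport.mkN (LeafSupport.cm l)) μtop κtop) (canon₃₈ (LeafSupport.mkN (LeafSupport.cm l))) (canon₆₀ (LeafSupport.mkN (LeafSupport.cm l)) μtop)) ∧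
      ¬ (canon₁₇₅ (LeafSupport.mkN (LeafSupport.cm l)) (canon₃ (LeafSupport.mkN (LeafSupport.cm l)) μtop κtop) (canon₃₈ (LeafSupport.mkN (LeafSupport.cm l))) (canon₆₀ (LeafSupport.mkN (LeafSupport.cm l)) μtop)).GSGammaChar ∧ ¬ (canon₁₇₅ (LeafSupport.mkN (LeafSupport.cm l)) (canon₃ (LeafSupport.mkN (LeafSupport.cm l)) μtop κtop) (canon₃₈ (LeafSupport.mkN (LeafSupport.cm l))) (canon₆₀ (LeafSupport.mkN (LeafSupport.cm l)) μtop)).GSGammaLLC ∧ ¬ (canon₁₇₅ (LeafSupport.mkN (LeafSupport.cm l)) (canon₃ (LeafSupport.mkN (LeafSupport.cm l)) μtop κtop) (canon₃₈ (LeafSupport.mkN (LeafSupport.cm l))) (canon₆₀ (LeafSupport.mkN (LeafSupport.cm l)) μtop)).CCDRShalikaTI ∧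
      ¬ (canon₁₇₅ (LeafSupport.mkN (LeafSupport.cm l)) (canon₃ (LeafSupport.mkN (LeafSupport.cm l)) μtop κtop) (canon₃₈ (LeafSupport.mkN (LeafSupport.cm l))) (canon₆₀ (LeafSupport.mkN (LeafSupport.cm l)) μtop)).HKSSWild ∧ ¬ (canon₁₇₅ (LeafSupport.mkN (LeafSupport.cm l)) (canon₃ (LeafSupport.mkN (LeafSupport.cm l)) μtop κtop) (canon₃₈ (LeafSupport.mkN (LeafSupport.cm l))) (canon₆₀ (LeafSupport.mkN (LeafSupport.cm l)) μtop)).YangRelSC ∧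
      ((canon₁₇₅ (LeafSupport.mkN (LeafSupport.cm l)) (canon₃ (LeafSupport.mkN (LeafSupport.cm l)) μtop κtop) (canon₃₈ (LeafSupport.mkN (LeafSupport.cm l))) (canon₆₀ (LeafSupport.mkN (LeafSupport.cm l)) μtop)).CCDRduality ∧ (canon₁₇₅ (LeafSupport.mkN (LeafSupport.cm l)) (canon₃ (LeafSupport.mkN (LeafSupport.cm l)) μtop κtop) (canon₃₈ (LeafSupport.mkN (LeafSupport.cm l))) (canon₆₀ (LeafSupport.mkN (LeafSupport.cm l)) μtop)).HKSSBlocks ∧ (canon₁₇₅ (LeafSupport.mkN (LeafSupport.cm l)) (canon₃ (LeafSupport.mkN (LeafSupport.cm l)) μtop κtop) (canon₃₈ (LeafSupport.mkN (LeafSupport.cm l))) (canon₆₀ (LeafSupport.mkN (LeafSupport.cm l)) μtop)).YangExt) :=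
  have nb := not_B_cm l
  ⟨(LeafSupport.countermodel l).2.2.1, canon_implications₁₇₅ _ _ _ _, fun h => nb h, fun h => nb h.1, fun h => nb h, fun h => nb h.1, fun h => nb h,
    ⟨True.intro, True.intro, True.intro⟩⟩

/-- MOK SIDE: in Mok's countermodel of ANY Mok leaf `l` (the book at the top, KMSW read `κnoMok`; tranches 3, 38, 60 read canonically there) the bundle holds; C335's Thm 8.6 / Cor. 8.7
FAILS — through C158's typed field `DHKM` (the general classical-groups statement of Dat – Helm – Kurinczuk – Moss, which reads Mok's memoir) — while C333's two theorems (B27 is book-fed: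
tranche 38's `ganSavinG2_of_leaves`), C334's Thm 8.2 and C336's Prop. 6.10 HOLD. [cite: HelmKurinczukSkodlerackStevens2024Blocks, §8 (arXiv:2405.13713v3 p0038:L47-54); GanSavin2023GammaG2, Thm 2.2 (separating models; bookkeeping proved here)] [claim: HelmKurinczukSkodlerackStevens2024Blocks, under-review] [claim: GanSavin2023GammaG2, under-review] -/
theorem c175_mok_cm (l : Mok2015.LeafSupport.Leaf) :
    ¬ (Mok2015.LeafSupport.mkN (Mok2015.LeafSupport.cm l)).leaf l ∧
      Implications175 νtop (canon₃ νtop (Mok2015.LeafSupport.mkN (Mok2015.LeafSupport.cm l)) κnoMok) (canon₃₈ νtop) (canon₆₀ νtop (Mok2015.LeafSupport.mkN (Mok2015.LeafSupport.cm l))) (canon₁₇₅ νtop (canon₃ νtop (Mok2015.LeafSupport.mkN (Mok2015.LeafSupport.cm l)) κnoMok) (canon₃₈ νtop) (canon₆₀ νtop (Mok2015.LeafSupport.mkN (Mok2015.LeafSupport.cm l)))) ∧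
      (canon₁₇₅ νtop (canon₃ νtop (Mok2015.LeafSupport.mkN (Mok2015.LeafSupport.cm l)) κnoMok) (canon₃₈ νtop) (canon₆₀ νtop (Mok2015.LeafSupport.mkN (Mok2015.LeafSupport.cm l)))).GSGammaChar ∧ (canon₁₇₅ νtop (canon₃ νtop (Mok2015.LeafSupport.mkN (Mok2015.LeafSupport.cm l)) κnoMok) (canon₃₈ νtop) (canon₆₀ νtop (Mok2015.LeafSupport.mkN (Mok2015.LeafSupport.cm l)))).GSGammaLLC ∧ (canon₁₇₅ νtop (canon₃ νtop (Mok2015.LeafSupport.mkN (Mok2015.LeafSupport.cm l)) κnoMok) (canon₃₈ νtop) (canon₆₀ νtop (Mok2015.LeafSupport.mkN (Mok2015.LeafSupport.cm l)))).CCDRShalikaTI ∧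
      ¬ (canon₁₇₅ νtop (canon₃ νtop (Mok2015.LeafSupport.mkN (Mok2015.LeafSupport.cm l)) κnoMok) (canon₃₈ νtop) (canon₆₀ νtop (Mok2015.LeafSupport.mkN (Mok2015.LeafSupport.cm l)))).HKSSWild ∧ (canon₁₇₅ νtop (canon₃ νtop (Mok2015.LeafSupport.mkN (Mok2015.LeafSupport.cm l)) κnoMok) (canon₃₈ νtop) (canon₆₀ νtop (Mok2015.LeafSupport.mkN (Mok2015.LeafSupport.cm l)))).YangRelSC :=
  have b : ∀ N, νtop.Everything N := bookInputs_top.everything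
  have nm := not_M_cm l
  have g : (canon₃₈ νtop).GanSavinG2 :=
    ganSavinG2_of_leaves (canon_implications₃₈ νtop (Mok2015.LeafSupport.mkN (Mok2015.LeafSupport.cm l)) κnoMok) (canon_implications νtop (Mok2015.LeafSupport.mkN (Mok2015.LeafSupport.cm l)) κnoMok)
      (canon_implications₁₅ νtop (Mok2015.LeafSupport.mkN (Mok2015.LeafSupport.cm l)) κnoMok) bookInputs_top
  ⟨(Mok2015.LeafSupport.countermodel l).2.2.1, canon_implications₁₇₅ _ _ _ _, b, g, b, fun h => nm h.2.1.2.1, b⟩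

/-- KMSW SIDE: in KMSW's countermodel of ANY KMSW leaf `l` (book and Mok at the top; tranches 3, 38, 60 read canonically there) the bundle holds; C335's Thm 8.6 / Cor. 8.7 holds IFF
`l.onlyFull = true` — i.e. exactly when the removed leaf is one of the sequel-only leaves: KMSW's PROVED-SCOPE leaves are load-bearing through C158's typed field, its two unwritten
sequels are not; C333's, C334's and C336's Arthur-fed fields HOLD (book-fed). [cite: HelmKurinczukSkodlerackStevens2024Blocks, §8 (arXiv:2405.13713v3 p0038:L47-54) (separating models; bookkeeping proved here)] [claim: HelmKurinczukSkodlerackStevens2024Blocks, under-review] [claim: KalethaMinguezShinWhite2014, under-review] -/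
theorem c175_kmsw_cm (l : KMSW2014.LeafSupport.Leaf) :
    ¬ (KMSW2014.LeafSupport.mkN (KMSW2014.LeafSupport.cm l)).leaf l ∧
      Implications175 νtop (canon₃ νtop μtop (KMSW2014.LeafSupport.mkN (KMSW2014.LeafSupport.cm l))) (canon₃₈ νtop) (canon₆₀ νtop μtop) (canon₁₇₅ νtop (canon₃ νtop μtop (KMSW2014.LeafSupport.mkN (KMSW2014.LeafSupport.cm l))) (canon₃₈ νtop) (canon₆₀ νtop μtop)) ∧
      (canon₁₇₅ νtop (canon₃ νtop μtop (KMSW2014.LeafSupport.mkN (KMSW2014.LeafSupport.cm l))) (canon₃₈ νtop) (canon₆₀ νtop μtop)).GSGammaChar ∧ (canon₁₇₅ νtop (canon₃ νtop μtop (KMSW2014.LeafSupport.mkN (KMSW2014.LeafSupport.cm l))) (canon₃₈ νtop) (canon₆₀ νtop μtop)).GSGammaLLC ∧ (canon₁₇₅ νtop (canon₃ νtop μtop (KMSW2014.LeafSupport.mkN (KMSW2014.LeafSupport.cm l))) (canon₃₈ νtop) (canon₆₀ νtop μtop)).CCDRShalikaTI ∧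
      ((canon₁₇₅ νtop (canon₃ νtop μtop (KMSW2014.LeafSupport.mkN (KMSW2014.LeafSupport.cm l))) (canon₃₈ νtop) (canon₆₀ νtop μtop)).HKSSWild ↔ l.onlyFull = true) ∧ (canon₁₇₅ νtop (canon₃ νtop μtop (KMSW2014.LeafSupport.mkN (KMSW2014.LeafSupport.cm l))) (canon₃₈ νtop) (canon₆₀ νtop μtop)).YangRelSC := by
  have b : ∀ N, νtop.Everything N := bookInputs_top.everything
  have m : ∀ N, μtop.Everything N := mokInputs_top.everything
  have g : (canon₃₈ νtop).GanSavinG2 :=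
    ganSavinG2_of_leaves (canon_implications₃₈ νtop μtop (KMSW2014.LeafSupport.mkN (KMSW2014.LeafSupport.cm l))) (canon_implications νtop μtop (KMSW2014.LeafSupport.mkN (KMSW2014.LeafSupport.cm l)))
      (canon_implications₁₅ νtop μtop (KMSW2014.LeafSupport.mkN (KMSW2014.LeafSupport.cm l))) bookInputs_top
  have j : (canon₆₀ νtop μtop).BHSJordan :=
    (bhs_of_inputs (canon_implications₆₀ νtop μtop (KMSW2014.LeafSupport.mkN (KMSW2014.LeafSupport.cm l))) (canon_implications₁₄ νtop) bookInputs_top).1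
  have nk : l.onlyFull = false → ¬ ∀ N, (KMSW2014.LeafSupport.mkN (KMSW2014.LeafSupport.cm l)).Scope N :=
    fun hb hk => KMSW2014.LeafSupport.not_scope_of (KMSW2014.LeafSupport.scope_fails l hb 0) (hk 0)
  refine ⟨(KMSW2014.LeafSupport.countermodel l).2.2.1, canon_implications₁₇₅ _ _ _ _, b, g, b, ?_, b⟩
  constructor
  · intro h
    cases hb : l.onlyFull
    · exact absurd h.2.1.2.2 (nk hb)
    · rfl
  · intro h
    exact ⟨b, ⟨b, m, scope_of_onlyFull l h⟩, j⟩

/-- THE HUNDRED-AND-SEVENTY-FIFTH TRANCHE REGRADED, in one statement: (i) at the top all five Arthur-fed fields hold; (ii) in the book countermodel of any of the 24 leaves all five fail;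
(iii) in Mok's countermodel of any Mok leaf C335's Thm 8.6 fails and the other four hold; (iv) in KMSW's countermodel of any KMSW leaf `l` C335's Thm 8.6 holds iff `l.onlyFull = true`
and the other four hold.  Supports, exact: support(C333 Thms 2.4 / 2.2) = support(C334 Thm 8.2, tot. imaginary case) = support(C336 Prop. 6.10) = the 24 book leaves (no Mok leaf, no
KMSW leaf); support(C335 Thm 8.6 / Cor. 8.7) = the 24 book leaves ∧ Mok's 29 leaves ∧ KMSW's proved-scope leaves; the controls (C334 Thm 5.1 etc., C335 Thms 1.1 / 1.2, C336 Thms 1.1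
/ 1.3 / 1.4 (1)): ∅. [cite: GanSavin2023GammaG2, Thms 2.2, 2.4; CastellanoChenDarshanRaghuram2026Betti, Thm 8.2; HelmKurinczukSkodlerackStevens2024Blocks, Thm 8.6; Yang2023ExtDistinction, Prop. 6.10 (bookkeeping proved here)] [claim: GanSavin2023GammaG2, under-review] [claim: CastellanoChenDarshanRaghuram2026Betti, under-review] [claim: HelmKurinczukSkodlerackStevens2024Blocks, under-review] [claim: Yang2023ExtDistinction, under-review] [claim: KalethaMinguezShinWhite2014, under-review] -/
theorem c175_regraded :
    ((canon₁₇₅ νtop (canon₃ νtop μtop κtop) (canon₃₈ νtop) (canon₆₀ νtop μtop)).GSGammaChar ∧ (canon₁₇₅ νtop (canon₃ νtop μtop κtop) (canon₃₈ νtop) (canon₆₀ νtop μtop)).GSGammaLLC ∧ (canon₁₇₅ νtop (canon₃ νtop μtop κtop) (canon₃₈ νtop) (canon₆₀ νtop μtop)).CCDRShalikaTI ∧ (canon₁₇₅ νtop (canon₃ νtop μtop κtop) (canon₃₈ νtop) (canon₆₀ νtop μtop)).HKSSWild ∧ (canon₁₇₅ νtop (canon₃ νtop μtop κtop) (canon₃₈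 νtop) (canon₆₀ νtop μtop)).YangRelSC) ∧
      (∀ l : LeafSupport.Leaf, ¬ (LeafSupport.mkN (LeafSupport.cm l)).leaf l ∧
        ¬ (canon₁₇₅ (LeafSupport.mkN (LeafSupport.cm l)) (canon₃ (LeafSupport.mkN (LeafSupport.cm l)) μtop κtop) (canon₃₈ (LeafSupport.mkN (LeafSupport.cm l))) (canon₆₀ (LeafSupport.mkN (LeafSupport.cm l)) μtop)).GSGammaChar ∧ ¬ (canon₁₇₅ (LeafSupport.mkN (LeafSupport.cm l)) (canon₃ (LeafSupport.mkN (LeafSupport.cm l)) μtop κtop) (canon₃₈ (LeafSupport.mkN (LeafSupport.cm l))) (canon₆₀ (LeafSupport.mkN (LeafSupport.cm l)) μtop)).GSGammaLLC ∧ ¬ (canon₁₇₅ (LeafSupport.mkN (LeafSupport.cm l)) (canon₃ (LeafSupport.mkN (LeafSupport.cm l)) μtop κtop) (canon₃₈ (LeafSupport.mkN (LeafSupport.cm l))) (canon₆₀ (LeafSupport.mkN (LeafSupport.cm l)) μtop)).CCDRShalikaTI ∧ ¬ (canon₁₇₅ (LeafSupport.mkN (LeafSupport.cm l)) (canon₃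 (LeafSupport.mkN (LeafSupport.cm l)) μtop κtop) (canon₃₈ (LeafSupport.mkN (LeafSupport.cm l))) (canon₆₀ (LeafSupport.mkN (LeafSupport.cm l)) μtop)).HKSSWild ∧ ¬ (canon₁₇₅ (LeafSupport.mkN (LeafSupport.cm l)) (canon₃ (LeafSupport.mkN (LeafSupport.cm l)) μtop κtop) (canon₃₈ (LeafSupport.mkN (LeafSupport.cm l))) (canon₆₀ (LeafSupport.mkN (LeafSupport.cm l)) μtop)).YangRelSC) ∧
      (∀ l : Mok2015.LeafSupport.Leaf, ¬ (Mok2015.LeafSupport.mkN (Mok2015.LeafSupport.cm l)).leaf l ∧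
        (canon₁₇₅ νtop (canon₃ νtop (Mok2015.LeafSupport.mkN (Mok2015.LeafSupport.cm l)) κnoMok) (canon₃₈ νtop) (canon₆₀ νtop (Mok2015.LeafSupport.mkN (Mok2015.LeafSupport.cm l)))).GSGammaChar ∧ (canon₁₇₅ νtop (canon₃ νtop (Mok2015.LeafSupport.mkN (Mok2015.LeafSupport.cm l)) κnoMok) (canon₃₈ νtop) (canon₆₀ νtop (Mok2015.LeafSupport.mkN (Mok2015.LeafSupport.cm l)))).GSGammaLLC ∧ (canon₁₇₅ νtop (canon₃ νtop (Mok2015.LeafSupport.mkN (Mok2015.LeafSupport.cm l)) κnoMok) (canon₃₈ νtop) (canon₆₀ νtop (Mok2015.LeafSupport.mkN (Mok2015.LeafSupport.cm l)))).CCDRShalikaTI ∧ ¬ (canon₁₇₅ νtop (canon₃ νtop (Mok2015.LeafSupport.mkN (Mok2015.LeafSupport.cm l)) κnoMok) (canon₃₈ νtop) (canon₆₀ νtop (Mok2015.LeafSupport.mkN (Mok2015.LeafSupport.cm l)))).HKSSWild ∧ (canon₁₇₅ νtop (canon₃ νtop (Mok2015.LeafSupport.mkN (Mok2015.LeafSupport.cm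 l)) κnoMok) (canon₃₈ νtop) (canon₆₀ νtop (Mok2015.LeafSupport.mkN (Mok2015.LeafSupport.cm l)))).YangRelSC) ∧
      (∀ l : KMSW2014.LeafSupport.Leaf, ¬ (KMSW2014.LeafSupport.mkN (KMSW2014.LeafSupport.cm l)).leaf l ∧
        (canon₁₇₅ νtop (canon₃ νtop μtop (KMSW2014.LeafSupport.mkN (KMSW2014.LeafSupport.cm l))) (canon₃₈ νtop) (canon₆₀ νtop μtop)).GSGammaChar ∧ (canon₁₇₅ νtop (canon₃ νtop μtop (KMSW2014.LeafSupport.mkN (KMSW2014.LeafSupport.cm l))) (canon₃₈ νtop) (canon₆₀ νtop μtop)).GSGammaLLC ∧ (canon₁₇₅ νtop (canon₃ νtop μtop (KMSW2014.LeafSupport.mkN (KMSW2014.LeafSupport.cm l))) (canon₃₈ νtop) (canon₆₀ νtop μtop)).CCDRShalikaTI ∧ ((canon₁₇₅ νtop (canon₃ νtop μtop (KMSW2014.LeafSupport.mkN (KMSW2014.LeafSupport.cm l))) (canon₃₈ νtop) (canon₆₀ νtop μtop)).HKSSWild ↔ l.onlyFull = true) ∧ (canon₁₇₅ νtop (canon₃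 νtop μtop (KMSW2014.LeafSupport.mkN (KMSW2014.LeafSupport.cm l))) (canon₃₈ νtop) (canon₆₀ νtop μtop)).YangRelSC) :=
  ⟨c175_top.2.1,
    fun l =>
      have h := c175_book_cm l
      ⟨h.1, h.2.2.1, h.2.2.2.1, h.2.2.2.2.1, h.2.2.2.2.2.1, h.2.2.2.2.2.2.1⟩,
    fun l =>
      have h := c175_mok_cm l
      ⟨h.1, h.2.2⟩,
    fun l =>
      have h := c175_kmsw_cm l
      ⟨h.1, h.2.2⟩⟩

/-! ## 178. Hundred-and-seventy-sixth tranche (v8 of this file, after NEW `Downstream48.lean` v1; unit `pub-arthur-down-g72`, downstream tracer gen 72): supports of NEW rows C337 (A. Cauchi –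
J. Rodrigues Jacinto, Doc. Math. 25 (2020)), C338 (A. Pollack, arXiv:2211.05280v2), C339 (C. Cunningham – L. Dembélé, arXiv:1705.03054) and C340 (Hengfei Lu, Math. Res. Lett. 27 (2020))
— the NASA ADS full-text channel, rounds 3–5 (conduit-title needles).  The canonical reading `canon₁₇₆ ν c c₅₄` over ARBITRARY tranche-1 / tranche-54 assignments (read canonically below
through section 1's `canon ν μ κ` (rows C10 `KretShinGSp`, C6 `ChenevierTaibi`, A4 `GeeTaibi` := the book at every rank, their further premises A7 / C4 / AMR / the similitude
stabilisations all inside `BookInputs`) and section 54's `canon₅₄ ν` (B7's symplectic – orthogonal instance `AtobeGanThetaSpO` := the book at every rank)): C337 Prop. 5.3 :=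
`c.KretShinGSp`; C338 Cor. 1.1.2 := `c.ChenevierTaibi`; C339 Cor. 19 := the book ∧ `c.GeeTaibi`; C340 Thms 1.2 / 5.1 := `c₅₄.AtobeGanThetaSpO`; the four controls := `True`.  Every
tranche-176 edge holds in it (`canon_implications₁₇₆`).  READINGS: (i) AT THE TOP the bundle holds and all nine fields HOLD — by the tranche's own `hundredseventysixth_of_inputs` over the
canonical bundles of sections 1 and 54 and `bookInputs_top` (`c176_top`); (ii) BOOK SIDE: in each of the 24 book countermodels all five Arthur-fed fields FAIL, the controls hold
(`c176_book_cm`); (iii) MOK SIDE: in each of Mok's 29 countermodels (book at the top, KMSW read `κnoMok`) all five Arthur-fed fields HOLD (`c176_mok_cm`); (iv) KMSW SIDE: in KMSW's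
countermodel of ANY KMSW leaf (book and Mok at the top) all five HOLD (`c176_kmsw_cm`).  Supports, exact: support(C337 Prop. 5.3 / Def. 5.5) = support(C338 Cor. 1.1.2) = support(C339
Cor. 19) = support(C340 Thms 1.2 / 5.1) = the 24 book leaves — no Mok leaf, no KMSW leaf (B7's Sp / O / Mp instance is fed by the book alone, section 54; contrast B7's unitary pairs);
the four controls: ∅. -/

section Canon176

variable (ν : Nodes) (μ : Mok2015.Nodes) (κ : KMSW2014.Nodes)

/-- The canonical reading of NEW rows C337 – C340 over arbitrary tranche-1 / tranche-54 assignments. [cite: CauchiRodriguesJacinto2020Norm, Thms A, B, Prop. 5.3; Pollack2022ExceptionalTheta, Thm 1.0.1, Cor. 1.1.2; CunninghamDembele2017Lifts, Thm 17, Cor. 19; Lu2020ThetaBranching, Thms 1.1, 1.2, 5.1 (canonical model; bookkeeping)] [claim: Pollack2022ExceptionalTheta, under-review] [claim: CunninghamDembele2017Lifts, under-review] -/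
abbrev canon₁₇₆ (c : Consumers) (c₅₄ : Consumers54) : Consumers176 where
  CRJclasses := True
  CRJIwasawa := c.KretShinGSp
  PollackTheta := True
  PollackG2Lifts := c.ChenevierTaibi
  CDlifts := True
  CDholLift := (∀ N, ν.Everything N) ∧ c.GeeTaibi
  LuGSpin4 := True
  LuSpDist := c₅₄.AtobeGanThetaSpO
  LuSOcodim1 := c₅₄.AtobeGanThetaSpO

/-- All nine hundred-and-seventy-sixth-tranche edges hold in the canonical reading, for arbitrary tranche-1 / tranche-54 assignments. [cite: CauchiRodriguesJacinto2020Norm, Prop. 5.3; Lu2020ThetaBranching, Thm 5.1 (bookkeeping proved here)] -/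
theorem canon_implications₁₇₆ (c : Consumers) (c₅₄ : Consumers54) : Implications176 ν c c₅₄ (canon₁₇₆ ν c c₅₄) where
  crjClasses := True.intro
  crjIwasawa := fun h => h
  pollackTheta := True.intro
  pollackLifts := fun h => h
  cdLifts := True.intro
  cdHol := fun b g => ⟨b, g⟩
  luGSpin := True.intro
  luSp := fun h => h
  luSO := fun h => h

end Canon176

/-- AT THE TOP (every leaf of the three DAGs granted; tranches 1 and 54 read canonically): the bundle holds and ALL NINE fields of rows C337 – C340 HOLD — by the tranche's
`hundredseventysixth_of_inputs` over sections 1 / 54's canonical bundles and `bookInputs_top`. [cite: CauchiRodriguesJacinto2020Norm, Prop. 5.3; Pollack2022ExceptionalTheta, Cor. 1.1.2; CunninghamDembele2017Lifts, Cor. 19; Lu2020ThetaBranching, Thms 1.2, 5.1 (bookkeeping proved here)] [claim: Pollack2022ExceptionalTheta, under-review] [claim: CunninghamDembele2017Lifts, under-review] -/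
theorem c176_top :
    Implications176 νtop (canon νtop μtop κtop) (canon₅₄ νtop) (canon₁₇₆ νtop (canon νtop μtop κtop) (canon₅₄ νtop)) ∧
      ((canon₁₇₆ νtop (canon νtop μtop κtop) (canon₅₄ νtop)).CRJIwasawa ∧ (canon₁₇₆ νtop (canon νtop μtop κtop) (canon₅₄ νtop)).PollackG2Lifts ∧ (canon₁₇₆ νtop (canon νtop μtop κtop) (canon₅₄ νtop)).CDholLift ∧ (canon₁₇₆ νtop (canon νtop μtop κtop) (canon₅₄ νtop)).LuSpDist ∧ (canon₁₇₆ νtop (canon νtop μtop κtop) (canon₅₄ νtop)).LuSOcodim1) ∧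
      ((canon₁₇₆ νtop (canon νtop μtop κtop) (canon₅₄ νtop)).CRJclasses ∧ (canon₁₇₆ νtop (canon νtop μtop κtop) (canon₅₄ νtop)).PollackTheta ∧ (canon₁₇₆ νtop (canon νtop μtop κtop) (canon₅₄ νtop)).CDlifts ∧ (canon₁₇₆ νtop (canon νtop μtop κtop) (canon₅₄ νtop)).LuGSpin4) :=
  have Y := canon_implications₁₇₆ νtop (canon νtop μtop κtop) (canon₅₄ νtop)
  have h := hundredseventysixth_of_inputs Y (canon_implications νtop μtop κtop) (canon_implications₅₄ νtop μtop κtop) bookInputs_top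
  ⟨Y, h⟩

/-- BOOK SIDE: in the book countermodel of ANY of the 24 leaves `l` (Mok / KMSW at the top; tranches 1, 54 read canonically there) the bundle holds; ALL FIVE Arthur-fed fields of rows
C337 – C340 FAIL (each reads the book at every rank through its conduit — C10, C6, A4, B7's Sp – O instance) and the four controls hold — every book leaf is load-bearing for every
typed use of the tranche. [cite: CauchiRodriguesJacinto2020Norm, §5.1 (VoR p0034:L32-36); Pollack2022ExceptionalTheta, §1.1 (arXiv:2211.05280v2 p0004:L62-64); CunninghamDembele2017Lifts, Cor. 19, proof; Lu2020ThetaBranching, Thm 5.1, proof (separating models; bookkeeping proved here)] [claim: Pollack2022ExceptionalTheta, under-review] [claim: CunninghamDembele2017Lifts, under-review] -/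
theorem c176_book_cm (l : LeafSupport.Leaf) :
    ¬ (LeafSupport.mkN (LeafSupport.cm l)).leaf l ∧
      Implications176 (LeafSupport.mkN (LeafSupport.cm l)) (canon (LeafSupport.mkN (LeafSupport.cm l)) μtop κtop) (canon₅₄ (LeafSupport.mkN (LeafSupport.cm l))) (canon₁₇₆ (LeafSupport.mkN (LeafSupport.cm l)) (canon (LeafSupport.mkN (LeafSupport.cm l)) μtop κtop) (canon₅₄ (LeafSupport.mkN (LeafSupport.cm l)))) ∧
      ¬ (canon₁₇₆ (LeafSupport.mkN (LeafSupport.cm l)) (canon (LeafSupport.mkN (LeafSupport.cm l)) μtop κtop) (canon₅₄ (LeafSupport.mkN (LeafSupport.cm l)))).CRJIwasawa ∧ ¬ (canon₁₇₆ (LeafSupport.mkN (LeafSupport.cm l)) (canon (LeafSupport.mkN (LeafSupport.cm l)) μtop κtop) (canon₅₄ (LeafSupport.mkN (LeafSupport.cm l)))).PollackG2Lifts ∧ ¬ (canon₁₇₆ (LeafSupport.mkN (LeafSupport.cm l)) (canon (LeafSupport.mkN (LeafSupport.cm l)) μtop κtop) (canon₅₄ (LeafSupport.mkN (LeafSupport.cm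 l)))).CDholLift ∧ ¬ (canon₁₇₆ (LeafSupport.mkN (LeafSupport.cm l)) (canon (LeafSupport.mkN (LeafSupport.cm l)) μtop κtop) (canon₅₄ (LeafSupport.mkN (LeafSupport.cm l)))).LuSpDist ∧ ¬ (canon₁₇₆ (LeafSupport.mkN (LeafSupport.cm l)) (canon (LeafSupport.mkN (LeafSupport.cm l)) μtop κtop) (canon₅₄ (LeafSupport.mkN (LeafSupport.cm l)))).LuSOcodim1 ∧
      ((canon₁₇₆ (LeafSupport.mkN (LeafSupport.cm l)) (canon (LeafSupport.mkN (LeafSupport.cm l)) μtop κtop) (canon₅₄ (LeafSupport.mkN (LeafSupport.cm l)))).CRJclasses ∧ (canon₁₇₆ (LeafSupport.mkN (LeafSupport.cm l)) (canon (LeafSupport.mkN (LeafSupport.cm l)) μtop κtop) (canon₅₄ (LeafSupport.mkN (LeafSupport.cm l)))).PollackTheta ∧ (canon₁₇₆ (LeafSupport.mkN (LeafSupport.cm l)) (canon (LeafSupport.mkN (LeafSupport.cm l)) μtop κtop) (canon₅₄ (LeafSupport.mkN (LeafSupport.cm l)))).CDlifts ∧ (canon₁₇₆ (LeafSupport.mkN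 (LeafSupport.cm l)) (canon (LeafSupport.mkN (LeafSupport.cm l)) μtop κtop) (canon₅₄ (LeafSupport.mkN (LeafSupport.cm l)))).LuGSpin4) :=
  have nb := not_B_cm l
  ⟨(LeafSupport.countermodel l).2.2.1, canon_implications₁₇₆ _ _ _, fun h => nb h, fun h => nb h, fun h => nb h.1, fun h => nb h, fun h => nb h,
    ⟨True.intro, True.intro, True.intro, True.intro⟩⟩

/-- MOK SIDE: in Mok's countermodel of ANY Mok leaf `l` (the book at the top, KMSW read `κnoMok`; tranches 1, 54 read canonically there) the bundle holds and ALL FIVE Arthur-fed fields of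
rows C337 – C340 HOLD — no Mok leaf is load-bearing (C10, C6, A4 and B7's Sp – O instance are book-fed). [cite: CauchiRodriguesJacinto2020Norm, Prop. 5.3; Lu2020ThetaBranching, Thm 1.2 (separating models; bookkeeping proved here)] -/
theorem c176_mok_cm (l : Mok2015.LeafSupport.Leaf) :
    ¬ (Mok2015.LeafSupport.mkN (Mok2015.LeafSupport.cm l)).leaf l ∧
      Implications176 νtop (canon νtop (Mok2015.LeafSupport.mkN (Mok2015.LeafSupport.cm l)) κnoMok) (canon₅₄ νtop) (canon₁₇₆ νtop (canon νtop (Mok2015.LeafSupport.mkN (Mok2015.LeafSupport.cm l)) κnoMok) (canon₅₄ νtop)) ∧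
      (canon₁₇₆ νtop (canon νtop (Mok2015.LeafSupport.mkN (Mok2015.LeafSupport.cm l)) κnoMok) (canon₅₄ νtop)).CRJIwasawa ∧ (canon₁₇₆ νtop (canon νtop (Mok2015.LeafSupport.mkN (Mok2015.LeafSupport.cm l)) κnoMok) (canon₅₄ νtop)).PollackG2Lifts ∧ (canon₁₇₆ νtop (canon νtop (Mok2015.LeafSupport.mkN (Mok2015.LeafSupport.cm l)) κnoMok) (canon₅₄ νtop)).CDholLift ∧ (canon₁₇₆ νtop (canon νtop (Mok2015.LeafSupport.mkN (Mok2015.LeafSupport.cm l)) κnoMok) (canon₅₄ νtop)).LuSpDist ∧ (canon₁₇₆ νtop (canon νtop (Mok2015.LeafSupport.mkN (Mok2015.LeafSupport.cm l)) κnoMok) (canon₅₄ νtop)).LuSOcodim1 :=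
  have b : ∀ N, νtop.Everything N := bookInputs_top.everything
  ⟨(Mok2015.LeafSupport.countermodel l).2.2.1, canon_implications₁₇₆ _ _ _, b, b, ⟨b, b⟩, b, b⟩

/-- KMSW SIDE: in KMSW's countermodel of ANY KMSW leaf `l` (book and Mok at the top; tranches 1, 54 read canonically there) the bundle holds and ALL FIVE Arthur-fed fields of rows C337 –
C340 HOLD — no KMSW leaf is load-bearing. [cite: CauchiRodriguesJacinto2020Norm, Prop. 5.3; Lu2020ThetaBranching, Thm 1.2 (separating models; bookkeeping proved here)] -/
theorem c176_kmsw_cm (l : KMSW2014.LeafSupport.Leaf) :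
    ¬ (KMSW2014.LeafSupport.mkN (KMSW2014.LeafSupport.cm l)).leaf l ∧
      Implications176 νtop (canon νtop μtop (KMSW2014.LeafSupport.mkN (KMSW2014.LeafSupport.cm l))) (canon₅₄ νtop) (canon₁₇₆ νtop (canon νtop μtop (KMSW2014.LeafSupport.mkN (KMSW2014.LeafSupport.cm l))) (canon₅₄ νtop)) ∧
      (canon₁₇₆ νtop (canon νtop μtop (KMSW2014.LeafSupport.mkN (KMSW2014.LeafSupport.cm l))) (canon₅₄ νtop)).CRJIwasawa ∧ (canon₁₇₆ νtop (canon νtop μtop (KMSW2014.LeafSupport.mkN (KMSW2014.LeafSupport.cm l))) (canon₅₄ νtop)).PollackG2Lifts ∧ (canon₁₇₆ νtop (canon νtop μtop (KMSW2014.LeafSupport.mkN (KMSW2014.LeafSupport.cm l))) (canon₅₄ νtop)).CDholLift ∧ (canon₁₇₆ νtop (canon νtop μtop (KMSW2014.LeafSupport.mkN (KMSW2014.LeafSupport.cm l))) (canon₅₄ νtop)).LuSpDist ∧ (canon₁₇₆ νtop (canon νtop μtop (KMSW2014.LeafSupport.mkN (KMSW2014.LeafSupport.cm l))) (canon₅₄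 νtop)).LuSOcodim1 :=
  have b : ∀ N, νtop.Everything N := bookInputs_top.everything
  ⟨(KMSW2014.LeafSupport.countermodel l).2.2.1, canon_implications₁₇₆ _ _ _, b, b, ⟨b, b⟩, b, b⟩

/-- THE HUNDRED-AND-SEVENTY-SIXTH TRANCHE REGRADED, in one statement: (i) at the top all five Arthur-fed fields hold; (ii) in the book countermodel of any of the 24 leaves all five fail;
(iii) in Mok's countermodel of any Mok leaf all five hold; (iv) in KMSW's countermodel of any KMSW leaf all five hold.  Supports, exact: support(C337 Prop. 5.3 / Def. 5.5) =
support(C338 Cor. 1.1.2) = support(C339 Cor. 19) = support(C340 Thms 1.2 / 5.1) = the 24 book leaves (no Mok leaf, no KMSW leaf); the controls (C337 Thms A / B, C338 Thms 1.0.1 /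
1.1.1, C339 Thms 2 / 3 / 17, C340 Thm 1.1): ∅. [cite: CauchiRodriguesJacinto2020Norm, Prop. 5.3; Pollack2022ExceptionalTheta, Cor. 1.1.2; CunninghamDembele2017Lifts, Cor. 19; Lu2020ThetaBranching, Thms 1.2, 5.1 (bookkeeping proved here)] [claim: Pollack2022ExceptionalTheta, under-review] [claim: CunninghamDembele2017Lifts, under-review] -/
theorem c176_regraded :
    ((canon₁₇₆ νtop (canon νtop μtop κtop) (canon₅₄ νtop)).CRJIwasawa ∧ (canon₁₇₆ νtop (canon νtop μtop κtop) (canon₅₄ νtop)).PollackG2Lifts ∧ (canon₁₇₆ νtop (canon νtop μtop κtop) (canon₅₄ νtop)).CDholLift ∧ (canon₁₇₆ νtop (canon νtop μtop κtop) (canon₅₄ νtop)).LuSpDist ∧ (canon₁₇₆ νtop (canon νtop μtop κtop) (canon₅₄ νtop)).LuSOcodim1) ∧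
      (∀ l : LeafSupport.Leaf, ¬ (LeafSupport.mkN (LeafSupport.cm l)).leaf l ∧
        ¬ (canon₁₇₆ (LeafSupport.mkN (LeafSupport.cm l)) (canon (LeafSupport.mkN (LeafSupport.cm l)) μtop κtop) (canon₅₄ (LeafSupport.mkN (LeafSupport.cm l)))).CRJIwasawa ∧ ¬ (canon₁₇₆ (LeafSupport.mkN (LeafSupport.cm l)) (canon (LeafSupport.mkN (LeafSupport.cm l)) μtop κtop) (canon₅₄ (LeafSupport.mkN (LeafSupport.cm l)))).PollackG2Lifts ∧ ¬ (canon₁₇₆ (LeafSupport.mkN (LeafSupport.cm l)) (canon (LeafSupport.mkN (LeafSupport.cm l)) μtop κtop) (canon₅₄ (LeafSupport.mkN (LeafSupport.cm l)))).CDholLift ∧ ¬ (canon₁₇₆ (LeafSupport.mkN (LeafSupport.cm l)) (canon (LeafSupport.mkN (LeafSupport.cm l)) μtop κtop) (canon₅₄ (LeafSupport.mkN (LeafSupport.cm l)))).LuSpDist ∧ ¬ (canon₁₇₆ (LeafSupport.mkN (LeafSupport.cm l)) (canon (LeafSupport.mkN (LeafSupport.cm l)) μtop κtop) (canon₅₄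 (LeafSupport.mkN (LeafSupport.cm l)))).LuSOcodim1) ∧
      (∀ l : Mok2015.LeafSupport.Leaf, ¬ (Mok2015.LeafSupport.mkN (Mok2015.LeafSupport.cm l)).leaf l ∧
        (canon₁₇₆ νtop (canon νtop (Mok2015.LeafSupport.mkN (Mok2015.LeafSupport.cm l)) κnoMok) (canon₅₄ νtop)).CRJIwasawa ∧ (canon₁₇₆ νtop (canon νtop (Mok2015.LeafSupport.mkN (Mok2015.LeafSupport.cm l)) κnoMok) (canon₅₄ νtop)).PollackG2Lifts ∧ (canon₁₇₆ νtop (canon νtop (Mok2015.LeafSupport.mkN (Mok2015.LeafSupport.cm l)) κnoMok) (canon₅₄ νtop)).CDholLift ∧ (canon₁₇₆ νtop (canon νtop (Mok2015.LeafSupport.mkN (Mok2015.LeafSupport.cm l)) κnoMok) (canon₅₄ νtop)).LuSpDist ∧ (canon₁₇₆ νtop (canon νtop (Mok2015.LeafSupport.mkN (Mok2015.LeafSupport.cm l)) κnoMok) (canon₅₄ νtop)).LuSOcodim1) ∧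
      (∀ l : KMSW2014.LeafSupport.Leaf, ¬ (KMSW2014.LeafSupport.mkN (KMSW2014.LeafSupport.cm l)).leaf l ∧
        (canon₁₇₆ νtop (canon νtop μtop (KMSW2014.LeafSupport.mkN (KMSW2014.LeafSupport.cm l))) (canon₅₄ νtop)).CRJIwasawa ∧ (canon₁₇₆ νtop (canon νtop μtop (KMSW2014.LeafSupport.mkN (KMSW2014.LeafSupport.cm l))) (canon₅₄ νtop)).PollackG2Lifts ∧ (canon₁₇₆ νtop (canon νtop μtop (KMSW2014.LeafSupport.mkN (KMSW2014.LeafSupport.cm l))) (canon₅₄ νtop)).CDholLift ∧ (canon₁₇₆ νtop (canon νtop μtop (KMSW2014.LeafSupport.mkN (KMSW2014.LeafSupport.cm l))) (canon₅₄ νtop)).LuSpDist ∧ (canon₁₇₆ νtop (canon νtop μtop (KMSW2014.LeafSupport.mkN (KMSW2014.LeafSupport.cm l))) (canon₅₄ νtop)).LuSOcodim1) :=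
  ⟨c176_top.2.1,
    fun l =>
      have h := c176_book_cm l
      ⟨h.1, h.2.2.1, h.2.2.2.1, h.2.2.2.2.1, h.2.2.2.2.2.1, h.2.2.2.2.2.2.1⟩,
    fun l =>
      have h := c176_mok_cm l
      ⟨h.1, h.2.2⟩,
    fun l =>
      have h := c176_kmsw_cm l
      ⟨h.1, h.2.2⟩⟩


/-! ## 179. Hundred-and-seventy-seventh tranche (v9 of this file, after `Downstream48.lean` v2; unit `pub-arthur-down-g73`, downstream tracer gen 73): supports of the CLASS ROW B82's FOURTH
TYPED MEMBER, I. Matić, J. Algebra 444 (2015) (`Consumers177.MaticSP` = Prop. 3.1 / Thms 4.1, 5.1, 6.1 ⇐ `Consumers51.BasicAssumption` ∧ `Consumers51.MoeglinTadicDS` ∧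
`Consumers50.MoeglinHalfInt`, with the 2015 printing of the class's supply edge `E_BasicAssumption15` ⇐ the book at every rank ∧ E41).  The canonical reading `canon₁₇₇ ν`: the member's
statement := « the book proves everything at every rank » (as the class's members in section 54's `canon₅₁`); every tranche-177 edge holds in it over section 50's `canon₅₀` and section 54's
`canon₅₁` (`canon_implications₁₇₇`).  READINGS: (i) AT THE TOP the bundle holds and the member's statement HOLDS — by the tranche's own `maticSP_of_inputs` over sections 18 / 50 / 54's
canonical bundles and `bookInputs_top` (`c177_top`); (ii) BOOK SIDE: in each of the 24 book countermodels the bundle holds and the statement FAILS (`c177_book_cm`) — every book leaf is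
load-bearing, the Jordan-block half of (BA) being cited to the book as a whole (section 54's `baLine_cm_fails` for the class); (iii) no Mok or KMSW assignment enters the line (p-adic
symplectic / orthogonal groups; the canonical readings of tranches 14 / 50 / 51 / 177 take ν only).  Support, exact: support(Matić 2015 Prop. 3.1 / Thms 4.1, 5.1, 6.1) = the 24 book
leaves — as the class's other typed members; no control. -/

section Canon177

variable (ν : Nodes)

/-- The canonical reading of the B82 member Matić 2015: its statement := the book at every rank. [cite: Matic2015StronglyPositive, Thms 4.1, 5.1, 6.1 (canonical model; bookkeeping)] -/
abbrev canon₁₇₇ : Consumers177 where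
  MaticSP := ∀ N, ν.Everything N

/-- Both hundred-and-seventy-seventh-tranche edges hold in the canonical reading, for arbitrary ν, over sections 50 / 54's canonical tranche-50 / tranche-51 readings. [cite: Matic2015StronglyPositive, §2, Introduction (bookkeeping proved here)] -/
theorem canon_implications₁₇₇ : Implications177 ν (canon₅₀ ν) (canon₅₁ ν) (canon₁₇₇ ν) where
  ba15 := fun b _ => b
  maticSP := fun b _ _ => b

end Canon177

/-- AT THE TOP (every leaf of the book's DAG granted; tranches 14, 50, 51 read canonically): the bundle holds and the member's statement HOLDS — by the tranche's `maticSP_of_inputs` over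
`canon_implications₅₁` / `canon_implications₅₀` / `canon_implications₁₄` and `bookInputs_top`. [cite: Matic2015StronglyPositive, Thms 4.1, 5.1, 6.1 (bookkeeping proved here)] -/
theorem c177_top :
    Implications177 νtop (canon₅₀ νtop) (canon₅₁ νtop) (canon₁₇₇ νtop) ∧ (canon₁₇₇ νtop).MaticSP :=
  have Y := canon_implications₁₇₇ νtop
  ⟨Y, maticSP_of_inputs Y (canon_implications₅₁ νtop) (canon_implications₅₀ νtop) (canon_implications₁₄ νtop) bookInputs_top⟩

/-- BOOK SIDE: in the book countermodel of ANY of the 24 leaves `l` (tranches 50 / 51 / 177 read canonically there) the bundles of tranches 51 and 177 hold, the leaf fails and the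
member's statement FAILS — every book leaf is load-bearing for the typed use, as for the class (section 54's `baLine_cm_fails`). [cite: Matic2015StronglyPositive, Introduction (author's version p0001:L17-19), §2 (p0005:L7-9) (separating models; bookkeeping proved here)] -/
theorem c177_book_cm (l : LeafSupport.Leaf) :
    ¬ (LeafSupport.mkN (LeafSupport.cm l)).leaf l ∧
      Implications51 (LeafSupport.mkN (LeafSupport.cm l)) (canon₄₅ (LeafSupport.mkN (LeafSupport.cm l))) (canon₅₀ (LeafSupport.mkN (LeafSupport.cm l))) (canon₅₁ (LeafSupport.mkN (LeafSupport.cm l))) ∧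
      Implications177 (LeafSupport.mkN (LeafSupport.cm l)) (canon₅₀ (LeafSupport.mkN (LeafSupport.cm l))) (canon₅₁ (LeafSupport.mkN (LeafSupport.cm l))) (canon₁₇₇ (LeafSupport.mkN (LeafSupport.cm l))) ∧
      ¬ (canon₁₇₇ (LeafSupport.mkN (LeafSupport.cm l))).MaticSP :=
  ⟨(LeafSupport.countermodel l).2.2.1, canon_implications₅₁ _, canon_implications₁₇₇ _, fun h => not_B_cm l h⟩

/-- THE HUNDRED-AND-SEVENTY-SEVENTH TRANCHE REGRADED, in one statement: (i) at the top the member's statement holds; (ii) in the book countermodel of any of the 24 leaves it fails while the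
leaf alone fails and every other leaf holds.  Support, exact: support(Matić 2015 Prop. 3.1 / Thms 4.1, 5.1, 6.1) = the 24 book leaves (no Mok leaf, no KMSW leaf: ν only); no control.
[cite: Matic2015StronglyPositive, Thms 4.1, 5.1, 6.1 (bookkeeping proved here)] -/
theorem c177_regraded :
    (canon₁₇₇ νtop).MaticSP ∧
      (∀ l : LeafSupport.Leaf, ¬ (LeafSupport.mkN (LeafSupport.cm l)).leaf l ∧ (∀ l', l' ≠ l → (LeafSupport.mkN (LeafSupport.cm l)).leaf l') ∧
        ¬ (canon₁₇₇ (LeafSupport.mkN (LeafSupport.cm l))).MaticSP) :=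
  ⟨c177_top.2, fun l => ⟨(c177_book_cm l).1, (LeafSupport.countermodel l).2.1, (c177_book_cm l).2.2.2⟩⟩

/-! ## 180. Hundred-and-seventy-eighth tranche (v10 of this file, after `Downstream48.lean` v3; unit `pub-arthur-down-g73`, downstream tracer gen 73): supports of ROW C172, J. A. Thorne,
*Raising the level for GL_n*, Forum Math. Sigma 2 (2014) e16 (`Consumers178`: `ThorneUnitaryLR` = Theorems 4.6 / 6.7, the CONTROL; `ThorneDescent` = Proposition 2.4 (1) ⇐ row C210's
Proposition 2.9 (3) = `Consumers83.CTdescent`; `ThorneLevelRaising` = Theorem 7.1 with Theorem 1.1 ⇐ the two).  The canonical reading `canon₁₇₈ μ` takes MOK's DAG ONLY: the control :=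
`True`; the descent := « Mok proves everything at every rank » (the canonical value of C210 in section 83's parametrised `canon₈₃W`); the main theorem := the conjunction of its two premises'
values.  Every tranche-178 edge holds in it over `canon₈₃W ν μ κ ig cz pf dv bm hc` for EVERY ν, κ and every parameter value (`canon_implications₁₇₈`); `canon₈₃T ν μ κ` names the instance of
`canon₈₃W` used at the top and in the countermodels by section 83 (tranches 1 / 25 / 27 read canonically, C211's node granted).  READINGS: (i) AT THE TOP the bundle holds and all three fields
HOLD — delivered by the tranche's own `thorne_of_mokInputs` over `canon_implications₈₃W` and `mokInputs_top` (`c178_top`); (ii) BOOK SIDE: in each of the 24 book countermodels (Mok and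
KMSW at the top) the bundle holds and ALL THREE fields HOLD (`c178_book_cm`) — no leaf of the book's own DAG is load-bearing for C172 as typed (the register models Mok's inputs as Mok's own
29 leaves; the book is not in C172's bibliography); (iii) MOK SIDE: with the book at the top, Mok read by the countermodel of ANY of its 29 leaves and KMSW without its Mok import (`κnoMok`),
the bundle holds, the descent and the main theorem FAIL and the control HOLDS (`c178_mok_cm`) — exactly row C210's behaviour in section 83's `c83_mok_cm`, inherited through « [CT,
Proposition 2.9] »; (iv) the control holds in every reading (`c178_control`).  Supports, exact: support(`ThorneDescent`) = support(`ThorneLevelRaising`) = Mok's 29 leaves = support(C210);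
support(`ThorneUnitaryLR`) = ∅; no book leaf, no KMSW leaf. -/

section Canon178

variable (ν : Nodes) (μ : Mok2015.Nodes) (κ : KMSW2014.Nodes)

/-- The canonical reading of row C172 (Mok's DAG only): control := `True`, Proposition 2.4 (1) := Mok at every rank, Theorem 7.1 / 1.1 := the conjunction of its premises' values. [cite: Thorne2014RaisingLevel, Prop. 2.4, Thms 6.7, 7.1 (canonical model; bookkeeping)] -/
abbrev canon₁₇₈ : Consumers178 where
  ThorneUnitaryLR := True
  ThorneDescent := ∀ N, μ.Everything N
  ThorneLevelRaising := (∀ N, μ.Everything N) ∧ True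

/-- The instance of section 83's parametrised tranche-83 reading used at the top and in the countermodels (row premises read from sections 1 / 25 / 27's `canon`, `canon₂₅`, `canon₂₇`; C211's cohomology node granted), named once. [cite: ClozelThorne2014LevelRaisingI, Prop. 2.9 (3) (canonical model; bookkeeping)] [claim: KalethaMinguezShinWhite2014, under-review] -/
abbrev canon₈₃T : Consumers83 :=
  canon₈₃W ν μ κ (canon ν μ κ).IshimotoGeneric (canon ν μ κ).ChenZou (canon₂₇ ν μ κ).PengFS (canon₂₅ ν μ κ).DvHKZ (canon₂₇ ν μ κ).BMHN True

/-- Every hundred-and-seventy-eighth-tranche edge holds in the canonical reading, for arbitrary ν, μ, κ and EVERY parameter value of section 83's `canon₈₃W` (whose C210 value is Mok at every rank). [cite: Thorne2014RaisingLevel, Prop. 2.4, Thms 6.7, 7.1 (bookkeeping proved here)] -/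
theorem canon_implications₁₇₈ (ig cz pf dv bm hc : Prop) : Implications178 (canon₈₃W ν μ κ ig cz pf dv bm hc) (canon₁₇₈ μ) where
  unitaryLR := True.intro
  descent := fun h => h
  levelRaising := fun d u => ⟨d, u⟩

end Canon178

/-- AT THE TOP (every input of the three DAGs; section 83's reading `canon₈₃T`): the bundle holds and all three fields of row C172 HOLD — delivered by the tranche's `thorne_of_mokInputs` over
`canon_implications₈₃W` and `mokInputs_top`, the control by its own edge. [cite: Thorne2014RaisingLevel, Prop. 2.4 (1), Thms 6.7, 7.1, 1.1 (bookkeeping proved here)] [claim: KalethaMinguezShinWhite2014, under-review] -/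
theorem c178_top :
    Implications178 (canon₈₃T νtop μtop κtop) (canon₁₇₈ μtop) ∧
      (canon₁₇₈ μtop).ThorneUnitaryLR ∧ (canon₁₇₈ μtop).ThorneDescent ∧ (canon₁₇₈ μtop).ThorneLevelRaising :=
  have Y : Implications178 (canon₈₃T νtop μtop κtop) (canon₁₇₈ μtop) := canon_implications₁₇₈ νtop μtop κtop _ _ _ _ _ _
  have h := thorne_of_mokInputs Y (canon_implications₈₃W νtop μtop κtop (canon νtop μtop κtop) (canon₂₅ νtop μtop κtop) (canon₂₇ νtop μtop κtop) True) mokInputs_top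
  ⟨Y, thorne_control Y, h.1, h.2⟩

/-- BOOK SIDE: in the book countermodel of ANY of the 24 leaves `l` (Mok and KMSW at the top; section 83's reading over the countermodel) the leaf fails, every other book leaf holds, the
bundle holds and ALL THREE fields of C172 HOLD — no leaf of the book's own DAG is load-bearing for the row as typed (the book is not in its bibliography; Mok enters through [CT]). [cite: Thorne2014RaisingLevel, Prop. 2.4, proof (fms-2-e16-thorne-vor p0011:L4-10) (separating models; bookkeeping proved here)] [claim: KalethaMinguezShinWhite2014, under-review] -/
theorem c178_book_cm (l : LeafSupport.Leaf) :
    ¬ (LeafSupport.mkN (LeafSupport.cm l)).leaf l ∧ (∀ l', l' ≠ l → (LeafSupport.mkN (LeafSupport.cm l)).leaf l') ∧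
      Implications178 (canon₈₃T (LeafSupport.mkN (LeafSupport.cm l)) μtop κtop) (canon₁₇₈ μtop) ∧
      ((canon₁₇₈ μtop).ThorneUnitaryLR ∧ (canon₁₇₈ μtop).ThorneDescent ∧ (canon₁₇₈ μtop).ThorneLevelRaising) :=
  have cmod := LeafSupport.countermodel l
  have m : ∀ N, μtop.Everything N := mokInputs_top.everything
  ⟨cmod.2.2.1, cmod.2.1, canon_implications₁₇₈ _ _ _ _ _ _ _ _ _, ⟨True.intro, m, ⟨m, True.intro⟩⟩⟩

/-- MOK SIDE, EXACT SUPPORT AS TYPED: with the book at the top, Mok read by the countermodel of ANY of its 29 leaves `l` and KMSW WITHOUT its Mok import (`κnoMok`), section 83's reading over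
these: the Mok leaf fails, every other Mok leaf holds, the bundle holds, Proposition 2.4 (1) and Theorem 7.1 / 1.1 FAIL, the control HOLDS — row C210's `c83_mok_cm` behaviour inherited
through « The first part is proved in [CT, Proposition 2.9] … uses the results of [Mok] ». [cite: Thorne2014RaisingLevel, Prop. 2.4, proof (fms-2-e16-thorne-vor p0011:L4-10), Thm 7.1, proof (p0030:L27-31); ClozelThorne2014LevelRaisingI, Prop. 2.9 (3) (separating models; bookkeeping proved here)] [claim: KalethaMinguezShinWhite2014, under-review] -/
theorem c178_mok_cm (l : Mok2015.LeafSupport.Leaf) :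
    ¬ (Mok2015.LeafSupport.mkN (Mok2015.LeafSupport.cm l)).leaf l ∧ (∀ l', l' ≠ l → (Mok2015.LeafSupport.mkN (Mok2015.LeafSupport.cm l)).leaf l') ∧
      Implications178 (canon₈₃T νtop (Mok2015.LeafSupport.mkN (Mok2015.LeafSupport.cm l)) κnoMok) (canon₁₇₈ (Mok2015.LeafSupport.mkN (Mok2015.LeafSupport.cm l))) ∧
      (¬ (canon₁₇₈ (Mok2015.LeafSupport.mkN (Mok2015.LeafSupport.cm l))).ThorneDescent ∧ ¬ (canon₁₇₈ (Mok2015.LeafSupport.mkN (Mok2015.LeafSupport.cm l))).ThorneLevelRaising) ∧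
      (canon₁₇₈ (Mok2015.LeafSupport.mkN (Mok2015.LeafSupport.cm l))).ThorneUnitaryLR :=
  have cmod := Mok2015.LeafSupport.countermodel l
  have nm := not_M_cm l
  ⟨cmod.2.2.1, cmod.2.1, canon_implications₁₇₈ _ _ _ _ _ _ _ _ _, ⟨nm, fun h => nm h.1⟩, True.intro⟩

/-- The CONTROL FIELD of C172 (Theorems 4.6 / 6.7) holds in the canonical reading for EVERY μ — no leaf of any DAG. [cite: Thorne2014RaisingLevel, Thms 4.6, 6.7 (bookkeeping proved here)] -/
theorem c178_control (μ : Mok2015.Nodes) : (canon₁₇₈ μ).ThorneUnitaryLR :=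
  True.intro

/-- THE HUNDRED-AND-SEVENTY-EIGHTH TRANCHE REGRADED, in one statement: (i) at the top all three fields hold; (ii) in the book countermodel of any of the 24 book leaves all three fields hold;
(iii) in Mok's countermodel of any of the 29 Mok leaves the descent and the main theorem fail while the leaf alone fails and the control holds.  Supports, exact: support(`ThorneDescent`) =
support(`ThorneLevelRaising`) = Mok's 29 leaves (= support of row C210); support(`ThorneUnitaryLR`) = ∅; no book leaf, no KMSW leaf. [cite: Thorne2014RaisingLevel, Prop. 2.4, Thms 6.7, 7.1, 1.1 (bookkeeping proved here)] [claim: KalethaMinguezShinWhite2014, under-review] -/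
theorem c178_regraded :
    ((canon₁₇₈ μtop).ThorneUnitaryLR ∧ (canon₁₇₈ μtop).ThorneDescent ∧ (canon₁₇₈ μtop).ThorneLevelRaising) ∧
      (∀ l : LeafSupport.Leaf, ¬ (LeafSupport.mkN (LeafSupport.cm l)).leaf l ∧
        ((canon₁₇₈ μtop).ThorneUnitaryLR ∧ (canon₁₇₈ μtop).ThorneDescent ∧ (canon₁₇₈ μtop).ThorneLevelRaising)) ∧
      (∀ l : Mok2015.LeafSupport.Leaf, ¬ (Mok2015.LeafSupport.mkN (Mok2015.LeafSupport.cm l)).leaf l ∧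
        (∀ l', l' ≠ l → (Mok2015.LeafSupport.mkN (Mok2015.LeafSupport.cm l)).leaf l') ∧
        ¬ (canon₁₇₈ (Mok2015.LeafSupport.mkN (Mok2015.LeafSupport.cm l))).ThorneDescent ∧ ¬ (canon₁₇₈ (Mok2015.LeafSupport.mkN (Mok2015.LeafSupport.cm l))).ThorneLevelRaising ∧
        (canon₁₇₈ (Mok2015.LeafSupport.mkN (Mok2015.LeafSupport.cm l))).ThorneUnitaryLR) :=
  ⟨c178_top.2, fun l => ⟨(c178_book_cm l).1, (c178_book_cm l).2.2.2⟩,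
    fun l => ⟨(c178_mok_cm l).1, (c178_mok_cm l).2.1, (c178_mok_cm l).2.2.2.1.1, (c178_mok_cm l).2.2.2.1.2, (c178_mok_cm l).2.2.2.2⟩⟩

/-! ## 181. Hundred-and-seventy-ninth tranche (v11 of this file, after `Downstream48.lean` v4; unit `pub-arthur-down-g73`, downstream tracer gen 73): supports of ROW C102, H. Grobner,
*On the residual Eisenstein cohomology of unitary groups*, arXiv:2608.15947v2 (`Consumers179`: `GrobnerBC` = Thm 1.6 ⇐ Mok ∧ KMSW's starred statements `κ.Full` ∧ row A6
`Consumers.ChenZou`; `GrobnerTempered` = Thm 1.7 / (1.8) ⇐ Thm 1.6 ∧ `κ.Scope` ∧ A6; `GrobnerPoles` = Thm 2.14 ⇐ Thm 1.7 ∧ Mok ∧ A6; `GrobnerMain` = Thm 4.6 ⇐ Thms 2.14, 1.7;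
`GrobnerExample` = Thm 4.11 ⇐ Thm 4.6 ∧ Mok).  The canonical reading `canon₁₇₉ ν μ κ` gives each field the conjunction of its premises' canonical values, written out in full (A6 read from section 1's `canon`, whose `ChenZou` := the book ∧ Mok at every rank; no auxiliary
`Prop` abbreviations — the gate's fact accounting counts a bare `abbrev … : Prop` as a named fact); every tranche-179 edge holds in it for arbitrary ν, μ, κ (`canon_implications₁₇₉`).  READINGS:
(i) AT THE TOP the bundle holds and all five fields HOLD — delivered by the tranche's own `grobner_of_inputs` over `canon_implications`, `bookInputs_top`, `mokInputs_top` and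
`kmswInputs_top` (whose second component grants KMSW's two unwritten sequels) (`c179_top`); (ii) BOOK SIDE: in each of the 24 book countermodels (Mok and KMSW at the top) the bundle holds
and ALL FIVE fields FAIL — the book's leaves are load-bearing through row A6 (`c179_book_cm`); (iii) MOK SIDE: with the book at the top, Mok read by the countermodel of ANY of its 29 leaves
and KMSW without its Mok import (`κnoMok`), all five FAIL (`c179_mok_cm`); (iv) KMSW SIDE: with the book and Mok at the top and KMSW read by the countermodel of ANY of its 13 other leaves,
all five FAIL (`c179_kmsw_cm`) — and in the countermodels of the three leaves that feed only the starred statements (`AubertSS`, `KMS_A`, `KMS_B`: `Leaf.onlyFull`) KMSW's PROVED SCOPE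
HOLDS at every rank while Theorem 1.6 and the whole chain still FAIL (`c179_kmsw_sequel_cm`): the typed premise « Thm$.^*$ 1.7.1 » carries the unwritten sequels into the row, as
typed.  Supports, exact: support(each of the five fields) = the 24 book leaves ∪ Mok's 29 leaves ∪ KMSW's 13 non-import leaves (sequel leaves included); no control, no node. -/

section Canon179

variable (ν : Nodes) (μ : Mok2015.Nodes) (κ : KMSW2014.Nodes)

/-- The canonical reading of row C102 (each field := the conjunction of its premises' canonical values, written out — Theorem 1.6's value M ∧ F ∧ CZ with M = Mok at every rank, F = KMSW's starred statements, CZ = A6's canonical value; Theorem 1.7's = it ∧ KMSW's proved scope ∧ CZ; and so on along the edges). [cite: Grobner2026ResidualEisensteinUnitary, Thms 1.6, 1.7, 2.14, 4.6, 4.11 (canonical model; bookkeeping)] [claim: KalethaMinguezShinWhite2014, under-review] -/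
abbrev canon₁₇₉ : Consumers179 where
  GrobnerBC := (∀ N, μ.Everything N) ∧ (∀ N, κ.Full N) ∧ (canon ν μ κ).ChenZou
  GrobnerTempered := ((∀ N, μ.Everything N) ∧ (∀ N, κ.Full N) ∧ (canon ν μ κ).ChenZou) ∧ (∀ N, κ.Scope N) ∧ (canon ν μ κ).ChenZou
  GrobnerPoles := (((∀ N, μ.Everything N) ∧ (∀ N, κ.Full N) ∧ (canon ν μ κ).ChenZou) ∧ (∀ N, κ.Scope N) ∧ (canon ν μ κ).ChenZou) ∧ (∀ N, μ.Everything N) ∧ (canon ν μ κ).ChenZou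
  GrobnerMain := ((((∀ N, μ.Everything N) ∧ (∀ N, κ.Full N) ∧ (canon ν μ κ).ChenZou) ∧ (∀ N, κ.Scope N) ∧ (canon ν μ κ).ChenZou) ∧ (∀ N, μ.Everything N) ∧ (canon ν μ κ).ChenZou) ∧ (((∀ N, μ.Everything N) ∧ (∀ N, κ.Full N) ∧ (canon ν μ κ).ChenZou) ∧ (∀ N, κ.Scope N) ∧ (canon ν μ κ).ChenZou)
  GrobnerExample := (((((∀ N, μ.Everything N) ∧ (∀ N, κ.Full N) ∧ (canon ν μ κ).ChenZou) ∧ (∀ N, κ.Scope N) ∧ (canon ν μ κ).ChenZou) ∧ (∀ N, μ.Everything N) ∧ (canon ν μ κ).ChenZou) ∧ (((∀ N, μ.Everything N) ∧ (∀ N, κ.Full N) ∧ (canon ν μ κ).ChenZou) ∧ (∀ N, κ.Scope N) ∧ (canon ν μ κ).ChenZou)) ∧ (∀ N, μ.Everything N)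

/-- Every hundred-and-seventy-ninth-tranche edge holds in the canonical reading, for arbitrary ν, μ, κ (A6 read from section 1's `canon`). [cite: Grobner2026ResidualEisensteinUnitary, Thms 1.6–4.11 (bookkeeping proved here)] [claim: KalethaMinguezShinWhite2014, under-review] -/
theorem canon_implications₁₇₉ : Implications179 μ κ (canon ν μ κ) (canon₁₇₉ ν μ κ) where
  bc := fun m f z => ⟨m, f, z⟩
  tempered := fun b s z => ⟨b, s, z⟩
  poles := fun t m z => ⟨t, m, z⟩
  main := fun p t => ⟨p, t⟩
  example179 := fun h m => ⟨h, m⟩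

end Canon179

/-- AT THE TOP (every input of the three DAGs, KMSW's two unwritten sequels included): the bundle holds and all five fields of row C102 HOLD — delivered by the tranche's `grobner_of_inputs`
over `canon_implications`, `bookInputs_top`, `mokInputs_top`, `kmswInputs_top`. [cite: Grobner2026ResidualEisensteinUnitary, Thms 1.6, 1.7, 2.14, 4.6, 4.11 (bookkeeping proved here)] [claim: KalethaMinguezShinWhite2014, under-review] -/
theorem c179_top :
    Implications179 μtop κtop (canon νtop μtop κtop) (canon₁₇₉ νtop μtop κtop) ∧
      (canon₁₇₉ νtop μtop κtop).GrobnerBC ∧ (canon₁₇₉ νtop μtop κtop).GrobnerTempered ∧ (canon₁₇₉ νtop μtop κtop).GrobnerPoles ∧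
      (canon₁₇₉ νtop μtop κtop).GrobnerMain ∧ (canon₁₇₉ νtop μtop κtop).GrobnerExample :=
  have Y := canon_implications₁₇₉ νtop μtop κtop
  have KQ := kmswInputs_top μtop
  ⟨Y, grobner_of_inputs Y (canon_implications νtop μtop κtop) bookInputs_top mokInputs_top KQ.1 KQ.2⟩

/-- BOOK SIDE: in the book countermodel of ANY of the 24 leaves `l` (Mok and KMSW at the top) the leaf fails, every other book leaf holds, the bundle holds and ALL FIVE fields of C102 FAIL —
the book's leaves are load-bearing through row A6 (Chen – Zou, « Thm.\ 2.1 and Prop.\ 4.1 in the latter reference »), whose canonical value is the book ∧ Mok. [cite: Grobner2026ResidualEisensteinUnitary, Thm 1.6, proof (src-2608.15947v2 l.377) (separating models; bookkeeping proved here)] [claim: KalethaMinguezShinWhite2014, under-review] -/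
theorem c179_book_cm (l : LeafSupport.Leaf) :
    ¬ (LeafSupport.mkN (LeafSupport.cm l)).leaf l ∧ (∀ l', l' ≠ l → (LeafSupport.mkN (LeafSupport.cm l)).leaf l') ∧
      Implications179 μtop κtop (canon (LeafSupport.mkN (LeafSupport.cm l)) μtop κtop) (canon₁₇₉ (LeafSupport.mkN (LeafSupport.cm l)) μtop κtop) ∧
      (¬ (canon₁₇₉ (LeafSupport.mkN (LeafSupport.cm l)) μtop κtop).GrobnerBC ∧ ¬ (canon₁₇₉ (LeafSupport.mkN (LeafSupport.cm l)) μtop κtop).GrobnerTempered ∧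
        ¬ (canon₁₇₉ (LeafSupport.mkN (LeafSupport.cm l)) μtop κtop).GrobnerPoles ∧ ¬ (canon₁₇₉ (LeafSupport.mkN (LeafSupport.cm l)) μtop κtop).GrobnerMain ∧
        ¬ (canon₁₇₉ (LeafSupport.mkN (LeafSupport.cm l)) μtop κtop).GrobnerExample) :=
  have cmod := LeafSupport.countermodel l
  have nb := not_B_cm l
  ⟨cmod.2.2.1, cmod.2.1, canon_implications₁₇₉ _ _ _,
    ⟨fun h => nb h.2.2.1, fun h => nb h.2.2.1, fun h => nb h.2.2.1, fun h => nb h.2.2.2.1, fun h => nb h.1.2.2.2.1⟩⟩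

/-- MOK SIDE: with the book at the top, Mok read by the countermodel of ANY of its 29 leaves `l` and KMSW WITHOUT its Mok import (`κnoMok`): the Mok leaf fails, every other Mok leaf holds,
the bundle holds and ALL FIVE fields FAIL (« culminating in \cite{mok} », « the local results of Mok », « \cite{mok}, Thm.\ 2.5.4 »). [cite: Grobner2026ResidualEisensteinUnitary, Thm 1.6, proof (l.377), §2.2 (l.492), Thm 4.11, proof (l.1208) (separating models; bookkeeping proved here)] [claim: KalethaMinguezShinWhite2014, under-review] -/
theorem c179_mok_cm (l : Mok2015.LeafSupport.Leaf) :
    ¬ (Mok2015.LeafSupport.mkN (Mok2015.LeafSupport.cm l)).leaf l ∧ (∀ l', l' ≠ l → (Mok2015.LeafSupport.mkN (Mok2015.LeafSupport.cm l)).leaf l') ∧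
      Implications179 (Mok2015.LeafSupport.mkN (Mok2015.LeafSupport.cm l)) κnoMok (canon νtop (Mok2015.LeafSupport.mkN (Mok2015.LeafSupport.cm l)) κnoMok)
        (canon₁₇₉ νtop (Mok2015.LeafSupport.mkN (Mok2015.LeafSupport.cm l)) κnoMok) ∧
      (¬ (canon₁₇₉ νtop (Mok2015.LeafSupport.mkN (Mok2015.LeafSupport.cm l)) κnoMok).GrobnerBC ∧
        ¬ (canon₁₇₉ νtop (Mok2015.LeafSupport.mkN (Mok2015.LeafSupport.cm l)) κnoMok).GrobnerTempered ∧
        ¬ (canon₁₇₉ νtop (Mok2015.LeafSupport.mkN (Mok2015.LeafSupport.cm l)) κnoMok).GrobnerPoles ∧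
        ¬ (canon₁₇₉ νtop (Mok2015.LeafSupport.mkN (Mok2015.LeafSupport.cm l)) κnoMok).GrobnerMain ∧
        ¬ (canon₁₇₉ νtop (Mok2015.LeafSupport.mkN (Mok2015.LeafSupport.cm l)) κnoMok).GrobnerExample) :=
  have cmod := Mok2015.LeafSupport.countermodel l
  have nm := not_M_cm l
  ⟨cmod.2.2.1, cmod.2.1, canon_implications₁₇₉ _ _ _,
    ⟨fun h => nm h.1, fun h => nm h.1.1, fun h => nm h.2.1, fun h => nm h.2.1.1, fun h => nm h.2⟩⟩

/-- KMSW SIDE: with the book and Mok at the top and KMSW read by the countermodel of ANY of its leaves `l` other than the Mok import: the KMSW leaf fails, every other KMSW leaf holds, the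
bundle holds and ALL FIVE fields FAIL — Theorem 1.6 cites « Thm$.^*$ 1.7.1 », KMSW's starred statements in full, which fail at every rank in all thirteen countermodels. [cite: Grobner2026ResidualEisensteinUnitary, Thm 1.6, proof (l.377) (separating models; bookkeeping proved here)] [claim: KalethaMinguezShinWhite2014, under-review] -/
theorem c179_kmsw_cm (l : KMSW2014.LeafSupport.Leaf) (hl : l ≠ .MokMain) :
    ¬ (KMSW2014.LeafSupport.mkN (KMSW2014.LeafSupport.cm l)).leaf l ∧ (∀ l', l' ≠ l → (KMSW2014.LeafSupport.mkN (KMSW2014.LeafSupport.cm l)).leaf l') ∧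
      (KMSW2014.LeafSupport.mkN (KMSW2014.LeafSupport.cm l)).leaf .MokMain ∧
      Implications179 μtop (KMSW2014.LeafSupport.mkN (KMSW2014.LeafSupport.cm l)) (canon νtop μtop (KMSW2014.LeafSupport.mkN (KMSW2014.LeafSupport.cm l)))
        (canon₁₇₉ νtop μtop (KMSW2014.LeafSupport.mkN (KMSW2014.LeafSupport.cm l))) ∧
      (¬ (canon₁₇₉ νtop μtop (KMSW2014.LeafSupport.mkN (KMSW2014.LeafSupport.cm l))).GrobnerBC ∧
        ¬ (canon₁₇₉ νtop μtop (KMSW2014.LeafSupport.mkN (KMSW2014.LeafSupport.cm l))).GrobnerTempered ∧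
        ¬ (canon₁₇₉ νtop μtop (KMSW2014.LeafSupport.mkN (KMSW2014.LeafSupport.cm l))).GrobnerPoles ∧
        ¬ (canon₁₇₉ νtop μtop (KMSW2014.LeafSupport.mkN (KMSW2014.LeafSupport.cm l))).GrobnerMain ∧
        ¬ (canon₁₇₉ νtop μtop (KMSW2014.LeafSupport.mkN (KMSW2014.LeafSupport.cm l))).GrobnerExample) :=
  have cmod := KMSW2014.LeafSupport.countermodel l
  have nf : ¬ ∀ N, (KMSW2014.LeafSupport.mkN (KMSW2014.LeafSupport.cm l)).Full N :=
    fun h => KMSW2014.LeafSupport.not_full_of_noFull (cmod.2.2.2 0) (h 0)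
  ⟨cmod.2.2.1, cmod.2.1, cmod.2.1 .MokMain (Ne.symm hl), canon_implications₁₇₉ _ _ _,
    ⟨fun h => nf h.2.1, fun h => nf h.1.2.1, fun h => nf h.1.1.2.1, fun h => nf h.2.1.2.1, fun h => nf h.1.2.1.2.1⟩⟩

/-- THE SEQUEL LEAVES ARE LOAD-BEARING AS TYPED: in the KMSW countermodel of any leaf that feeds ONLY the starred statements (`AubertSS`, `KMS_A`, `KMS_B`), with the book and Mok at the
top, KMSW's PROVED SCOPE HOLDS at every rank and row A6 holds — yet Theorem 1.6 and with it Theorems 1.7, 2.14, 4.6, 4.11 FAIL: the printed ground « Thm$.^*$ 1.7.1 » (base change for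
every square-integrable π of every U(V)) exceeds KMSW's proved scope, and the footnote's flag does not name the sequels. [cite: Grobner2026ResidualEisensteinUnitary, Thm 1.6, proof and footnote 1 (l.377) (separating models; bookkeeping proved here)] [claim: KalethaMinguezShinWhite2014, under-review] -/
theorem c179_kmsw_sequel_cm (l : KMSW2014.LeafSupport.Leaf) (h : l.onlyFull = true) :
    (∀ N, (KMSW2014.LeafSupport.mkN (KMSW2014.LeafSupport.cm l)).Scope N) ∧ (canon νtop μtop (KMSW2014.LeafSupport.mkN (KMSW2014.LeafSupport.cm l))).ChenZou ∧
      ¬ (canon₁₇₉ νtop μtop (KMSW2014.LeafSupport.mkN (KMSW2014.LeafSupport.cm l))).GrobnerBC ∧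
      ¬ (canon₁₇₉ νtop μtop (KMSW2014.LeafSupport.mkN (KMSW2014.LeafSupport.cm l))).GrobnerMain ∧
      ¬ (canon₁₇₉ νtop μtop (KMSW2014.LeafSupport.mkN (KMSW2014.LeafSupport.cm l))).GrobnerExample :=
  have cmod := KMSW2014.LeafSupport.countermodel l
  have nf : ¬ ∀ N, (KMSW2014.LeafSupport.mkN (KMSW2014.LeafSupport.cm l)).Full N :=
    fun h' => KMSW2014.LeafSupport.not_full_of_noFull (cmod.2.2.2 0) (h' 0)
  ⟨scope_of_onlyFull l h, ⟨bookInputs_top.everything, mokInputs_top.everything⟩, fun h' => nf h'.2.1, fun h' => nf h'.2.1.2.1, fun h' => nf h'.1.2.1.2.1⟩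

/-- THE HUNDRED-AND-SEVENTY-NINTH TRANCHE REGRADED, in one statement: (i) at the top all five fields hold; (ii) in the book countermodel of any of the 24 book leaves all five fail; (iii) in
Mok's countermodel of any of the 29 Mok leaves all five fail; (iv) in KMSW's countermodel of any of its 13 non-import leaves all five fail, the proved scope surviving when the leaf feeds
only the starred statements.  Supports, exact: support(`GrobnerBC`) = support(`GrobnerTempered`) = support(`GrobnerPoles`) = support(`GrobnerMain`) = support(`GrobnerExample`) = the 24
book leaves ∪ Mok's 29 leaves ∪ KMSW's 13 non-import leaves; no control. [cite: Grobner2026ResidualEisensteinUnitary, Thms 1.6, 1.7, 2.14, 4.6, 4.11 (bookkeeping proved here)] [claim: KalethaMinguezShinWhite2014, under-review] -/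
theorem c179_regraded :
    ((canon₁₇₉ νtop μtop κtop).GrobnerBC ∧ (canon₁₇₉ νtop μtop κtop).GrobnerTempered ∧ (canon₁₇₉ νtop μtop κtop).GrobnerPoles ∧ (canon₁₇₉ νtop μtop κtop).GrobnerMain ∧
        (canon₁₇₉ νtop μtop κtop).GrobnerExample) ∧
      (∀ l : LeafSupport.Leaf, ¬ (LeafSupport.mkN (LeafSupport.cm l)).leaf l ∧
        ¬ (canon₁₇₉ (LeafSupport.mkN (LeafSupport.cm l)) μtop κtop).GrobnerBC ∧ ¬ (canon₁₇₉ (LeafSupport.mkN (LeafSupport.cm l)) μtop κtop).GrobnerMain ∧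
        ¬ (canon₁₇₉ (LeafSupport.mkN (LeafSupport.cm l)) μtop κtop).GrobnerExample) ∧
      (∀ l : Mok2015.LeafSupport.Leaf, ¬ (Mok2015.LeafSupport.mkN (Mok2015.LeafSupport.cm l)).leaf l ∧
        ¬ (canon₁₇₉ νtop (Mok2015.LeafSupport.mkN (Mok2015.LeafSupport.cm l)) κnoMok).GrobnerBC ∧
        ¬ (canon₁₇₉ νtop (Mok2015.LeafSupport.mkN (Mok2015.LeafSupport.cm l)) κnoMok).GrobnerMain ∧
        ¬ (canon₁₇₉ νtop (Mok2015.LeafSupport.mkN (Mok2015.LeafSupport.cm l)) κnoMok).GrobnerExample) ∧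
      (∀ l : KMSW2014.LeafSupport.Leaf, l ≠ .MokMain → ¬ (KMSW2014.LeafSupport.mkN (KMSW2014.LeafSupport.cm l)).leaf l ∧
        ¬ (canon₁₇₉ νtop μtop (KMSW2014.LeafSupport.mkN (KMSW2014.LeafSupport.cm l))).GrobnerBC ∧
        ¬ (canon₁₇₉ νtop μtop (KMSW2014.LeafSupport.mkN (KMSW2014.LeafSupport.cm l))).GrobnerMain ∧
        ¬ (canon₁₇₉ νtop μtop (KMSW2014.LeafSupport.mkN (KMSW2014.LeafSupport.cm l))).GrobnerExample ∧
        (l.onlyFull = true → ∀ N, (KMSW2014.LeafSupport.mkN (KMSW2014.LeafSupport.cm l)).Scope N)) :=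
  ⟨c179_top.2,
    fun l => ⟨(c179_book_cm l).1, (c179_book_cm l).2.2.2.1, (c179_book_cm l).2.2.2.2.2.2.1, (c179_book_cm l).2.2.2.2.2.2.2⟩,
    fun l => ⟨(c179_mok_cm l).1, (c179_mok_cm l).2.2.2.1, (c179_mok_cm l).2.2.2.2.2.2.1, (c179_mok_cm l).2.2.2.2.2.2.2⟩,
    fun l hl => ⟨(c179_kmsw_cm l hl).1, (c179_kmsw_cm l hl).2.2.2.2.1, (c179_kmsw_cm l hl).2.2.2.2.2.2.2.1, (c179_kmsw_cm l hl).2.2.2.2.2.2.2.2,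
      fun h => scope_of_onlyFull l h⟩⟩

end Support

end Downstream

end Literature.NumberTheory.Automorphic.Arthur2013
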